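import Summits.ValiantsHypothesis.ValiantsHypothesis.Theorems.SymPencilPerFourSingularLocusSupportPatterns
import Mathlib.Algebra.Module.Submodule.Union
import Mathlib.Algebra.CharZero.Infinite

/-!
# The `6`-dimensional linear subspaces of `Sing Z(per₄)` — THEOREM A (T6′), sorry-free
(port candidate of the crux workfile `Cruxes/SdcSuperquadratic/Lines/sing_six_classification.lean`,
rev 2.6, val-idea-18 g3/g4, lens cascade; memo `Cruxes/SdcSuperquadratic/SING-SIX-CLASSIFICATION.md`)

**Theorem A** (`sixDim_classification`).  Let `K` be a field of characteristic `0` and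
`W ≤ K^{4×4}` a linear subspace of dimension `6` on which all `3 × 3` subpermanents vanish
(`Sing3 W`, i.e. `W ⊆ Sing Z(per₄)`).  Then `W` lies in a cross `X_{lc}` (`InCross`), or has two
identically-zero rows (`TwoZeroRows`) or two identically-zero columns (`TwoZeroCols`), or — up to
`S₄ × S₄` — is one of the two one-zero-row exotic families
`V_λ = row a ⊕ K(αE_{bc}+βE_{bc'}) ⊕ K(αE_{b'c}−βE_{b'c'})` (`αβ ≠ 0`; `VLambdaRows`, cf.
`SymPencilPerFourSixDimExotic`) and `V^gr = row a ⊕ K(E_{bc}+c₀E_{b'c}) ⊕ K(E_{bc'}−c₀E_{b'c'})`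
(`c₀ ≠ 0`; `VGraphRows`), or the transpose of one of them (`VLambdaCols`, `VGraphCols`).
Also **T5** (`zeroLine` / `fiveDim_crossOrZeroLine`): a `W ⊆ Sing Z(per₄)` of dimension `≥ 5` lies
in a cross or has an identically-zero row or column.

PROOF STRUCTURE.  Leaf 1 (`zeroLine`): Part A
(`SymPencilPerFourSingularLocusSupportPatterns.support_of_subperm_vanish`) puts every `x ∈ W` in one
of `42` coordinate subspaces (`piece`: 4 rows, 4 columns, 16 crosses, 18 proper anti-blocks); over an
infinite field `W` lies in ONE of them (`Submodule.exists_forall_notMem_of_forall_ne_top`); a proper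
anti-block `[[0,P],[Q,0]]` forces a zero row once `dim W ≥ 5` (`anti_case`: the subpermanents
`per(P)·q`, `per(Q)·p` vanish, polarisation along `x ± x₀`, and totally isotropic subspaces of
`p₁₁p₂₂ + p₁₂p₂₁` have dimension `≤ 2`, `iso_le_two`).  Leaf 2 (`zeroLineResidue`): a `6`-dimensional
singular `W` with a zero row is normalised (`transport`: `rowPermL`, `transposeL`) to `NormSix`; with
`A_i = row_i(W)`, `K_i = ker row_i|_W`, `n_i = dim A_i`, the `3 × 3` subpermanents are the symmetric
trilinear `T3` (`permanent_submatrix_eq_T3`, polarisation `polar`), perm-orthogonality `PermOrth`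
(`pairPerm v w p q = v_p w_q + v_q w_p`) is its rank-drop shadow (`permOrth_of_T3`,
`permOrth_of_T3_on`), and the case tree is: some `n_r = 4` (`caseFour_of`: the kernel plane `K_r` is
PURE, a PRODUCT or a GRAPH — `perpPlanes`/`permOrthPairs` — handled by `casePure_of pureCore`,
`caseProduct_of productAbsorb`, `caseGraph_of (graphAbsorb_of productAbsorb)`, all resting on the
ABSORPTION MASTER LEMMA `T3_absorb_all`), or `max n_r = 3` (`caseThree_of`), or all `n_r ≤ 2`
(`toricStructure`, `toricTriple` via the kernel-pair lemma `smallKer`).  Everything is kernel-checked;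
`#print axioms sixDim_classification` = `propext, Classical.choice, Quot.sound`.

NOT A LOWER BOUND: `27 ≤ sdc(per₄) ≤ 29` is unchanged, stmt-5674 `SdcSuperquadratic` stays open,
`VP ≠ VNP` is not moved, and no summit statement is proved here.  (The per-direction six-square LIST of
the workfile — leaves 3–5 — is deliberately NOT in this file.) [folklore]
-/

noncomputable section

set_option linter.dupNamespace false
set_option linter.unusedVariables false
set_option linter.unusedSectionVars false

namespace Summit.ValiantsHypothesis.ValiantsHypothesis.Cruxes.SdcSuperquadratic.SingSixClassification

open Module

variable {K : Type*} [Field K]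

/-- `W ⊆ Sing Z(per₄)`: all `3 × 3` subpermanents vanish on `W` (the tree's convention). -/
def Sing3 (W : Submodule K (Fin 4 × Fin 4 → K)) : Prop :=
  ∀ x ∈ W, ∀ (r c : Fin 3 → Fin 4), Function.Injective r → Function.Injective c →
    ((Matrix.of fun i j => x (i, j)).submatrix r c).permanent = 0

/-- `W` lies in the cross `X_{lc} = row l ∪ column c`. -/
def InCross (W : Submodule K (Fin 4 × Fin 4 → K)) : Prop :=
  ∃ l c : Fin 4, ∀ x ∈ W, ∀ i j : Fin 4, i ≠ l → j ≠ c → x (i, j) = 0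

/-- Two identically-zero rows on `W`. -/
def TwoZeroRows (W : Submodule K (Fin 4 × Fin 4 → K)) : Prop :=
  ∃ p q : Fin 4, p ≠ q ∧ ∀ x ∈ W, ∀ j : Fin 4, x (p, j) = 0 ∧ x (q, j) = 0

/-- Two identically-zero columns on `W`. -/
def TwoZeroCols (W : Submodule K (Fin 4 × Fin 4 → K)) : Prop :=
  ∃ p q : Fin 4, p ≠ q ∧ ∀ x ∈ W, ∀ i : Fin 4, x (i, p) = 0 ∧ x (i, q) = 0

/-- `W = V_λ` up to `S₄ × S₄`: zero row `ρ 0`, free row `ρ 1`, row `ρ 2 ∈ K(α e_{γ0} + β e_{γ1})`,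
row `ρ 3 ∈ K(α e_{γ0} − β e_{γ1})`, `αβ ≠ 0` (`SymPencilPerFourSixDimExotic`: `ρ = γ = 1`, `α = β = 1`). -/
def VLambdaRows (W : Submodule K (Fin 4 × Fin 4 → K)) : Prop :=
  ∃ (ρ γ : Equiv.Perm (Fin 4)) (α β : K), α ≠ 0 ∧ β ≠ 0 ∧
    ∀ x : Fin 4 × Fin 4 → K, x ∈ W ↔
      ((∀ j, x (ρ 0, j) = 0) ∧
       (∃ s : K, ∀ j, x (ρ 2, γ j) = s * ![α, β, 0, 0] j) ∧
       (∃ t : K, ∀ j, x (ρ 3, γ j) = t * ![α, -β, 0, 0] j))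

/-- Transposed `V_λ`: zero column `γ 0`, free column `γ 1`, columns `γ 2, γ 3` as above. -/
def VLambdaCols (W : Submodule K (Fin 4 × Fin 4 → K)) : Prop :=
  ∃ (ρ γ : Equiv.Perm (Fin 4)) (α β : K), α ≠ 0 ∧ β ≠ 0 ∧
    ∀ x : Fin 4 × Fin 4 → K, x ∈ W ↔
      ((∀ i, x (i, γ 0) = 0) ∧
       (∃ s : K, ∀ i, x (ρ i, γ 2) = s * ![α, β, 0, 0] i) ∧
       (∃ t : K, ∀ i, x (ρ i, γ 3) = t * ![α, -β, 0, 0] i))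

/-- `W = V^gr` up to `S₄ × S₄` (NEW exotic family): zero row `ρ 0`, free row `ρ 1`, rows `ρ 2, ρ 3`
supported on columns `γ 0, γ 1` with `x_{ρ3,γ0} = c₀ x_{ρ2,γ0}`, `x_{ρ3,γ1} = −c₀ x_{ρ2,γ1}`, `c₀ ≠ 0`;
i.e. `row ρ1 ⊕ K(E_{ρ2,γ0} + c₀E_{ρ3,γ0}) ⊕ K(E_{ρ2,γ1} − c₀E_{ρ3,γ1})`. -/
def VGraphRows (W : Submodule K (Fin 4 × Fin 4 → K)) : Prop :=
  ∃ (ρ γ : Equiv.Perm (Fin 4)) (c₀ : K), c₀ ≠ 0 ∧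
    ∀ x : Fin 4 × Fin 4 → K, x ∈ W ↔
      ((∀ j, x (ρ 0, j) = 0) ∧
       x (ρ 2, γ 2) = 0 ∧ x (ρ 2, γ 3) = 0 ∧ x (ρ 3, γ 2) = 0 ∧ x (ρ 3, γ 3) = 0 ∧
       x (ρ 3, γ 0) = c₀ * x (ρ 2, γ 0) ∧ x (ρ 3, γ 1) = -(c₀ * x (ρ 2, γ 1)))

/-- Transposed `V^gr`. -/
def VGraphCols (W : Submodule K (Fin 4 × Fin 4 → K)) : Prop :=
  ∃ (ρ γ : Equiv.Perm (Fin 4)) (c₀ : K), c₀ ≠ 0 ∧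
    ∀ x : Fin 4 × Fin 4 → K, x ∈ W ↔
      ((∀ i, x (i, γ 0) = 0) ∧
       x (ρ 2, γ 2) = 0 ∧ x (ρ 3, γ 2) = 0 ∧ x (ρ 2, γ 3) = 0 ∧ x (ρ 3, γ 3) = 0 ∧
       x (ρ 0, γ 3) = c₀ * x (ρ 0, γ 2) ∧ x (ρ 1, γ 3) = -(c₀ * x (ρ 1, γ 2)))



/-! ## Leaf 2 — the one-zero-line residue: SECOND-LEVEL SPLIT (rev 2/2.1, val-idea-18 g4; price P1 of val-idea-crit-5 VERDICT #5 / R194 (a))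

The `L`-sized leaf `stub_zeroLineResidue` of rev 1 is now the DERIVED theorem `zeroLineResidue`
(sorry-free composition) of the typed cascade below.  Normal form: `NormSix W` = `W` singular,
`6`-dimensional, row `0` identically zero; the three live rows are addressed through a permutation `ρ`
of `Fin 4` with `ρ 0 = 0` (`r, s, t = ρ 1, ρ 2, ρ 3`); `A_i = W.map (rowL i)` (row space, `n_i` its
dimension), `K_r = W ⊓ ker (rowL r)` (kernel plane).

TREE (memo §3; every `stub_*` is ONE leaf; sizes are Lean guesses S ≈ ½ day, M ≈ 1–2 days, L ≈ 3+ days):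
* `zeroLineResidue_of : Transport → CaseFour → CaseThree → ToricStructure → ToricTriple → leaf 2`
  (PROVED: the trichotomy `some n_r = 4 ∨ (all ≤ 3, some = 3) ∨ all n_r ≤ 2` and the toric glue);
* `caseFour_of : PerpPlanes → CasePure → CaseProduct → CaseGraph → CaseFour`
  (PROVED: `dim K_r = 2` by rank–nullity, POLARISATION §3.1 (`polar`, PROVED) makes every element of
  `K_r` a perm-orthogonal pair of rows, and the four kernel-plane types of `PerpPlanes` are dispatched,
  the second pure type through `ρ ∘ (2 3)`);
* `pureCore_of : SBShape → LemmaPhi → PureCore` (PROVED, unused since rev 2.4) and `pureCore : PureCore`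
  (PROVED rev 2.4 from the absorption master lemma `T3_absorb_all` / `permOrth_absorb`);
* TOOLS (self-contained algebra over `K⁴`, no `W`): `permOrthPairs` (§3.3, PROVED rev 2.1),
  `productAbsorb` (§3.5 / C12, PROVED rev 2.4: transport `T3_perm` to `j = 0, c = 1` + a `16`-unknown
  linear system), `graphAbsorb_of : ProductAbsorb → GraphAbsorb` (C13, PROVED rev 2.4: `χ ± e φ` are
  absorbed by `e_j`, `e_c`), `perpPlanes : PermOrthPairs → PerpPlanes` (§3.3 rulings + covering,
  PROVED rev 2.5), `toricTriple : PermOrthPairs → ToricTriple` (§3.8, PROVED rev 2.5 by the kernel-pair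
  lemma `smallKer` + `coordPair_of_cover` + `toric_caseI`; no `SBShape` — `SBShape`, `LemmaPhi` remain
  as `def`s only);
* CASES (`W`-level; each ≤ one page on paper GIVEN its tool, which it takes as hypothesis):
  `casePure_of : PureCore → CasePure` (§3.6 (i), PROVED rev 2.2), `caseProduct_of : ProductAbsorb →
  CaseProduct` (§3.6 (ii), PROVED rev 2.3), `caseGraph_of : GraphAbsorb → CaseGraph` (§3.6 (iii),
  PROVED rev 2.3), `caseThree_of : PerpPlanes → CaseThree` (§3.7, PROVED rev 2.3 via the rank drop
  `permOrth_of_T3_on` and `kerPlane_pure_of_three`); `toricStructure` (§3.8, linear algebra) and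
  `transport` (`S₄ × S₄ × ⟨ᵀ⟩` transport to the normal form) are PROVED (rev 2.1).
REMAINING residue stubs: NONE (rev 2.5) — leaf 2 is closed; leaf 1 is closed too (rev 2.6, section «Leaf 1»
below), so THEOREM A `sixDim_classification` is sorry-free; the skeleton's open stubs are the LIST leaves 3, 4, 5.
Conventions: `pairPerm v w p q = v_p w_q + v_q w_p` (the memo's `m_{pq}(v,w)`), `T3 u v w l` = the
`3 × 3` permanent of the rows `u, v, w` off column `l` (`= (P(v,w)u)_l`; symmetric, trilinear —
PROVED), `PermOrth v w` = `v ⊥ w`.  The memo's COMPLEMENTARY arrangement `P(v,w)_{ab} = m_{{a,b}ᶜ}(v,w)`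
is spelled out where it matters (`SBShape`, `LemmaPhi`).  Exact sanity checks of the four freshly
typed tool statements in exactly these conventions: `leaf2_stub_checks.py` (evidence on stmt-5674;
C12′ ProductAbsorb incl. `αβ = 0`, C13′ GraphAbsorb, 3.2′ SBShape on 655 random/sparse planes + all
shapes, 3.4′ LemmaPhi for shapes 0/C1/C2/C3/C3′: 4/4 PASS).  [folklore] -/

/-! ### Notation for the residue cascade -/

/-- Row `i` of a `4 × 4` array. -/
def row (x : Fin 4 × Fin 4 → K) (i : Fin 4) : Fin 4 → K := fun j => x (i, j)

/-- Row extraction as a linear map. -/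
def rowL (i : Fin 4) : (Fin 4 × Fin 4 → K) →ₗ[K] (Fin 4 → K) where
  toFun x := row x i
  map_add' x y := rfl
  map_smul' c x := rfl

@[simp] theorem rowL_apply (i : Fin 4) (x : Fin 4 × Fin 4 → K) : rowL i x = row x i := rfl
@[simp] theorem row_apply (x : Fin 4 × Fin 4 → K) (i j : Fin 4) : row x i j = x (i, j) := rfl
theorem row_add (x y : Fin 4 × Fin 4 → K) (i : Fin 4) : row (x + y) i = row x i + row y i := rfl
theorem row_smul (c : K) (x : Fin 4 × Fin 4 → K) (i : Fin 4) : row (c • x) i = c • row x i := rfl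
theorem row_sub (x y : Fin 4 × Fin 4 → K) (i : Fin 4) : row (x - y) i = row x i - row y i := rfl

/-- The `2 × 2` permanent of the pair `(v ; w)` on the columns `p, q`: `m_{pq}(v,w) = v_p w_q + v_q w_p`. -/
def pairPerm (v w : Fin 4 → K) (p q : Fin 4) : K := v p * w q + v q * w p

/-- `v ⊥ w` (perm-orthogonal, memo §3.3): every `2 × 2` permanent of `(v ; w)` vanishes. -/
def PermOrth (v w : Fin 4 → K) : Prop := ∀ p q : Fin 4, p ≠ q → pairPerm v w p q = 0

/-- The symmetric trilinear form `T3 u v w l` = permanent of the `3 × 3` array with rows `u, v, w` on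
the three columns `≠ l` (`permanent_submatrix_eq_T3`); `= (P(v,w) u)_l` in the memo's notation. -/
def T3 (u v w : Fin 4 → K) (l : Fin 4) : K :=
  u (l.succAbove 0) * (v (l.succAbove 1) * w (l.succAbove 2) + v (l.succAbove 2) * w (l.succAbove 1)) +
  u (l.succAbove 1) * (v (l.succAbove 0) * w (l.succAbove 2) + v (l.succAbove 2) * w (l.succAbove 0)) +
  u (l.succAbove 2) * (v (l.succAbove 0) * w (l.succAbove 1) + v (l.succAbove 1) * w (l.succAbove 0))

/-- `α e_j + β e_c`. -/
def lvec (j c : Fin 4) (α β : K) : Fin 4 → K := α • Pi.single j 1 + β • Pi.single c 1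

/-- Sign flip of the `c`-th coordinate (the memo's `σ = diag(1,-1)` on `span(e_j, e_c)`). -/
def flipAt (c : Fin 4) (v : Fin 4 → K) : Fin 4 → K := fun i => if i = c then -v i else v i

/-- Two vectors with disjoint supports (the shapes `0, C1, C2, C3, C3′` of memo §3.2). -/
def DisjSupp (ℓ₁ ℓ₂ : Fin 4 → K) : Prop := ∀ i, ℓ₁ i = 0 ∨ ℓ₂ i = 0

/-- NORMAL FORM of the residue: `W ⊆ Sing`, `dim W = 6`, row `0 ≡ 0` on `W`. -/
def NormSix (W : Submodule K (Fin 4 × Fin 4 → K)) : Prop :=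
  Sing3 W ∧ finrank K W = 6 ∧ ∀ x ∈ W, row x 0 = 0

/-- The seven-way conclusion of T6′ for `W`. -/
def Concl (W : Submodule K (Fin 4 × Fin 4 → K)) : Prop :=
  InCross W ∨ TwoZeroRows W ∨ TwoZeroCols W ∨
    VLambdaRows W ∨ VGraphRows W ∨ VLambdaCols W ∨ VGraphCols W

/-! ### Proved basics: `T3` is the subpermanent; symmetric, trilinear; polarisation -/

theorem T3_swap₁₂ (u v w : Fin 4 → K) (l : Fin 4) : T3 u v w l = T3 v u w l := by
  unfold T3; ring
theorem T3_swap₂₃ (u v w : Fin 4 → K) (l : Fin 4) : T3 u v w l = T3 u w v l := by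
  unfold T3; ring
theorem T3_swap₁₃ (u v w : Fin 4 → K) (l : Fin 4) : T3 u v w l = T3 w v u l := by
  unfold T3; ring
theorem T3_add₁ (u u' v w : Fin 4 → K) (l : Fin 4) : T3 (u + u') v w l = T3 u v w l + T3 u' v w l := by
  simp only [T3, Pi.add_apply]; ring
theorem T3_smul₁ (c : K) (u v w : Fin 4 → K) (l : Fin 4) : T3 (c • u) v w l = c * T3 u v w l := by
  simp only [T3, Pi.smul_apply, smul_eq_mul]; ring
theorem T3_add₃ (u v w w' : Fin 4 → K) (l : Fin 4) : T3 u v (w + w') l = T3 u v w l + T3 u v w' l := by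
  simp only [T3, Pi.add_apply]; ring
theorem T3_smul₃ (c : K) (u v w : Fin 4 → K) (l : Fin 4) : T3 u v (c • w) l = c * T3 u v w l := by
  simp only [T3, Pi.smul_apply, smul_eq_mul]; ring
theorem T3_add₂ (u v v' w : Fin 4 → K) (l : Fin 4) : T3 u (v + v') w l = T3 u v w l + T3 u v' w l := by
  simp only [T3, Pi.add_apply]; ring
theorem T3_smul₂ (c : K) (u v w : Fin 4 → K) (l : Fin 4) : T3 u (c • v) w l = c * T3 u v w l := by
  simp only [T3, Pi.smul_apply, smul_eq_mul]; ring
theorem T3_zero₁ (v w : Fin 4 → K) (l : Fin 4) : T3 0 v w l = 0 := by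
  simp [T3]
theorem T3_zero₃ (u v : Fin 4 → K) (l : Fin 4) : T3 u v 0 l = 0 := by
  simp [T3]

/-- The `3 × 3` subpermanent of `x` on the rows `r₁, r₂, r₃` and the columns `≠ l` is `T3`. -/
theorem permanent_submatrix_eq_T3 (x : Fin 4 × Fin 4 → K) (r₁ r₂ r₃ l : Fin 4) :
    ((Matrix.of fun i j => x (i, j)).submatrix ![r₁, r₂, r₃] l.succAbove).permanent =
      T3 (row x r₁) (row x r₂) (row x r₃) l := by
  rw [Matrix.permanent_fin_three_row]
  simp [Matrix.submatrix_apply, T3, row]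

/-- `Sing3` yields `T3 = 0` on any three distinct rows. -/
theorem T3_eq_zero_of_sing3 {W : Submodule K (Fin 4 × Fin 4 → K)} (hS : Sing3 W)
    {x : Fin 4 × Fin 4 → K} (hx : x ∈ W) (r₁ r₂ r₃ : Fin 4) (h₁₂ : r₁ ≠ r₂) (h₁₃ : r₁ ≠ r₃)
    (h₂₃ : r₂ ≠ r₃) (l : Fin 4) : T3 (row x r₁) (row x r₂) (row x r₃) l = 0 := by
  rw [← permanent_submatrix_eq_T3]
  refine hS x hx _ _ ?_ Fin.succAbove_right_injective
  intro a b hab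
  fin_cases a <;> fin_cases b <;> simp_all

/-- **Polarisation** (memo §3.1): if `x, k ∈ W` and row `r` of `k` vanishes, then
`T3 (row x r) (row k s) (row k t) = 0` (the `t²`-coefficient of `T3` along `x + t k`). -/
theorem polar [CharZero K] {W : Submodule K (Fin 4 × Fin 4 → K)} (hS : Sing3 W)
    {r s t : Fin 4} (hrs : r ≠ s) (hrt : r ≠ t) (hst : s ≠ t)
    {x : Fin 4 × Fin 4 → K} (hx : x ∈ W) {k : Fin 4 × Fin 4 → K} (hk : k ∈ W)
    (hkr : row k r = 0) (l : Fin 4) : T3 (row x r) (row k s) (row k t) l = 0 := by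
  have h0 := T3_eq_zero_of_sing3 hS hx r s t hrs hrt hst l
  have h1 := T3_eq_zero_of_sing3 hS (W.add_mem hx hk) r s t hrs hrt hst l
  have h2 := T3_eq_zero_of_sing3 hS (W.sub_mem hx hk) r s t hrs hrt hst l
  rw [row_add, row_add, row_add, hkr, add_zero] at h1
  rw [row_sub, row_sub, row_sub, hkr, sub_zero] at h2
  have e1 : T3 (row x r) (row x s + row k s) (row x t + row k t) l =
      T3 (row x r) (row x s) (row x t) l + T3 (row x r) (row x s) (row k t) l +
        T3 (row x r) (row k s) (row x t) l + T3 (row x r) (row k s) (row k t) l := by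
    simp only [T3, Pi.add_apply]; ring
  have e2 : T3 (row x r) (row x s - row k s) (row x t - row k t) l =
      T3 (row x r) (row x s) (row x t) l - T3 (row x r) (row x s) (row k t) l -
        T3 (row x r) (row k s) (row x t) l + T3 (row x r) (row k s) (row k t) l := by
    simp only [T3, Pi.sub_apply]; ring
  have h3 : (2 : K) * T3 (row x r) (row k s) (row k t) l = 0 := by
    linear_combination h1 + h2 - 2 * h0 - e1 - e2
  rcases mul_eq_zero.mp h3 with h | h
  · exact absurd h two_ne_zero
  · exact h

/-- `T3 u v w = 0` for all `u` forces `v ⊥ w` (take `u = e_j`). -/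
theorem permOrth_of_T3 {v w : Fin 4 → K} (h : ∀ u l, T3 u v w l = 0) : PermOrth v w := by
  intro p q hpq
  fin_cases p <;> fin_cases q
  all_goals (first | exact absurd rfl hpq | skip)
  · have := h (Pi.single 2 1) 3; simpa [T3, Fin.succAbove, pairPerm, Pi.single_apply] using this
  · have := h (Pi.single 1 1) 3; simpa [T3, Fin.succAbove, pairPerm, Pi.single_apply] using this
  · have := h (Pi.single 1 1) 2; simpa [T3, Fin.succAbove, pairPerm, Pi.single_apply] using this
  · have := h (Pi.single 2 1) 3; simpa [T3, Fin.succAbove, pairPerm, Pi.single_apply, add_comm, mul_comm] using this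
  · have := h (Pi.single 0 1) 3; simpa [T3, Fin.succAbove, pairPerm, Pi.single_apply] using this
  · have := h (Pi.single 0 1) 2; simpa [T3, Fin.succAbove, pairPerm, Pi.single_apply] using this
  · have := h (Pi.single 1 1) 3; simpa [T3, Fin.succAbove, pairPerm, Pi.single_apply, add_comm, mul_comm] using this
  · have := h (Pi.single 0 1) 3; simpa [T3, Fin.succAbove, pairPerm, Pi.single_apply, add_comm, mul_comm] using this
  · have := h (Pi.single 0 1) 1; simpa [T3, Fin.succAbove, pairPerm, Pi.single_apply] using this
  · have := h (Pi.single 1 1) 2; simpa [T3, Fin.succAbove, pairPerm, Pi.single_apply, add_comm, mul_comm] using this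
  · have := h (Pi.single 0 1) 2; simpa [T3, Fin.succAbove, pairPerm, Pi.single_apply, add_comm, mul_comm] using this
  · have := h (Pi.single 0 1) 1; simpa [T3, Fin.succAbove, pairPerm, Pi.single_apply, add_comm, mul_comm] using this

/-- Conversely `v ⊥ w` gives `T3 u v w = 0`. -/
theorem T3_eq_zero_of_permOrth {v w : Fin 4 → K} (h : PermOrth v w) (u : Fin 4 → K) (l : Fin 4) :
    T3 u v w l = 0 := by
  fin_cases l
  · have h12 := h 1 2 (by decide); have h13 := h 1 3 (by decide); have h23 := h 2 3 (by decide)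
    simp only [pairPerm] at h12 h13 h23
    simp [T3, Fin.succAbove]
    linear_combination u 1 * h23 + u 2 * h13 + u 3 * h12
  · have h02 := h 0 2 (by decide); have h03 := h 0 3 (by decide); have h23 := h 2 3 (by decide)
    simp only [pairPerm] at h02 h03 h23
    simp [T3, Fin.succAbove]
    linear_combination u 0 * h23 + u 2 * h03 + u 3 * h02
  · have h01 := h 0 1 (by decide); have h03 := h 0 3 (by decide); have h13 := h 1 3 (by decide)
    simp only [pairPerm] at h01 h03 h13
    simp [T3, Fin.succAbove]
    linear_combination u 0 * h13 + u 1 * h03 + u 3 * h01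
  · have h01 := h 0 1 (by decide); have h02 := h 0 2 (by decide); have h12 := h 1 2 (by decide)
    simp only [pairPerm] at h01 h02 h12
    simp [T3, Fin.succAbove]
    linear_combination u 0 * h12 + u 1 * h02 + u 2 * h01


/-! ### Tool statements (self-contained linear algebra over `K⁴`; no `W`) -/

/-- **§3.3 PERM-ORTHOGONAL PAIRS** (S).  If `v ⊥ w` then `v = 0`, or `w = 0`, or both are supported on
a common pair of coordinates `{j, c}` (and then `v_j w_c + v_c w_j = 0` is the remaining content of `⊥`).
Proof: if `v, w ≠ 0`, then for `p ∈ supp v ∌ q` the relation `m_{pq} = v_p w_q = 0` forces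
`supp w ⊆ supp v`, so the two supports agree; on a common support of size `≥ 3` the ratios `w_p / v_p`
would be pairwise opposite — impossible in characteristic `≠ 2`.
[Check C8: exhaustive over `F₇`.] [folklore] -/
def PermOrthPairs (K : Type*) [Field K] : Prop :=
  ∀ v w : Fin 4 → K, PermOrth v w → v = 0 ∨ w = 0 ∨
    ∃ j c : Fin 4, j ≠ c ∧ ∀ i, i ≠ j → i ≠ c → v i = 0 ∧ w i = 0

/-- **§3.3 KERNEL-PLANE TYPES** (M; uses `PermOrthPairs`).  Let `D` be a linear space of `4 × 4`
arrays supported on two rows `s ≠ t`, of dimension `≥ 2`, all of whose elements `d` have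
`row_s d ⊥ row_t d`.  Then row `s` vanishes on `D`, or row `t` does, or `dim D = 2` and `D` is a RULING
PLANE of one quadric `Q_{jc} = {(v, w) ∈ span(e_j,e_c)² : v_j w_c + v_c w_j = 0}`: the PRODUCT plane
`K(αe_j+βe_c) × K(αe_j−βe_c)` (`(α,β) ≠ 0`; `αβ = 0` allowed) or the GRAPH plane
`Γ_e = {(v, e·σv)}`, `σ = diag(1,−1)` on `(j,c)`, `e ≠ 0`.  Proof: `D ⊆ {v=0} ∪ {w=0} ∪ ⋃ Q_{jc}`
pointwise (`PermOrthPairs`); a vector space over the infinite field `K` is not a finite union of proper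
subspaces, so `D` lies in `{v = 0}`, `{w = 0}` or one `span(e_j,e_c)²`, and there inside the rank-`4`
quadric `Q_{jc}`, whose maximal isotropic subspaces are the `2`-planes of its two rulings. [folklore] -/
def PerpPlanes (K : Type*) [Field K] : Prop :=
  ∀ (D : Submodule K (Fin 4 × Fin 4 → K)) (s t : Fin 4), s ≠ t →
    (∀ d ∈ D, ∀ i, i ≠ s → i ≠ t → row d i = 0) → 2 ≤ finrank K D →
    (∀ d ∈ D, PermOrth (row d s) (row d t)) →
    (∀ d ∈ D, row d s = 0) ∨ (∀ d ∈ D, row d t = 0) ∨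
    (finrank K D = 2 ∧
      ((∃ (j c : Fin 4) (α β : K), j ≠ c ∧ (α ≠ 0 ∨ β ≠ 0) ∧
          ∀ d, d ∈ D ↔ ((∀ i, i ≠ s → i ≠ t → row d i = 0) ∧
            (∃ μ : K, row d s = μ • lvec j c α β) ∧ (∃ ν : K, row d t = ν • lvec j c α (-β)))) ∨
       (∃ (j c : Fin 4) (e : K), j ≠ c ∧ e ≠ 0 ∧
          ∀ d, d ∈ D ↔ ((∀ i, i ≠ s → i ≠ t → row d i = 0) ∧
            (∀ i, i ≠ j → i ≠ c → d (s, i) = 0 ∧ d (t, i) = 0) ∧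
            d (t, j) = e * d (s, j) ∧ d (t, c) = -(e * d (s, c))))))

/-- **§3.2 THE SPACE `S(B)`** (M).  For a subspace `B ⊆ K⁴` of dimension `≥ 2`, the pairs `(v, w)`
with `P(v,w) B = 0` (i.e. `T3 b v w = 0` for all `b ∈ B`) have ALL their `2 × 2` permanents
proportional to ONE fixed pattern: there are `ℓ₁, ℓ₂` with disjoint supports (the disjoint-support
basis of `B^⊥` when it exists — shapes C1, C2, C3, C3′ — and `ℓ₁ = ℓ₂ = 0` otherwise, in particular
whenever `dim B ≥ 3`) such that `m_{pq}(v,w) = μ · m_{ab}(ℓ₁,ℓ₂)` for `{a,b} = {p,q}ᶜ` (complementary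
arrangement: `P(v,w) = μ (ℓ₁ℓ₂ᵀ + ℓ₂ℓ₁ᵀ)`).  Ingredients: `P(v,w)` is symmetric with zero diagonal;
such a matrix of rank `≤ 1` is `0` (R) and one of rank `2` is `ℓ₁ℓ₂ᵀ + ℓ₂ℓ₁ᵀ` with `ℓ₁, ℓ₂` of disjoint
supports (H); `B ⊆ ker P(v,w)`.  [Check 3.2′: 655 random/sparse planes + all shapes.] [folklore] -/
def SBShape (K : Type*) [Field K] : Prop :=
  ∀ B : Submodule K (Fin 4 → K), 2 ≤ finrank K B →
    ∃ ℓ₁ ℓ₂ : Fin 4 → K, DisjSupp ℓ₁ ℓ₂ ∧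
      ∀ v w : Fin 4 → K, (∀ b ∈ B, ∀ l, T3 b v w l = 0) →
        ∃ μ : K, ∀ p q a b : Fin 4, p ≠ q → a ≠ b → a ≠ p → a ≠ q → b ≠ p → b ≠ q →
          pairPerm v w p q = μ * pairPerm ℓ₁ ℓ₂ a b

/-- **§3.4 LEMMA Φ** (M; a linear system in the `16` entries of `φ`, shape by shape).  If
`φ : K⁴ → K⁴` is linear and, for every `u`, the `2 × 2` permanents of `(u, φu)` are proportional to the
fixed complementary pattern of a disjoint-support pair `(ℓ₁, ℓ₂)` (shapes `0, C1, C2, C3, C3′`), then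
`φ = 0`.  Proof: polarise `uφ(u)ᵀ + φ(u)uᵀ ≡ μ(u) M₀ (mod diagonal)` at `(e_i, e_j)` and read off the
entries (memo §3.4 (1)–(4)); uses characteristic `≠ 2`.  [Checks C7 and 3.4′.] [folklore] -/
def LemmaPhi (K : Type*) [Field K] : Prop :=
  ∀ (φ : (Fin 4 → K) →ₗ[K] (Fin 4 → K)) (ℓ₁ ℓ₂ : Fin 4 → K), DisjSupp ℓ₁ ℓ₂ →
    (∀ u, ∃ μ : K, ∀ p q a b : Fin 4, p ≠ q → a ≠ b → a ≠ p → a ≠ q → b ≠ p → b ≠ q →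
        pairPerm u (φ u) p q = μ * pairPerm ℓ₁ ℓ₂ a b) → φ = 0

/-- **PURE-PLANE CORE** (PROVED rev 2.4 as `pureCore`; also `= SBShape + LemmaPhi`, `pureCore_of`):
a linear `φ` with `P(u, φu) B = 0` for all `u` and a `≥ 2`-dimensional `B` vanishes. [folklore] -/
def PureCore (K : Type*) [Field K] : Prop :=
  ∀ (φ : (Fin 4 → K) →ₗ[K] (Fin 4 → K)) (B : Submodule K (Fin 4 → K)), 2 ≤ finrank K B →
    (∀ u, ∀ b ∈ B, ∀ l, T3 u (φ u) b l = 0) → φ = 0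

/-- **§3.5 / C12 PRODUCT ABSORPTION** (M).  For `a = αe_j + βe_c ≠ 0` and `b = αe_j − βe_c`:
a linear `χ` with `P(u, a) χ(u) = 0` for all `u` takes values in `K b`
(`ker P(a,u) = K b` for generic `u`, memo §3.5; also for `αβ = 0`).  [Checks C6, C12, C12′.] [folklore] -/
def ProductAbsorb (K : Type*) [Field K] : Prop :=
  ∀ (j c : Fin 4) (α β : K) (χ : (Fin 4 → K) →ₗ[K] (Fin 4 → K)), j ≠ c → (α ≠ 0 ∨ β ≠ 0) →
    (∀ u l, T3 u (lvec j c α β) (χ u) l = 0) → ∀ u, ∃ μ : K, χ u = μ • lvec j c α (-β)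

/-- **C13 GRAPH ABSORPTION** (M).  For `e ≠ 0` and linear `φ, χ` with
`P(u, v) χ(u) + e · P(u, σv) φ(u) = 0` for all `u` and all `v ∈ span(e_j, e_c)` (`σ` = sign flip at
`c`): `φ` takes values in `span(e_j, e_c)` and `χ = e · σ ∘ φ`.  [Checks C13, C13′.] [folklore] -/
def GraphAbsorb (K : Type*) [Field K] : Prop :=
  ∀ (j c : Fin 4) (e : K) (φ χ : (Fin 4 → K) →ₗ[K] (Fin 4 → K)), j ≠ c → e ≠ 0 →
    (∀ u v : Fin 4 → K, (∀ i, i ≠ j → i ≠ c → v i = 0) → ∀ l,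
        T3 u v (χ u) l + e * T3 u (flipAt c v) (φ u) l = 0) →
    ∀ u, (∀ i, i ≠ j → i ≠ c → φ u i = 0) ∧ χ u = e • flipAt c (φ u)

/-- **§3.8 TORIC TRIPLE LEMMA** (PROVED rev 2.5 as `toricTriple : PermOrthPairs → ToricTriple`, without
the memo's shapes C1–C3′ / `SBShape`).  Three `2`-planes `A₁, A₂, A₃ ⊆ K⁴` with `T3 (a₁, a₂, a₃) = 0`
identically (i.e. `P(a₂,a₃) A₁ = 0`) have two common zero coordinates `p ≠ q` (in fact
`A₁ = A₂ = A₃ = span(e_r, e_s)`).  Proof: the symmetric zero-diagonal matrices killing the `2`-plane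
`A₁` form a LINE (kernel-pair lemma `smallKer`), so for each `a₃` the plane `{P(a₂,a₃) : a₂ ∈ A₂}`
contains `0`: a perpendicular partner; by `PermOrthPairs` every `a₃` sits on a coordinate pair, by a
finite-union argument `A₃` on ONE pair, so `e_j ∈ A₃`, and a coordinate vector propagates
(`toric_caseI`).  [Check C9: exhaustive over `F₅`.] [folklore] -/
def ToricTriple (K : Type*) [Field K] : Prop :=
  ∀ A₁ A₂ A₃ : Submodule K (Fin 4 → K), finrank K A₁ = 2 → finrank K A₂ = 2 → finrank K A₃ = 2 →
    (∀ a₁ ∈ A₁, ∀ a₂ ∈ A₂, ∀ a₃ ∈ A₃, ∀ l, T3 a₁ a₂ a₃ l = 0) →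
    ∃ p q : Fin 4, p ≠ q ∧ (∀ a ∈ A₁, a p = 0 ∧ a q = 0) ∧ (∀ a ∈ A₂, a p = 0 ∧ a q = 0) ∧
      (∀ a ∈ A₃, a p = 0 ∧ a q = 0)

/-! ### Case statements (`W`-level; `r, s, t = ρ 1, ρ 2, ρ 3`, `ρ 0 = 0` the zero row) -/

/-- **§3.6 (i) PURE KERNEL PLANE** (M given `PureCore`).  If `n_r = 4` and row `s` vanishes on
`K_r = W ∩ {row r = 0}`, then row `s` vanishes on all of `W` (so `W` has the two zero rows `0, s`).
Proof: choose a linear section `u ↦ (0; u; φu; χu)` of `row_r : W → K⁴`; `B := row_t (K_r)` is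
`2`-dimensional; `T3 (u, φu, b) = 0` for `b ∈ B` (the `t¹`-coefficient of `Sing` along `x + t k`,
`k = (0;0;0;b) ∈ K_r`); `PureCore` gives `φ = 0`; `W = section + K_r`. [folklore] -/
def CasePure (K : Type*) [Field K] : Prop :=
  ∀ (W : Submodule K (Fin 4 × Fin 4 → K)) (ρ : Equiv.Perm (Fin 4)), NormSix W → ρ 0 = 0 →
    W.map (rowL (ρ 1)) = ⊤ → (∀ k ∈ W, row k (ρ 1) = 0 → row k (ρ 2) = 0) →
    ∀ x ∈ W, row x (ρ 2) = 0

/-- **§3.6 (ii) PRODUCT KERNEL PLANE** (M given `ProductAbsorb`).  If `n_r = 4` and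
`K_r = {(0; 0; μa; νb)}` with `a = αe_j+βe_c`, `b = αe_j−βe_c`, then `W = {(0; u; μa; νb)}`:
for `αβ ≠ 0` this is `V_λ` (`VLambdaRows`), for `αβ = 0` it lies in the cross `X_{r j'}` (`InCross`).
Proof: section `(0;u;φu;χu)`; the `t¹`-coefficients of `Sing` along `K_r` give
`P(u,a)χ(u) = 0 = P(u,b)φ(u)`; `ProductAbsorb` (and its `β ↦ -β` instance) puts `χu ∈ Kb`, `φu ∈ Ka`,
which are absorbed into `K_r`; dimension count `4 + 2 = 6`. [folklore] -/
def CaseProduct (K : Type*) [Field K] : Prop :=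
  ∀ (W : Submodule K (Fin 4 × Fin 4 → K)) (ρ : Equiv.Perm (Fin 4)) (j c : Fin 4) (α β : K),
    NormSix W → ρ 0 = 0 → W.map (rowL (ρ 1)) = ⊤ → j ≠ c → (α ≠ 0 ∨ β ≠ 0) →
    (∀ k, k ∈ W ∧ row k (ρ 1) = 0 ↔
      ((∀ i, i ≠ ρ 2 → i ≠ ρ 3 → row k i = 0) ∧
        (∃ μ : K, row k (ρ 2) = μ • lvec j c α β) ∧ (∃ ν : K, row k (ρ 3) = ν • lvec j c α (-β)))) →
    VLambdaRows W ∨ InCross W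

/-- **§3.6 (iii) GRAPH KERNEL PLANE** (M given `GraphAbsorb`).  If `n_r = 4` and `K_r` is the graph
plane `Γ_e` on `(j, c)`, then `W = {(0; u; v; e·σv) : v ∈ span(e_j,e_c)} = V^gr` (`VGraphRows`, with
`γ 0 = j`, `γ 1 = c`, `c₀ = e`).  Proof: section; the `t¹`-coefficient of `Sing` along `K_r` is the
hypothesis of `GraphAbsorb`; absorb `(0;0;φu;χu) ∈ K_r`; dimension count. [folklore] -/
def CaseGraph (K : Type*) [Field K] : Prop :=
  ∀ (W : Submodule K (Fin 4 × Fin 4 → K)) (ρ : Equiv.Perm (Fin 4)) (j c : Fin 4) (e : K),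
    NormSix W → ρ 0 = 0 → W.map (rowL (ρ 1)) = ⊤ → j ≠ c → e ≠ 0 →
    (∀ k, k ∈ W ∧ row k (ρ 1) = 0 ↔
      ((∀ i, i ≠ ρ 2 → i ≠ ρ 3 → row k i = 0) ∧
        (∀ i, i ≠ j → i ≠ c → k (ρ 2, i) = 0 ∧ k (ρ 3, i) = 0) ∧
        k (ρ 3, j) = e * k (ρ 2, j) ∧ k (ρ 3, c) = -(e * k (ρ 2, c)))) →
    VGraphRows W

/-- **CASE `n_r = 4`** (assembled from the kernel-plane types and the three sub-cases by `caseFour_of`,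
PROVED). [folklore] -/
def CaseFour (K : Type*) [Field K] : Prop :=
  ∀ (W : Submodule K (Fin 4 × Fin 4 → K)) (ρ : Equiv.Perm (Fin 4)), NormSix W → ρ 0 = 0 →
    W.map (rowL (ρ 1)) = ⊤ → Concl W

/-- **§3.7 CASE `max n_r = 3`** (M given `PerpPlanes`; uses `polar`).  If every live `n_i ≤ 3` and
`n_r = 3`, then two rows vanish on `W`.  Proof: `K_r` is `3`-dimensional and `A_r` (a hyperplane) lies in
`ker P(v', w')` for `(v', w') ∈ K_r`, so `rank P(v',w') ≤ 1`, hence `P = 0` (zero-diagonal symmetric):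
`K_r` consists of perm-orthogonal pairs and `PerpPlanes` (dim `3`) makes it PURE, say row `s ≡ 0` on
`K_r`, row `t` injective on `K_r`; then `n_t = 3`, `K_t` is pure too, and either row `s ≡ 0` on
`W = K_r ⊕ K_t`, or `K_t ⊆ K_r` contradicts `dim K_t = 3`. [folklore] -/
def CaseThree (K : Type*) [Field K] : Prop :=
  ∀ (W : Submodule K (Fin 4 × Fin 4 → K)) (ρ : Equiv.Perm (Fin 4)), NormSix W → ρ 0 = 0 →
    (∀ i, i ≠ 0 → finrank K (W.map (rowL i)) ≤ 3) → finrank K (W.map (rowL (ρ 1))) = 3 →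
    TwoZeroRows W

/-- **§3.8 TORIC PRODUCT STRUCTURE** (S; pure linear algebra, no `Sing`).  If `dim W = 6`, row `0`
vanishes on `W` and every live `n_i ≤ 2`, then every live `n_i = 2` and
`W = {x : row₀ x = 0, rowᵢ x ∈ Aᵢ}` is the full product of its three row spaces
(`W ↪ A₁ × A₂ × A₃` and `6 ≤ n₁ + n₂ + n₃ ≤ 6`). [folklore] -/
def ToricStructure (K : Type*) [Field K] : Prop :=
  ∀ W : Submodule K (Fin 4 × Fin 4 → K), finrank K W = 6 → (∀ x ∈ W, row x 0 = 0) →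
    (∀ i, i ≠ 0 → finrank K (W.map (rowL i)) ≤ 2) →
    (∀ i, i ≠ 0 → finrank K (W.map (rowL i)) = 2) ∧
      ∀ x : Fin 4 × Fin 4 → K, row x 0 = 0 → (∀ i, i ≠ 0 → row x i ∈ W.map (rowL i)) → x ∈ W

/-- The normal-form residue theorem: `NormSix W → Concl W` (`residueNorm_of`, PROVED from the cases). -/
def ResidueNorm (K : Type*) [Field K] : Prop :=
  ∀ W : Submodule K (Fin 4 × Fin 4 → K), NormSix W → Concl W

/-- **SYMMETRY TRANSPORT** (S/M; bookkeeping).  `Sing3` is invariant under row permutations and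
transposition (`Matrix.permanent_permute_rows/cols`, `Matrix.permanent_transpose`; `Sing3` quantifies
over ALL injective row/column selections), `finrank` is preserved by the linear equivalences
`x ↦ x ∘ (σ × id)` / `x ↦ xᵀ`, and the seven predicates of `Concl` are permuted among themselves
(rows ↔ cols under ᵀ; the index data `ρ, γ, l, c, p, q` are composed with `σ`).  So the normal form
(the zero row moved to row `0`; a zero column first transposed to a zero row) suffices. [folklore] -/
def Transport (K : Type*) [Field K] : Prop :=
  ResidueNorm K → ∀ W : Submodule K (Fin 4 × Fin 4 → K), Sing3 W → finrank K W = 6 →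
    ((∃ i : Fin 4, ∀ x ∈ W, ∀ j : Fin 4, x (i, j) = 0) ∨
      (∃ j : Fin 4, ∀ x ∈ W, ∀ i : Fin 4, x (i, j) = 0)) → Concl W

/-! ### The residue cascade (rev 2.5: no stubs left — `permOrthPairs`, `transport` are proved here;
`toricStructure`, the tools and the four CASES further below) -/

/-- **§3.3 PERM-ORTHOGONAL PAIRS — PROVED** (rev 2.1; was `stub_permOrthPairs`). -/
theorem permOrthPairs [CharZero K] : PermOrthPairs K := by
  intro v w h
  by_cases hv : v = 0
  · exact Or.inl hv
  by_cases hw : w = 0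
  · exact Or.inr (Or.inl hw)
  refine Or.inr (Or.inr ?_)
  obtain ⟨p, hp⟩ : ∃ p, v p ≠ 0 := Function.ne_iff.mp hv
  obtain ⟨q₀, hq₀⟩ : ∃ q, w q ≠ 0 := Function.ne_iff.mp hw
  have hA : ∀ q, v q = 0 → w q = 0 := by
    intro q hq
    have hpq : p ≠ q := by rintro rfl; exact hp hq
    have e := h p q hpq
    simp only [pairPerm, hq, zero_mul, add_zero] at e
    exact (mul_eq_zero.mp e).resolve_left hp
  have hB : ∀ q, w q = 0 → v q = 0 := by
    intro q hq
    have hpq : q₀ ≠ q := by rintro rfl; exact hq₀ hq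
    have e := h q₀ q hpq
    simp only [pairPerm, hq, mul_zero, zero_add] at e
    exact (mul_eq_zero.mp e).resolve_right hq₀
  -- three nonzero coordinates are impossible (pairwise opposite ratios, char ≠ 2)
  have h3 : ∀ a b d : Fin 4, a ≠ b → a ≠ d → b ≠ d → v a ≠ 0 → v b ≠ 0 → v d ≠ 0 → False := by
    intro a b d hab had hbd ha hb hd
    have hwa : w a ≠ 0 := fun e => ha (hB a e)
    have e1 := h a b hab
    have e2 := h a d had
    have e3 := h b d hbd
    simp only [pairPerm] at e1 e2 e3
    have e4 : (2 : K) * (v b * (v d * w a)) = 0 := by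
      linear_combination v b * e2 + v d * e1 - v a * e3
    rcases mul_eq_zero.mp e4 with e5 | e5
    · exact two_ne_zero e5
    rcases mul_eq_zero.mp e5 with e6 | e6
    · exact hb e6
    rcases mul_eq_zero.mp e6 with e7 | e7
    · exact hd e7
    · exact hwa e7
  by_cases hex : ∃ c, c ≠ p ∧ v c ≠ 0
  · obtain ⟨c, hcp, hc⟩ := hex
    refine ⟨p, c, hcp.symm, fun i hip hic => ?_⟩
    have hvi : v i = 0 := by
      by_contra hvi
      exact h3 p c i hcp.symm hip.symm hic.symm hp hc hvi
    exact ⟨hvi, hA i hvi⟩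
  · push Not at hex
    obtain ⟨c, hcp⟩ := exists_ne p
    refine ⟨p, c, hcp.symm, fun i hip hic => ?_⟩
    have hvi : v i = 0 := hex i hip
    exact ⟨hvi, hA i hvi⟩



/-! #### Symmetry transport — PROVED (rev 2.1; was `stub_transport`) -/

/-- Row permutation `x ↦ ((i, j) ↦ x (σ i, j))` as a linear equivalence. -/
def rowPermL (σ : Equiv.Perm (Fin 4)) : (Fin 4 × Fin 4 → K) ≃ₗ[K] (Fin 4 × Fin 4 → K) :=
  LinearEquiv.funCongrLeft K K (Equiv.prodCongr σ (Equiv.refl (Fin 4)))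

@[simp] theorem rowPermL_apply (σ : Equiv.Perm (Fin 4)) (x : Fin 4 × Fin 4 → K) (i j : Fin 4) :
    rowPermL σ x (i, j) = x (σ i, j) := rfl

/-- Transposition `x ↦ ((i, j) ↦ x (j, i))` as a linear equivalence. -/
def transposeL : (Fin 4 × Fin 4 → K) ≃ₗ[K] (Fin 4 × Fin 4 → K) :=
  LinearEquiv.funCongrLeft K K (Equiv.prodComm (Fin 4) (Fin 4))

@[simp] theorem transposeL_apply (x : Fin 4 × Fin 4 → K) (i j : Fin 4) :
    transposeL (K := K) x (i, j) = x (j, i) := rfl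

theorem mem_iff_map_equiv (e : (Fin 4 × Fin 4 → K) ≃ₗ[K] (Fin 4 × Fin 4 → K))
    (W : Submodule K (Fin 4 × Fin 4 → K)) (x : Fin 4 × Fin 4 → K) :
    x ∈ W ↔ e x ∈ W.map (e : (Fin 4 × Fin 4 → K) →ₗ[K] (Fin 4 × Fin 4 → K)) := by
  rw [Submodule.mem_map_equiv, LinearEquiv.symm_apply_apply]

theorem sing3_map_rowPermL {W : Submodule K (Fin 4 × Fin 4 → K)} (hS : Sing3 W)
    (σ : Equiv.Perm (Fin 4)) :
    Sing3 (W.map (rowPermL (K := K) σ : (Fin 4 × Fin 4 → K) →ₗ[K] (Fin 4 × Fin 4 → K))) := by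
  intro y hy r c hr hc
  obtain ⟨x, hx, rfl⟩ := Submodule.mem_map.mp hy
  have key : (Matrix.of fun i j => (rowPermL (K := K) σ : (Fin 4 × Fin 4 → K) →ₗ[K]
      (Fin 4 × Fin 4 → K)) x (i, j)).submatrix r c =
      (Matrix.of fun i j => x (i, j)).submatrix (σ ∘ r) c := Matrix.ext fun _ _ => rfl
  rw [key]
  exact hS x hx _ _ (σ.injective.comp hr) hc

theorem sing3_map_transposeL {W : Submodule K (Fin 4 × Fin 4 → K)} (hS : Sing3 W) :
    Sing3 (W.map (transposeL (K := K) : (Fin 4 × Fin 4 → K) →ₗ[K] (Fin 4 × Fin 4 → K))) := by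
  intro y hy r c hr hc
  obtain ⟨x, hx, rfl⟩ := Submodule.mem_map.mp hy
  have key : (Matrix.of fun i j => (transposeL (K := K) : (Fin 4 × Fin 4 → K) →ₗ[K]
      (Fin 4 × Fin 4 → K)) x (i, j)).submatrix r c =
      ((Matrix.of fun i j => x (i, j)).submatrix c r).transpose := Matrix.ext fun _ _ => rfl
  rw [key, Matrix.permanent_transpose]
  exact hS x hx _ _ hc hr

/-- `Concl` pulls back along a row permutation. -/
theorem concl_of_rowPerm (σ : Equiv.Perm (Fin 4)) {W W' : Submodule K (Fin 4 × Fin 4 → K)}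
    (hmem : ∀ x, x ∈ W ↔ rowPermL σ x ∈ W') : Concl W' → Concl W := by
  have hsy : ∀ i : Fin 4, σ (σ.symm i) = i := fun i => σ.apply_symm_apply i
  rintro (⟨l, c, h⟩ | ⟨p, q, hpq, h⟩ | ⟨p, q, hpq, h⟩ | ⟨ρ, γ, α, β, hα, hβ, h⟩ |
    ⟨ρ, γ, c₀, hc, h⟩ | ⟨ρ, γ, α, β, hα, hβ, h⟩ | ⟨ρ, γ, c₀, hc, h⟩)
  · refine Or.inl ⟨σ l, c, fun x hx i j hil hjc => ?_⟩
    have hne : σ.symm i ≠ l := fun e => hil (by rw [← e, hsy])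
    have := h _ ((hmem x).mp hx) (σ.symm i) j hne hjc
    simpa [hsy] using this
  · refine Or.inr (Or.inl ⟨σ p, σ q, σ.injective.ne hpq, fun x hx j => ?_⟩)
    simpa using h _ ((hmem x).mp hx) j
  · refine Or.inr (Or.inr (Or.inl ⟨p, q, hpq, fun x hx i => ?_⟩))
    simpa [hsy] using h _ ((hmem x).mp hx) (σ.symm i)
  · refine Or.inr (Or.inr (Or.inr (Or.inl ⟨ρ.trans σ, γ, α, β, hα, hβ, fun x => ?_⟩)))
    rw [hmem x, h]
    simp only [rowPermL_apply, Equiv.trans_apply]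
  · refine Or.inr (Or.inr (Or.inr (Or.inr (Or.inl ⟨ρ.trans σ, γ, c₀, hc, fun x => ?_⟩))))
    rw [hmem x, h]
    simp only [rowPermL_apply, Equiv.trans_apply]
  · refine Or.inr (Or.inr (Or.inr (Or.inr (Or.inr (Or.inl ⟨ρ.trans σ, γ, α, β, hα, hβ, fun x => ?_⟩)))))
    rw [hmem x, h]
    simp only [rowPermL_apply, Equiv.trans_apply]
    exact and_congr (σ.surjective.forall (p := fun i => x (i, γ 0) = 0)).symm Iff.rfl
  · refine Or.inr (Or.inr (Or.inr (Or.inr (Or.inr (Or.inr ⟨ρ.trans σ, γ, c₀, hc, fun x => ?_⟩)))))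
    rw [hmem x, h]
    simp only [rowPermL_apply, Equiv.trans_apply]
    exact and_congr (σ.surjective.forall (p := fun i => x (i, γ 0) = 0)).symm Iff.rfl

/-- `Concl` pulls back along transposition (rows ↔ columns). -/
theorem concl_of_transpose {W W' : Submodule K (Fin 4 × Fin 4 → K)}
    (hmem : ∀ x, x ∈ W ↔ transposeL x ∈ W') : Concl W' → Concl W := by
  rintro (⟨l, c, h⟩ | ⟨p, q, hpq, h⟩ | ⟨p, q, hpq, h⟩ | ⟨ρ, γ, α, β, hα, hβ, h⟩ |
    ⟨ρ, γ, c₀, hc, h⟩ | ⟨ρ, γ, α, β, hα, hβ, h⟩ | ⟨ρ, γ, c₀, hc, h⟩)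
  · refine Or.inl ⟨c, l, fun x hx i j hic hjl => ?_⟩
    simpa using h _ ((hmem x).mp hx) j i hjl hic
  · refine Or.inr (Or.inr (Or.inl ⟨p, q, hpq, fun x hx i => ?_⟩))
    simpa using h _ ((hmem x).mp hx) i
  · refine Or.inr (Or.inl ⟨p, q, hpq, fun x hx j => ?_⟩)
    simpa using h _ ((hmem x).mp hx) j
  · refine Or.inr (Or.inr (Or.inr (Or.inr (Or.inr (Or.inl ⟨γ, ρ, α, β, hα, hβ, fun x => ?_⟩)))))
    rw [hmem x, h]
    simp only [transposeL_apply]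
  · refine Or.inr (Or.inr (Or.inr (Or.inr (Or.inr (Or.inr ⟨γ, ρ, c₀, hc, fun x => ?_⟩)))))
    rw [hmem x, h]
    simp only [transposeL_apply]
  · refine Or.inr (Or.inr (Or.inr (Or.inl ⟨γ, ρ, α, β, hα, hβ, fun x => ?_⟩)))
    rw [hmem x, h]
    simp only [transposeL_apply]
  · refine Or.inr (Or.inr (Or.inr (Or.inr (Or.inl ⟨γ, ρ, c₀, hc, fun x => ?_⟩))))
    rw [hmem x, h]
    simp only [transposeL_apply]

/-- Transport, zero-ROW case: move the zero row to position `0` by `Equiv.swap 0 i`. -/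
theorem transport_row [CharZero K] (hR : ResidueNorm K) (W : Submodule K (Fin 4 × Fin 4 → K))
    (hS : Sing3 W) (h6 : finrank K W = 6) (hz : ∃ i : Fin 4, ∀ x ∈ W, ∀ j : Fin 4, x (i, j) = 0) :
    Concl W := by
  obtain ⟨i, hi⟩ := hz
  have hmem := mem_iff_map_equiv (rowPermL (Equiv.swap 0 i)) W
  refine concl_of_rowPerm (Equiv.swap 0 i) hmem (hR _ ⟨sing3_map_rowPermL hS _, ?_, ?_⟩)
  · rw [LinearEquiv.finrank_map_eq]; exact h6
  · intro y hy
    obtain ⟨x, hx, rfl⟩ := Submodule.mem_map.mp hy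
    funext j
    show x (Equiv.swap 0 i 0, j) = 0
    rw [Equiv.swap_apply_left]
    exact hi x hx j

/-- **SYMMETRY TRANSPORT — PROVED** (rev 2.1; was `stub_transport`). -/
theorem transport [CharZero K] : Transport K := by
  intro hR W hS h6 hz
  rcases hz with hz | ⟨j, hj⟩
  · exact transport_row hR W hS h6 hz
  · have hmem := mem_iff_map_equiv (transposeL (K := K)) W
    refine concl_of_transpose hmem (transport_row hR _ (sing3_map_transposeL hS) ?_ ⟨j, ?_⟩)
    · rw [LinearEquiv.finrank_map_eq]; exact h6
    · intro y hy i
      obtain ⟨x, hx, rfl⟩ := Submodule.mem_map.mp hy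
      exact hj x hx i

/-! ### Kernel-checked compositions of the residue cascade -/

/-- `PureCore` from `SBShape` and `LemmaPhi`. -/
theorem pureCore_of (hS : SBShape K) (hΦ : LemmaPhi K) : PureCore K := by
  intro φ B hB h
  obtain ⟨ℓ₁, ℓ₂, hdisj, hprop⟩ := hS B hB
  refine hΦ φ ℓ₁ ℓ₂ hdisj fun u => hprop u (φ u) fun b hb l => ?_
  rw [T3_swap₁₃, T3_swap₂₃, ← T3_swap₁₃, ← T3_swap₁₂, T3_swap₂₃]
  first
  | exact h u b hb l
  | (have := h u b hb l
     simp only [T3] at this ⊢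
     linear_combination this)

omit [Field K] in
theorem fin4_of_perm (ρ : Equiv.Perm (Fin 4)) (i : Fin 4) :
    i = ρ 0 ∨ i = ρ 1 ∨ i = ρ 2 ∨ i = ρ 3 := by
  obtain ⟨m, rfl⟩ := ρ.surjective i
  fin_cases m <;> simp

omit [Field K] in
theorem fin4_cases (i : Fin 4) : i = 0 ∨ i = 1 ∨ i = 2 ∨ i = 3 := by
  fin_cases i <;> simp

/-- Membership in the kernel plane `K_r = W ⊓ ker (rowL r)`. -/
theorem mem_kerPlane {W : Submodule K (Fin 4 × Fin 4 → K)} {r : Fin 4} {k : Fin 4 × Fin 4 → K} :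
    k ∈ W ⊓ LinearMap.ker (rowL (K := K) r) ↔ k ∈ W ∧ row k r = 0 := by
  simp [Submodule.mem_inf, LinearMap.mem_ker]

/-- `dim K_r = 2` when `n_r = 4` (rank–nullity). -/
theorem finrank_kerPlane {W : Submodule K (Fin 4 × Fin 4 → K)} (h6 : finrank K W = 6) {r : Fin 4}
    (htop : W.map (rowL r) = ⊤) : finrank K ↥(W ⊓ LinearMap.ker (rowL (K := K) r)) = 2 := by
  have hrn := LinearMap.finrank_range_add_finrank_ker ((rowL (K := K) r).domRestrict W)
  rw [LinearMap.range_domRestrict, htop, finrank_top, Module.finrank_fin_fun, h6,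
    LinearMap.ker_domRestrict] at hrn
  rw [← Submodule.map_comap_subtype, Submodule.finrank_map_subtype_eq]
  omega

/-- **§3.6 (i) PURE KERNEL PLANE — PROVED** (rev 2.2; was `stub_casePure`): a linear section
`u ↦ g u` of `row_{ρ1} : W → K⁴`, `φ u = row_{ρ2} (g u)`, `B = row_{ρ3} (K_r)` (`2`-dimensional since
rows `0, ρ 1, ρ 2` vanish on `K_r`), the `Sing3` identity `T3 (u, φ u, b) = 0` on `g u + k`, and
`PureCore` give `φ = 0`; then `x - g (row_{ρ1} x) ∈ K_r`. -/
theorem casePure_of [CharZero K] (hC : PureCore K) : CasePure K := by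
  intro W ρ hN hρ htop hKs
  obtain ⟨hS, h6, h0⟩ := hN
  have h12 : ρ 1 ≠ ρ 2 := fun h => by simpa using ρ.injective h
  have h13 : ρ 1 ≠ ρ 3 := fun h => by simpa using ρ.injective h
  have h23 : ρ 2 ≠ ρ 3 := fun h => by simpa using ρ.injective h
  -- a linear section of `row_{ρ 1} : W → K⁴`
  obtain ⟨g, hg⟩ := LinearMap.exists_rightInverse_of_surjective
    ((rowL (K := K) (ρ 1)).domRestrict W) (by rw [LinearMap.range_domRestrict, htop])
  have hsec : ∀ u, row ((g u : W) : Fin 4 × Fin 4 → K) (ρ 1) = u := fun u => by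
    have := LinearMap.congr_fun hg u
    simpa [rowL_apply] using this
  set φ : (Fin 4 → K) →ₗ[K] (Fin 4 → K) := (rowL (K := K) (ρ 2)).comp (W.subtype.comp g) with hφ
  have hφu : ∀ u, φ u = row ((g u : W) : Fin 4 × Fin 4 → K) (ρ 2) := fun u => rfl
  set D : Submodule K (Fin 4 × Fin 4 → K) := W ⊓ LinearMap.ker (rowL (K := K) (ρ 1)) with hD
  have hD2 : finrank K D = 2 := finrank_kerPlane h6 htop
  -- on `D` the rows `0, ρ 1, ρ 2` vanish, so `row_{ρ 3}` is injective on `D`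
  have hDrows : ∀ d ∈ D, ∀ i, i ≠ ρ 3 → row d i = 0 := by
    intro d hd i hi3
    rw [mem_kerPlane] at hd
    rcases fin4_of_perm ρ i with rfl | rfl | rfl | rfl
    · rw [hρ]; exact h0 d hd.1
    · exact hd.2
    · exact hKs d hd.1 hd.2
    · exact absurd rfl hi3
  have hinj : ∀ d ∈ D, row d (ρ 3) = 0 → d = 0 := by
    intro d hd h3
    funext ⟨i, j⟩
    by_cases hi : i = ρ 3
    · subst hi; exact congrFun h3 j
    · exact congrFun (hDrows d hd i hi) j
  set B : Submodule K (Fin 4 → K) := D.map (rowL (K := K) (ρ 3)) with hB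
  have hB2 : 2 ≤ finrank K B := by
    have hrn := LinearMap.finrank_range_add_finrank_ker ((rowL (K := K) (ρ 3)).domRestrict D)
    have hker : LinearMap.ker ((rowL (K := K) (ρ 3)).domRestrict D) = ⊥ := by
      refine LinearMap.ker_eq_bot'.mpr fun d hd => ?_
      apply Subtype.ext
      exact hinj d d.2 (by simpa [rowL_apply] using hd)
    rw [LinearMap.range_domRestrict, hker, finrank_bot, hD2] at hrn
    rw [hB]; omega
  -- the key identity `T3 (u, φ u, b) = 0` for `b ∈ B` (the `Sing3` condition on `g u + k`)
  have hkey : ∀ u, ∀ b ∈ B, ∀ l, T3 u (φ u) b l = 0 := by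
    intro u b hb l
    obtain ⟨k, hkD, rfl⟩ := Submodule.mem_map.mp hb
    have hkD' := hkD
    rw [mem_kerPlane] at hkD'
    obtain ⟨hkW, hk1⟩ := hkD'
    have hk2 : row k (ρ 2) = 0 := hKs k hkW hk1
    have hxW : ((g u : W) : Fin 4 × Fin 4 → K) ∈ W := (g u).2
    have e0 := T3_eq_zero_of_sing3 hS hxW (ρ 1) (ρ 2) (ρ 3) h12 h13 h23 l
    have e1 := T3_eq_zero_of_sing3 hS (W.add_mem hxW hkW) (ρ 1) (ρ 2) (ρ 3) h12 h13 h23 l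
    rw [row_add, row_add, row_add, hk1, hk2, add_zero, add_zero, T3_add₃, e0, zero_add,
      hsec u] at e1
    rw [hφu, rowL_apply]
    exact e1
  have hφ0 : φ = 0 := hC φ B hB2 hkey
  intro x hx
  have hgW : ((g (row x (ρ 1)) : W) : Fin 4 × Fin 4 → K) ∈ W := (g (row x (ρ 1))).2
  have hkW := W.sub_mem hx hgW
  have hk1 : row (x - ((g (row x (ρ 1)) : W) : Fin 4 × Fin 4 → K)) (ρ 1) = 0 := by
    rw [row_sub, hsec, sub_self]
  have hk2 := hKs _ hkW hk1
  rw [row_sub, sub_eq_zero] at hk2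
  rw [hk2, ← hφu, hφ0, LinearMap.zero_apply]

/-! #### Helpers for the `n_r = 4` cases (rev 2.3) -/

/-- The array with row `r` equal to `v` and all other rows zero. -/
def rowAt (r : Fin 4) (v : Fin 4 → K) : Fin 4 × Fin 4 → K :=
  fun p => if p.1 = r then v p.2 else 0

theorem row_rowAt_self (r : Fin 4) (v : Fin 4 → K) : row (rowAt r v) r = v := by
  funext j; simp [row, rowAt]

theorem row_rowAt_ne {r i : Fin 4} (h : i ≠ r) (v : Fin 4 → K) : row (rowAt r v) i = 0 := by
  funext j; simp [row, rowAt, h]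

theorem lvec_apply (j c : Fin 4) (α β : K) (i : Fin 4) :
    lvec j c α β i = (if i = j then α else 0) + (if i = c then β else 0) := by
  simp [lvec, Pi.single_apply]

theorem lvec_apply_left {j c : Fin 4} (hjc : j ≠ c) (α β : K) : lvec j c α β j = α := by
  simp [lvec_apply, hjc]

theorem lvec_apply_right {j c : Fin 4} (hjc : j ≠ c) (α β : K) : lvec j c α β c = β := by
  simp [lvec_apply, hjc.symm]

theorem lvec_apply_of_ne {i j c : Fin 4} (hij : i ≠ j) (hic : i ≠ c) (α β : K) :
    lvec j c α β i = 0 := by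
  simp [lvec_apply, hij, hic]

omit [Field K] in
/-- A permutation of `Fin 4` taking `0 ↦ j`, `1 ↦ c`. -/
theorem exists_perm_zero_one {j c : Fin 4} (hjc : j ≠ c) :
    ∃ γ : Equiv.Perm (Fin 4), γ 0 = j ∧ γ 1 = c := by
  refine ⟨(Equiv.swap (0 : Fin 4) j).trans (Equiv.swap (Equiv.swap (0 : Fin 4) j 1) c), ?_, ?_⟩
  · have h1 : j ≠ Equiv.swap (0 : Fin 4) j 1 := by
      intro h
      have h' : Equiv.swap (0 : Fin 4) j 0 = Equiv.swap (0 : Fin 4) j 1 := by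
        rw [Equiv.swap_apply_left]; exact h
      exact absurd ((Equiv.swap (0 : Fin 4) j).injective h') (by decide)
    rw [Equiv.trans_apply, Equiv.swap_apply_left, Equiv.swap_apply_of_ne_of_ne h1 hjc]
  · rw [Equiv.trans_apply, Equiv.swap_apply_left]

/-- The values of `lvec j c α β` read through a permutation `γ` with `γ 0 = j`, `γ 1 = c`. -/
theorem lvec_perm {j c : Fin 4} (hjc : j ≠ c) {γ : Equiv.Perm (Fin 4)} (hγ0 : γ 0 = j)
    (hγ1 : γ 1 = c) (α β : K) (i : Fin 4) : lvec j c α β (γ i) = ![α, β, 0, 0] i := by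
  have hγ2j : γ 2 ≠ j := by rw [← hγ0]; exact fun h => by simpa using γ.injective h
  have hγ2c : γ 2 ≠ c := by rw [← hγ1]; exact fun h => by simpa using γ.injective h
  have hγ3j : γ 3 ≠ j := by rw [← hγ0]; exact fun h => by simpa using γ.injective h
  have hγ3c : γ 3 ≠ c := by rw [← hγ1]; exact fun h => by simpa using γ.injective h
  rcases fin4_cases i with rfl | rfl | rfl | rfl
  · rw [hγ0, lvec_apply_left hjc]; simp
  · rw [hγ1, lvec_apply_right hjc]; simp
  · rw [lvec_apply_of_ne hγ2j hγ2c]; simp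
  · rw [lvec_apply_of_ne hγ3j hγ3c]; simp

/-- A linear section of `row_r : W → K⁴` when `n_r = 4`. -/
theorem exists_rowSection {W : Submodule K (Fin 4 × Fin 4 → K)} {r : Fin 4}
    (htop : W.map (rowL r) = ⊤) :
    ∃ g : (Fin 4 → K) →ₗ[K] W, ∀ u, row ((g u : W) : Fin 4 × Fin 4 → K) r = u := by
  obtain ⟨g, hg⟩ := LinearMap.exists_rightInverse_of_surjective
    ((rowL (K := K) r).domRestrict W) (by rw [LinearMap.range_domRestrict, htop])
  exact ⟨g, fun u => by simpa [rowL_apply] using LinearMap.congr_fun hg u⟩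

/-- **§3.6 (ii) PRODUCT KERNEL PLANE — PROVED** (rev 2.3; was `stub_caseProduct`): section `g` of
`row_{ρ1}`, the `t¹`-coefficients of `Sing3` along the two generators `(0;0;a;0)`, `(0;0;0;b)` of
`K_r`, `ProductAbsorb` twice (`χ u ∈ K b`, `φ u ∈ K a`), absorption into `K_r`; then `V_λ` for
`αβ ≠ 0` and a cross for `αβ = 0`. -/
theorem caseProduct_of [CharZero K] (hPA : ProductAbsorb K) : CaseProduct K := by
  intro W ρ j c α β hN hρ htop hjc hαβ hK
  obtain ⟨hS, h6, h0⟩ := hN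
  have h12 : ρ 1 ≠ ρ 2 := fun h => by simpa using ρ.injective h
  have h13 : ρ 1 ≠ ρ 3 := fun h => by simpa using ρ.injective h
  have h23 : ρ 2 ≠ ρ 3 := fun h => by simpa using ρ.injective h
  obtain ⟨g, hsec⟩ := exists_rowSection htop
  have hgW : ∀ u, ((g u : W) : Fin 4 × Fin 4 → K) ∈ W := fun u => (g u).2
  set φ : (Fin 4 → K) →ₗ[K] (Fin 4 → K) := (rowL (K := K) (ρ 2)).comp (W.subtype.comp g) with hφ
  set χ : (Fin 4 → K) →ₗ[K] (Fin 4 → K) := (rowL (K := K) (ρ 3)).comp (W.subtype.comp g) with hχ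
  have hφu : ∀ u, φ u = row ((g u : W) : Fin 4 × Fin 4 → K) (ρ 2) := fun u => rfl
  have hχu : ∀ u, χ u = row ((g u : W) : Fin 4 × Fin 4 → K) (ρ 3) := fun u => rfl
  -- the two generators of `K_r`
  have hka : rowAt (ρ 2) (lvec j c α β) ∈ W ∧ row (rowAt (ρ 2) (lvec j c α β)) (ρ 1) = 0 := by
    refine (hK _).mpr ⟨fun i hi2 hi3 => row_rowAt_ne hi2 _, ⟨1, ?_⟩, ⟨0, ?_⟩⟩
    · rw [row_rowAt_self, one_smul]
    · rw [row_rowAt_ne h23.symm, zero_smul]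
  have hkb : rowAt (ρ 3) (lvec j c α (-β)) ∈ W ∧
      row (rowAt (ρ 3) (lvec j c α (-β))) (ρ 1) = 0 := by
    refine (hK _).mpr ⟨fun i hi2 hi3 => row_rowAt_ne hi3 _, ⟨0, ?_⟩, ⟨1, ?_⟩⟩
    · rw [row_rowAt_ne h23, zero_smul]
    · rw [row_rowAt_self, one_smul]
  -- `t¹`-coefficients of `Sing3` along the two generators
  have hTa : ∀ u l, T3 u (lvec j c α β) (χ u) l = 0 := by
    intro u l
    have e0 := T3_eq_zero_of_sing3 hS (hgW u) (ρ 1) (ρ 2) (ρ 3) h12 h13 h23 l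
    have e1 := T3_eq_zero_of_sing3 hS (W.add_mem (hgW u) hka.1) (ρ 1) (ρ 2) (ρ 3) h12 h13 h23 l
    rw [row_add, row_add, row_add, hka.2, row_rowAt_self, row_rowAt_ne h23.symm, add_zero,
      add_zero, T3_add₂, e0, zero_add, hsec u] at e1
    rw [hχu]; exact e1
  have hTb : ∀ u l, T3 u (lvec j c α (-β)) (φ u) l = 0 := by
    intro u l
    have e0 := T3_eq_zero_of_sing3 hS (hgW u) (ρ 1) (ρ 2) (ρ 3) h12 h13 h23 l
    have e1 := T3_eq_zero_of_sing3 hS (W.add_mem (hgW u) hkb.1) (ρ 1) (ρ 2) (ρ 3) h12 h13 h23 l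
    rw [row_add, row_add, row_add, hkb.2, row_rowAt_self, row_rowAt_ne h23, add_zero, add_zero,
      T3_add₃, e0, zero_add, hsec u, T3_swap₂₃] at e1
    rw [hφu]; exact e1
  have hχ : ∀ u, ∃ μ : K, χ u = μ • lvec j c α (-β) := hPA j c α β χ hjc hαβ hTa
  have hφ : ∀ u, ∃ μ : K, φ u = μ • lvec j c α β := by
    have hαβ' : α ≠ 0 ∨ -β ≠ 0 := hαβ.imp id fun h => neg_ne_zero.mpr h
    have := hPA j c α (-β) φ hjc hαβ' hTb
    simpa only [neg_neg] using this
  -- membership in `W`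
  have hW : ∀ x, x ∈ W ↔ (row x 0 = 0 ∧ (∃ s : K, row x (ρ 2) = s • lvec j c α β) ∧
      (∃ t : K, row x (ρ 3) = t • lvec j c α (-β))) := by
    intro x
    constructor
    · intro hx
      have hk := (hK (x - (g (row x (ρ 1)) : Fin 4 × Fin 4 → K))).mp
        ⟨W.sub_mem hx (hgW _), by rw [row_sub, hsec, sub_self]⟩
      obtain ⟨-, ⟨μ, hμ⟩, ⟨ν, hν⟩⟩ := hk
      obtain ⟨μ', hμ'⟩ := hφ (row x (ρ 1))
      obtain ⟨ν', hν'⟩ := hχ (row x (ρ 1))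
      rw [row_sub, sub_eq_iff_eq_add] at hμ hν
      refine ⟨h0 x hx, ⟨μ + μ', ?_⟩, ⟨ν + ν', ?_⟩⟩
      · rw [hμ, ← hφu (row x (ρ 1)), hμ', add_smul]
      · rw [hν, ← hχu (row x (ρ 1)), hν', add_smul]
    · rintro ⟨hx0, ⟨s, hs⟩, ⟨t, ht⟩⟩
      obtain ⟨μ', hμ'⟩ := hφ (row x (ρ 1))
      obtain ⟨ν', hν'⟩ := hχ (row x (ρ 1))
      have hk : x - (g (row x (ρ 1)) : Fin 4 × Fin 4 → K) ∈ W := by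
        refine ((hK _).mpr ⟨fun i hi2 hi3 => ?_, ⟨s - μ', ?_⟩, ⟨t - ν', ?_⟩⟩).1
        · rcases fin4_of_perm ρ i with rfl | rfl | rfl | rfl
          · rw [hρ, row_sub, hx0, h0 _ (hgW _), sub_zero]
          · rw [row_sub, hsec, sub_self]
          · exact absurd rfl hi2
          · exact absurd rfl hi3
        · rw [row_sub, hs, ← hφu (row x (ρ 1)), hμ', sub_smul]
        · rw [row_sub, ht, ← hχu (row x (ρ 1)), hν', sub_smul]
      have := W.add_mem hk (hgW (row x (ρ 1)))
      rwa [sub_add_cancel] at this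
  -- conclusion: a cross when `αβ = 0`, `V_λ` otherwise
  by_cases hβ : β = 0
  · subst hβ
    refine Or.inr ⟨ρ 1, j, fun x hx i j' hi hj' => ?_⟩
    obtain ⟨hx0, ⟨s, hs⟩, ⟨t, ht⟩⟩ := (hW x).mp hx
    rcases fin4_of_perm ρ i with rfl | rfl | rfl | rfl
    · rw [hρ]; exact congrFun hx0 j'
    · exact absurd rfl hi
    · have e := congrFun hs j'
      simp only [row, Pi.smul_apply, smul_eq_mul, lvec_apply, if_neg hj'] at e
      simpa using e
    · have e := congrFun ht j'
      simp only [row, Pi.smul_apply, smul_eq_mul, lvec_apply, if_neg hj'] at e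
      simpa using e
  by_cases hα : α = 0
  · subst hα
    refine Or.inr ⟨ρ 1, c, fun x hx i j' hi hj' => ?_⟩
    obtain ⟨hx0, ⟨s, hs⟩, ⟨t, ht⟩⟩ := (hW x).mp hx
    rcases fin4_of_perm ρ i with rfl | rfl | rfl | rfl
    · rw [hρ]; exact congrFun hx0 j'
    · exact absurd rfl hi
    · have e := congrFun hs j'
      simp only [row, Pi.smul_apply, smul_eq_mul, lvec_apply, if_neg hj'] at e
      simpa using e
    · have e := congrFun ht j'
      simp only [row, Pi.smul_apply, smul_eq_mul, lvec_apply, if_neg hj'] at e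
      simpa using e
  · obtain ⟨γ, hγ0, hγ1⟩ := exists_perm_zero_one hjc
    refine Or.inl ⟨ρ, γ, α, β, hα, hβ, fun x => (hW x).trans ?_⟩
    refine and_congr ?_ (and_congr (exists_congr fun s => ?_) (exists_congr fun t => ?_))
    · rw [hρ]; exact funext_iff
    · constructor
      · intro h j'
        have e := congrFun h (γ j')
        rw [Pi.smul_apply, smul_eq_mul, lvec_perm hjc hγ0 hγ1] at e
        exact e
      · intro h
        funext j''
        obtain ⟨j', rfl⟩ := γ.surjective j''
        rw [Pi.smul_apply, smul_eq_mul, lvec_perm hjc hγ0 hγ1]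
        exact h j'
    · constructor
      · intro h j'
        have e := congrFun h (γ j')
        rw [Pi.smul_apply, smul_eq_mul, lvec_perm hjc hγ0 hγ1] at e
        exact e
      · intro h
        funext j''
        obtain ⟨j', rfl⟩ := γ.surjective j''
        rw [Pi.smul_apply, smul_eq_mul, lvec_perm hjc hγ0 hγ1]
        exact h j'

@[simp] theorem rowAt_apply_self (r : Fin 4) (v : Fin 4 → K) (i : Fin 4) : rowAt r v (r, i) = v i := by
  simp [rowAt]

theorem rowAt_apply_ne {r p : Fin 4} (h : p ≠ r) (v : Fin 4 → K) (i : Fin 4) :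
    rowAt r v (p, i) = 0 := by
  simp [rowAt, h]

theorem flipAt_apply_self (c : Fin 4) (v : Fin 4 → K) : flipAt c v c = -v c := by
  simp [flipAt]

theorem flipAt_apply_ne {c i : Fin 4} (h : i ≠ c) (v : Fin 4 → K) : flipAt c v i = v i := by
  simp [flipAt, h]

/-- The graph-plane conditions on rows `r, s` (columns `j, c`, ratio `e`): rows `r, s` supported on
columns `j, c`, `y_{s j} = e y_{r j}`, `y_{s c} = -e y_{r c}`. -/
def GraphCond (r s j c : Fin 4) (e : K) (y : Fin 4 × Fin 4 → K) : Prop :=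
  (∀ i, i ≠ j → i ≠ c → y (r, i) = 0 ∧ y (s, i) = 0) ∧
    y (s, j) = e * y (r, j) ∧ y (s, c) = -(e * y (r, c))

theorem graphCond_add {r s j c : Fin 4} {e : K} {y z : Fin 4 × Fin 4 → K}
    (hy : GraphCond r s j c e y) (hz : GraphCond r s j c e z) : GraphCond r s j c e (y + z) := by
  obtain ⟨hy0, hyj, hyc⟩ := hy
  obtain ⟨hz0, hzj, hzc⟩ := hz
  refine ⟨fun i hij hic => ⟨?_, ?_⟩, ?_, ?_⟩
  · rw [Pi.add_apply, (hy0 i hij hic).1, (hz0 i hij hic).1, add_zero]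
  · rw [Pi.add_apply, (hy0 i hij hic).2, (hz0 i hij hic).2, add_zero]
  · simp only [Pi.add_apply]; rw [hyj, hzj]; ring
  · simp only [Pi.add_apply]; rw [hyc, hzc]; ring

theorem graphCond_sub {r s j c : Fin 4} {e : K} {y z : Fin 4 × Fin 4 → K}
    (hy : GraphCond r s j c e y) (hz : GraphCond r s j c e z) : GraphCond r s j c e (y - z) := by
  obtain ⟨hy0, hyj, hyc⟩ := hy
  obtain ⟨hz0, hzj, hzc⟩ := hz
  refine ⟨fun i hij hic => ⟨?_, ?_⟩, ?_, ?_⟩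
  · rw [Pi.sub_apply, (hy0 i hij hic).1, (hz0 i hij hic).1, sub_zero]
  · rw [Pi.sub_apply, (hy0 i hij hic).2, (hz0 i hij hic).2, sub_zero]
  · simp only [Pi.sub_apply]; rw [hyj, hzj]; ring
  · simp only [Pi.sub_apply]; rw [hyc, hzc]; ring

/-- **§3.6 (iii) GRAPH KERNEL PLANE — PROVED** (rev 2.3; was `stub_caseGraph`): section `g` of
`row_{ρ1}`; the generators `(0;0;v;e·σv)` (`v ∈ span(e_j,e_c)`) of `K_r`; the `t¹`-coefficient of
`Sing3` along `g u ± k_v` (char `0`) is the hypothesis of `GraphAbsorb`, which makes `g u` itself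
satisfy the graph conditions; absorption; then `V^gr` with `γ 0 = j`, `γ 1 = c`, `c₀ = e`. -/
theorem caseGraph_of [CharZero K] (hGA : GraphAbsorb K) : CaseGraph K := by
  intro W ρ j c e hN hρ htop hjc he hK
  obtain ⟨hS, h6, h0⟩ := hN
  have h12 : ρ 1 ≠ ρ 2 := fun h => by simpa using ρ.injective h
  have h13 : ρ 1 ≠ ρ 3 := fun h => by simpa using ρ.injective h
  have h23 : ρ 2 ≠ ρ 3 := fun h => by simpa using ρ.injective h
  obtain ⟨g, hsec⟩ := exists_rowSection htop
  have hgW : ∀ u, ((g u : W) : Fin 4 × Fin 4 → K) ∈ W := fun u => (g u).2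
  set φ : (Fin 4 → K) →ₗ[K] (Fin 4 → K) := (rowL (K := K) (ρ 2)).comp (W.subtype.comp g) with hφ
  set χ : (Fin 4 → K) →ₗ[K] (Fin 4 → K) := (rowL (K := K) (ρ 3)).comp (W.subtype.comp g) with hχ
  have hφu : ∀ u, φ u = row ((g u : W) : Fin 4 × Fin 4 → K) (ρ 2) := fun u => rfl
  have hχu : ∀ u, χ u = row ((g u : W) : Fin 4 × Fin 4 → K) (ρ 3) := fun u => rfl
  -- generators of `K_r`: `(0; 0; v; e σ v)` for `v` supported on `{j, c}`
  have hkv : ∀ v : Fin 4 → K, (∀ i, i ≠ j → i ≠ c → v i = 0) →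
      (rowAt (ρ 2) v + rowAt (ρ 3) (e • flipAt c v)) ∈ W ∧
        row (rowAt (ρ 2) v + rowAt (ρ 3) (e • flipAt c v)) (ρ 1) = 0 := by
    intro v hv
    refine (hK _).mpr ⟨fun i hi2 hi3 => ?_, fun i hij hic => ⟨?_, ?_⟩, ?_, ?_⟩
    · rw [row_add, row_rowAt_ne hi2, row_rowAt_ne hi3, add_zero]
    · simp [rowAt_apply_ne h23, hv i hij hic]
    · simp [rowAt_apply_ne h23.symm, flipAt, hic, hv i hij hic]
    · simp [rowAt_apply_ne h23, rowAt_apply_ne h23.symm, flipAt, hjc]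
    · simp [rowAt_apply_ne h23, rowAt_apply_ne h23.symm, flipAt]
  -- the `t¹`-coefficient of `Sing3` along `g u ± k_v`
  have hT : ∀ u v : Fin 4 → K, (∀ i, i ≠ j → i ≠ c → v i = 0) → ∀ l,
      T3 u v (χ u) l + e * T3 u (flipAt c v) (φ u) l = 0 := by
    intro u v hv l
    obtain ⟨hkW, hk1⟩ := hkv v hv
    have hk2 : row (rowAt (ρ 2) v + rowAt (ρ 3) (e • flipAt c v)) (ρ 2) = v := by
      rw [row_add, row_rowAt_self, row_rowAt_ne h23, add_zero]
    have hk3 : row (rowAt (ρ 2) v + rowAt (ρ 3) (e • flipAt c v)) (ρ 3) = e • flipAt c v := by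
      rw [row_add, row_rowAt_ne h23.symm, row_rowAt_self, zero_add]
    generalize rowAt (ρ 2) v + rowAt (ρ 3) (e • flipAt c v) = kv at hkW hk1 hk2 hk3
    have e1 := T3_eq_zero_of_sing3 hS (W.add_mem (hgW u) hkW) (ρ 1) (ρ 2) (ρ 3) h12 h13 h23 l
    have e2 := T3_eq_zero_of_sing3 hS (W.sub_mem (hgW u) hkW) (ρ 1) (ρ 2) (ρ 3) h12 h13 h23 l
    rw [row_add, row_add, row_add, hk1, hk2, hk3, add_zero, hsec u, ← hφu, ← hχu] at e1
    rw [row_sub, row_sub, row_sub, hk1, hk2, hk3, sub_zero, hsec u, ← hφu, ← hχu] at e2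
    have h2 : (2 : K) * (T3 u v (χ u) l + e * T3 u (flipAt c v) (φ u) l) = 0 := by
      simp only [T3, Pi.add_apply, Pi.sub_apply, Pi.smul_apply, smul_eq_mul] at e1 e2 ⊢
      linear_combination e1 - e2
    exact (mul_eq_zero.mp h2).resolve_left two_ne_zero
  have hG : ∀ u, (∀ i, i ≠ j → i ≠ c → φ u i = 0) ∧ χ u = e • flipAt c (φ u) :=
    hGA j c e φ χ hjc he hT
  -- `g u` itself satisfies the graph conditions
  have hGg : ∀ u, GraphCond (ρ 2) (ρ 3) j c e ((g u : W) : Fin 4 × Fin 4 → K) := by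
    intro u
    obtain ⟨hφ0, hχe⟩ := hG u
    have hχi : ∀ i, χ u i = e * flipAt c (φ u) i := fun i => by
      rw [hχe, Pi.smul_apply, smul_eq_mul]
    refine ⟨fun i hij hic => ⟨?_, ?_⟩, ?_, ?_⟩
    · exact hφ0 i hij hic
    · have := hχi i
      rw [flipAt_apply_ne hic, hφ0 i hij hic, mul_zero] at this
      exact this
    · have := hχi j
      rw [flipAt_apply_ne hjc] at this
      exact this
    · have := hχi c
      rw [flipAt_apply_self, mul_neg] at this
      exact this
  -- membership in `W`
  have hW : ∀ x, x ∈ W ↔ (row x 0 = 0 ∧ GraphCond (ρ 2) (ρ 3) j c e x) := by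
    intro x
    constructor
    · intro hx
      have hk := (hK (x - (g (row x (ρ 1)) : Fin 4 × Fin 4 → K))).mp
        ⟨W.sub_mem hx (hgW _), by rw [row_sub, hsec, sub_self]⟩
      have hGx := graphCond_add hk.2 (hGg (row x (ρ 1)))
      rw [sub_add_cancel] at hGx
      exact ⟨h0 x hx, hGx⟩
    · rintro ⟨hx0, hGx⟩
      have hk : x - (g (row x (ρ 1)) : Fin 4 × Fin 4 → K) ∈ W := by
        refine ((hK _).mpr ⟨fun i hi2 hi3 => ?_, graphCond_sub hGx (hGg (row x (ρ 1)))⟩).1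
        rcases fin4_of_perm ρ i with rfl | rfl | rfl | rfl
        · rw [hρ, row_sub, hx0, h0 _ (hgW _), sub_zero]
        · rw [row_sub, hsec, sub_self]
        · exact absurd rfl hi2
        · exact absurd rfl hi3
      have := W.add_mem hk (hgW (row x (ρ 1)))
      rwa [sub_add_cancel] at this
  -- conclusion: `V^gr` with `γ 0 = j`, `γ 1 = c`, `c₀ = e`
  obtain ⟨γ, hγ0, hγ1⟩ := exists_perm_zero_one hjc
  have hγ2j : γ 2 ≠ j := by rw [← hγ0]; exact fun h => by simpa using γ.injective h
  have hγ2c : γ 2 ≠ c := by rw [← hγ1]; exact fun h => by simpa using γ.injective h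
  have hγ3j : γ 3 ≠ j := by rw [← hγ0]; exact fun h => by simpa using γ.injective h
  have hγ3c : γ 3 ≠ c := by rw [← hγ1]; exact fun h => by simpa using γ.injective h
  refine ⟨ρ, γ, e, he, fun x => (hW x).trans (and_congr ?_ ?_)⟩
  · rw [hρ]; exact funext_iff
  · constructor
    · rintro ⟨hz, hj, hc⟩
      exact ⟨(hz _ hγ2j hγ2c).1, (hz _ hγ3j hγ3c).1, (hz _ hγ2j hγ2c).2, (hz _ hγ3j hγ3c).2,
        by rw [hγ0]; exact hj, by rw [hγ1]; exact hc⟩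
    · rintro ⟨h22, h23', h32, h33, hj, hc⟩
      rw [hγ0] at hj
      rw [hγ1] at hc
      refine ⟨fun i hij hic => ?_, hj, hc⟩
      rcases fin4_of_perm γ i with rfl | rfl | rfl | rfl
      · exact absurd hγ0 hij
      · exact absurd hγ1 hic
      · exact ⟨h22, h32⟩
      · exact ⟨h23', h33⟩

/-! #### Helpers for the case `max n_r = 3` (rev 2.3) -/

/-- `u ↦ T3 u v w l` as a linear functional. -/
def T3lin (v w : Fin 4 → K) (l : Fin 4) : (Fin 4 → K) →ₗ[K] K where
  toFun u := T3 u v w l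
  map_add' u u' := T3_add₁ u u' v w l
  map_smul' c u := by rw [T3_smul₁, smul_eq_mul, RingHom.id_apply]

theorem T3lin_apply (v w : Fin 4 → K) (l : Fin 4) (u : Fin 4 → K) :
    T3lin v w l u = T3 u v w l := rfl

theorem T3_single_self (v w : Fin 4 → K) (l : Fin 4) : T3 (Pi.single l 1) v w l = 0 := by
  fin_cases l <;> simp [T3, Fin.succAbove]

/-- Symmetry of the polar matrix: `T3 (e_l, v, w)_m = T3 (e_m, v, w)_l`. -/
theorem T3_single_symm (v w : Fin 4 → K) (l m : Fin 4) :
    T3 (Pi.single l 1) v w m = T3 (Pi.single m 1) v w l := by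
  fin_cases l <;> fin_cases m <;> simp [T3, Fin.succAbove]

/-- **Rank drop.**  If `T3 (a, v, w) = 0` for all `a` in a `3`-dimensional `A ⊆ K⁴`, then already
`T3 (u, v, w) = 0` for all `u`, i.e. `v ⊥ w`: the polar matrix is symmetric with zero diagonal, so a
nonzero entry `(l, m)` makes `A = ker (row l) ∋ e_l`, contradicting the entry `(m, l)`. -/
theorem permOrth_of_T3_on {A : Submodule K (Fin 4 → K)} (hA : finrank K A = 3) {v w : Fin 4 → K}
    (h : ∀ a ∈ A, ∀ l, T3 a v w l = 0) : PermOrth v w := by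
  have key : ∀ l m, T3 (Pi.single m 1) v w l = 0 := by
    intro l m
    by_cases hlm : l = m
    · subst hlm; exact T3_single_self v w l
    by_contra hμ
    have hf : T3lin v w l ≠ 0 := fun hf0 => hμ (by
      have := LinearMap.congr_fun hf0 (Pi.single m 1)
      rwa [T3lin_apply, LinearMap.zero_apply] at this)
    have hAle : A ≤ LinearMap.ker (T3lin v w l) := fun a ha => by
      rw [LinearMap.mem_ker, T3lin_apply]; exact h a ha l
    have hlt : finrank K ↥(LinearMap.ker (T3lin v w l)) < 4 := by
      have := Submodule.finrank_lt (mt LinearMap.ker_eq_top.mp hf)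
      simpa using this
    have hEq : A = LinearMap.ker (T3lin v w l) := Submodule.eq_of_le_of_finrank_le hAle (by omega)
    have hl : (Pi.single l 1 : Fin 4 → K) ∈ A := by
      rw [hEq, LinearMap.mem_ker, T3lin_apply]; exact T3_single_self v w l
    have := h _ hl m
    rw [T3_single_symm] at this
    exact hμ this
  refine permOrth_of_T3 fun u l => ?_
  have hf0 : T3lin v w l = 0 :=
    (Pi.basisFun K (Fin 4)).ext fun m => by
      rw [Pi.basisFun_apply, T3lin_apply, LinearMap.zero_apply]; exact key l m
  have := LinearMap.congr_fun hf0 u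
  rwa [T3lin_apply, LinearMap.zero_apply] at this

/-- Rank–nullity for the row map: `dim K_r + n_r = dim W`. -/
theorem finrank_kerPlane_add (W : Submodule K (Fin 4 × Fin 4 → K)) (r : Fin 4) :
    finrank K ↥(W ⊓ LinearMap.ker (rowL (K := K) r)) + finrank K (W.map (rowL r)) =
      finrank K W := by
  have hrn := LinearMap.finrank_range_add_finrank_ker ((rowL (K := K) r).domRestrict W)
  rw [LinearMap.range_domRestrict, LinearMap.ker_domRestrict] at hrn
  rw [← Submodule.map_comap_subtype, Submodule.finrank_map_subtype_eq]
  omega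

/-- **Kernel space of a rank-`3` row is pure.**  If `n_r = 3` (`r = ρ 1`), then `K_r` is
`3`-dimensional, every element is a perm-orthogonal pair of rows `ρ 2, ρ 3` (polarisation + rank drop
on the hyperplane `A_r`), and `PerpPlanes` forces one of the two rows to vanish on `K_r`. -/
theorem kerPlane_pure_of_three [CharZero K] (hP : PerpPlanes K) {W : Submodule K (Fin 4 × Fin 4 → K)}
    (hS : Sing3 W) (h6 : finrank K W = 6) (h0 : ∀ x ∈ W, row x 0 = 0) (ρ : Equiv.Perm (Fin 4))
    (hρ : ρ 0 = 0) (hn3 : finrank K (W.map (rowL (ρ 1))) = 3) :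
    (∀ d ∈ W ⊓ LinearMap.ker (rowL (K := K) (ρ 1)), row d (ρ 2) = 0) ∨
      (∀ d ∈ W ⊓ LinearMap.ker (rowL (K := K) (ρ 1)), row d (ρ 3) = 0) := by
  have h12 : ρ 1 ≠ ρ 2 := fun h => by simpa using ρ.injective h
  have h13 : ρ 1 ≠ ρ 3 := fun h => by simpa using ρ.injective h
  have h23 : ρ 2 ≠ ρ 3 := fun h => by simpa using ρ.injective h
  have hD3 : finrank K ↥(W ⊓ LinearMap.ker (rowL (K := K) (ρ 1))) = 3 := by
    have := finrank_kerPlane_add W (ρ 1); omega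
  have hrows : ∀ d ∈ W ⊓ LinearMap.ker (rowL (K := K) (ρ 1)), ∀ i, i ≠ ρ 2 → i ≠ ρ 3 →
      row d i = 0 := by
    intro d hd i hi2 hi3
    rw [mem_kerPlane] at hd
    rcases fin4_of_perm ρ i with rfl | rfl | rfl | rfl
    · rw [hρ]; exact h0 d hd.1
    · exact hd.2
    · exact absurd rfl hi2
    · exact absurd rfl hi3
  have hperp : ∀ d ∈ W ⊓ LinearMap.ker (rowL (K := K) (ρ 1)), PermOrth (row d (ρ 2)) (row d (ρ 3)) := by
    intro d hd
    rw [mem_kerPlane] at hd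
    refine permOrth_of_T3_on hn3 fun a ha l => ?_
    obtain ⟨x, hx, rfl⟩ := Submodule.mem_map.mp ha
    rw [rowL_apply]
    exact polar hS h12 h13 h23 hx hd.1 hd.2 l
  rcases hP _ (ρ 2) (ρ 3) h23 hrows (by omega) hperp with hv | hw | ⟨h2, -⟩
  · exact Or.inl hv
  · exact Or.inr hw
  · omega

/-- **§3.7 CASE `max n_r = 3` — PROVED** (rev 2.3; was `stub_caseThree`): with `r = τ 1`, `K_r` is
pure (`kerPlane_pure_of_three`), say row `s` vanishes on it; then `row_t` is injective on `K_r`, so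
`n_t = 3` and `K_t` is pure as well (second application, to `τ ∘ (1 3)`); if row `s` vanishes on `K_t`
then `W = K_r ⊕ K_t` has the two zero rows `0, s`; if row `r` vanishes on `K_t` then `K_t ⊆ K_r`
forces `K_t = 0`, contradicting `dim K_t = 3`.  The case "row `t` vanishes on `K_r`" is the same
with `τ = ρ ∘ (2 3)`. -/
theorem caseThree_of [CharZero K] (hP : PerpPlanes K) : CaseThree K := by
  intro W ρ hN hρ hle3 hn3
  obtain ⟨hS, h6, h0⟩ := hN
  have main : ∀ τ : Equiv.Perm (Fin 4), τ 0 = 0 → finrank K (W.map (rowL (τ 1))) = 3 →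
      (∀ d ∈ W ⊓ LinearMap.ker (rowL (K := K) (τ 1)), row d (τ 2) = 0) → TwoZeroRows W := by
    intro τ hτ hn3 hpure
    have t02 : (0 : Fin 4) ≠ τ 2 := by rw [← hτ]; exact fun h => by simpa using τ.injective h
    have t03 : (0 : Fin 4) ≠ τ 3 := by rw [← hτ]; exact fun h => by simpa using τ.injective h
    have hD3 : finrank K ↥(W ⊓ LinearMap.ker (rowL (K := K) (τ 1))) = 3 := by
      have := finrank_kerPlane_add W (τ 1); omega
    -- on `K_r` only row `τ 3` is alive
    have hDrows : ∀ d ∈ W ⊓ LinearMap.ker (rowL (K := K) (τ 1)), ∀ i, i ≠ τ 3 → row d i = 0 := by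
      intro d hd i hi3
      have hd' := mem_kerPlane.mp hd
      rcases fin4_of_perm τ i with rfl | rfl | rfl | rfl
      · rw [hτ]; exact h0 d hd'.1
      · exact hd'.2
      · exact hpure d hd
      · exact absurd rfl hi3
    have hinj : ∀ d ∈ W ⊓ LinearMap.ker (rowL (K := K) (τ 1)), row d (τ 3) = 0 → d = 0 := by
      intro d hd h3
      funext ⟨i, j⟩
      by_cases hi : i = τ 3
      · subst hi; exact congrFun h3 j
      · exact congrFun (hDrows d hd i hi) j
    -- hence `n_t = 3` and `dim K_t = 3`
    have hnt : finrank K (W.map (rowL (τ 3))) = 3 := by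
      have hle := hle3 (τ 3) t03.symm
      have hker : LinearMap.ker ((rowL (K := K) (τ 3)).domRestrict
          (W ⊓ LinearMap.ker (rowL (K := K) (τ 1)))) = ⊥ := by
        refine LinearMap.ker_eq_bot'.mpr fun d hd => ?_
        apply Subtype.ext
        exact hinj d d.2 (by simpa [rowL_apply] using hd)
      have hrn := LinearMap.finrank_range_add_finrank_ker ((rowL (K := K) (τ 3)).domRestrict
          (W ⊓ LinearMap.ker (rowL (K := K) (τ 1))))
      rw [LinearMap.range_domRestrict, hker, finrank_bot, hD3] at hrn
      have hmono : finrank K ↥((W ⊓ LinearMap.ker (rowL (K := K) (τ 1))).map (rowL (K := K) (τ 3)))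
          ≤ finrank K (W.map (rowL (τ 3))) :=
        Submodule.finrank_mono (Submodule.map_mono inf_le_left)
      omega
    have hDt3 : finrank K ↥(W ⊓ LinearMap.ker (rowL (K := K) (τ 3))) = 3 := by
      have := finrank_kerPlane_add W (τ 3); omega
    -- second application of the kernel-plane lemma, to `τ' = τ ∘ (1 3)`
    have e0 : ((Equiv.swap (1 : Fin 4) 3).trans τ) 0 = 0 := by
      simp [Equiv.swap_apply_of_ne_of_ne, hτ]
    have e1 : ((Equiv.swap (1 : Fin 4) 3).trans τ) 1 = τ 3 := by simp
    have e2 : ((Equiv.swap (1 : Fin 4) 3).trans τ) 2 = τ 2 := by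
      simp [Equiv.swap_apply_of_ne_of_ne]
    have e3 : ((Equiv.swap (1 : Fin 4) 3).trans τ) 3 = τ 1 := by simp
    have hcases := kerPlane_pure_of_three hP hS h6 h0 ((Equiv.swap (1 : Fin 4) 3).trans τ) e0
      (by rw [e1]; exact hnt)
    rw [e1, e2, e3] at hcases
    rcases hcases with hs | hr
    · -- row `τ 2` vanishes on `K_t` too: `W = K_r ⊔ K_t`
      have hinf : W ⊓ LinearMap.ker (rowL (K := K) (τ 1)) ⊓ (W ⊓ LinearMap.ker (rowL (K := K) (τ 3)))
          = ⊥ := by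
        rw [eq_bot_iff]
        intro d hd
        rw [Submodule.mem_bot]
        obtain ⟨hdD, hdDt⟩ := Submodule.mem_inf.mp hd
        exact hinj d hdD (mem_kerPlane.mp hdDt).2
      have hsup : W ⊓ LinearMap.ker (rowL (K := K) (τ 1)) ⊔ (W ⊓ LinearMap.ker (rowL (K := K) (τ 3)))
          = W := by
        refine Submodule.eq_of_le_of_finrank_le (sup_le inf_le_left inf_le_left) ?_
        have := Submodule.finrank_sup_add_finrank_inf_eq
          (W ⊓ LinearMap.ker (rowL (K := K) (τ 1))) (W ⊓ LinearMap.ker (rowL (K := K) (τ 3)))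
        rw [hinf, finrank_bot, hD3, hDt3] at this
        omega
      have hrow : ∀ x ∈ W, row x (τ 2) = 0 := by
        intro x hx
        rw [← hsup, Submodule.mem_sup] at hx
        obtain ⟨d, hd, k, hk, rfl⟩ := hx
        rw [row_add, hpure d hd, hs k hk, add_zero]
      exact ⟨0, τ 2, t02, fun x hx j => ⟨congrFun (h0 x hx) j, congrFun (hrow x hx) j⟩⟩
    · -- row `τ 1` vanishes on `K_t`: then `K_t ⊆ K_r` is zero, contradicting `dim K_t = 3`
      exfalso
      have hbot : W ⊓ LinearMap.ker (rowL (K := K) (τ 3)) = ⊥ := by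
        rw [eq_bot_iff]
        intro k hk
        rw [Submodule.mem_bot]
        have hk' := mem_kerPlane.mp hk
        exact hinj k (mem_kerPlane.mpr ⟨hk'.1, hr k hk⟩) hk'.2
      rw [hbot, finrank_bot] at hDt3
      exact absurd hDt3 (by norm_num)
  rcases kerPlane_pure_of_three hP hS h6 h0 ρ hρ hn3 with h2 | h3
  · exact main ρ hρ hn3 h2
  · have e0 : ((Equiv.swap (2 : Fin 4) 3).trans ρ) 0 = 0 := by
      simp [Equiv.swap_apply_of_ne_of_ne, hρ]
    have e1 : ((Equiv.swap (2 : Fin 4) 3).trans ρ) 1 = ρ 1 := by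
      simp [Equiv.swap_apply_of_ne_of_ne]
    have e2 : ((Equiv.swap (2 : Fin 4) 3).trans ρ) 2 = ρ 3 := by simp
    refine main ((Equiv.swap (2 : Fin 4) 3).trans ρ) e0 (by rw [e1]; exact hn3) ?_
    rw [e1, e2]
    exact h3

/-! #### Coordinate transport and the absorption tools (rev 2.4) -/

/-- `w ↦ w ∘ γ` as a linear map. -/
def compPermL (γ : Equiv.Perm (Fin 4)) : (Fin 4 → K) →ₗ[K] (Fin 4 → K) where
  toFun w := w ∘ γ
  map_add' _ _ := rfl
  map_smul' _ _ := rfl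

@[simp] theorem compPermL_apply (γ : Equiv.Perm (Fin 4)) (w : Fin 4 → K) :
    compPermL (K := K) γ w = w ∘ γ := rfl

/-- `T3` is equivariant under a simultaneous permutation of the four coordinates
(column-permutation invariance of the permanent). -/
theorem T3_perm (γ : Equiv.Perm (Fin 4)) (u v w : Fin 4 → K) (l : Fin 4) :
    T3 (u ∘ γ) (v ∘ γ) (w ∘ γ) l = T3 u v w (γ l) := by
  let x : Fin 4 × Fin 4 → K := fun p => ![u, v, w, 0] p.1 p.2
  let x' : Fin 4 × Fin 4 → K := fun p => x (p.1, γ p.2)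
  have h1 : ((Matrix.of fun i j => x (i, j)).submatrix ![0, 1, 2] (γ l).succAbove).permanent =
      T3 u v w (γ l) := permanent_submatrix_eq_T3 x 0 1 2 (γ l)
  have h2 : ((Matrix.of fun i j => x' (i, j)).submatrix ![0, 1, 2] l.succAbove).permanent =
      T3 (u ∘ γ) (v ∘ γ) (w ∘ γ) l := permanent_submatrix_eq_T3 x' 0 1 2 l
  rw [← h1, ← h2]
  have hne : ∀ k, γ (l.succAbove k) ≠ γ l := fun k h => Fin.succAbove_ne l k (γ.injective h)
  choose π hπ using fun k => Fin.exists_succAbove_eq (hne k)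
  have hπi : Function.Injective π := by
    intro a b hab
    have h := hπ a
    rw [hab, hπ b] at h
    exact (Fin.succAbove_right_injective (γ.injective h)).symm
  have hπb : Function.Bijective π := Finite.injective_iff_bijective.mp hπi
  have hM : (Matrix.of fun i j => x' (i, j)).submatrix ![0, 1, 2] l.succAbove =
      ((Matrix.of fun i j => x (i, j)).submatrix ![0, 1, 2] (γ l).succAbove).submatrix id
        (Equiv.ofBijective π hπb) := by
    ext i k
    fin_cases i <;> simp [Matrix.submatrix_apply, x', hπ]
  rw [hM, Matrix.permanent_permute_rows]

theorem lvec_comp_perm {j c : Fin 4} {γ : Equiv.Perm (Fin 4)} (hγ0 : γ 0 = j) (hγ1 : γ 1 = c)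
    (α β : K) : lvec j c α β ∘ γ = lvec 0 1 α β := by
  funext k
  subst hγ0; subst hγ1
  simp [lvec, Pi.single_apply]

/-- The values of `T3 (u, αe₀ + βe₁, w)`. -/
theorem T3_lvec01 (α β : K) (u w : Fin 4 → K) :
    T3 u (lvec 0 1 α β) w 0 = β * (u 2 * w 3 + u 3 * w 2) ∧
    T3 u (lvec 0 1 α β) w 1 = α * (u 2 * w 3 + u 3 * w 2) ∧
    T3 u (lvec 0 1 α β) w 2 = (β * u 0 + α * u 1) * w 3 + u 3 * (β * w 0 + α * w 1) ∧
    T3 u (lvec 0 1 α β) w 3 = (β * u 0 + α * u 1) * w 2 + u 2 * (β * w 0 + α * w 1) := by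
  refine ⟨?_, ?_, ?_, ?_⟩ <;> simp [T3, Fin.succAbove, lvec] <;> ring

theorem basis_expand (u : Fin 4 → K) :
    u = u 0 • (Pi.single 0 1 : Fin 4 → K) + u 1 • Pi.single 1 1 + u 2 • Pi.single 2 1 +
      u 3 • Pi.single 3 1 := by
  funext i
  fin_cases i <;> simp

/-- `ProductAbsorb` in the coordinates `j = 0`, `c = 1` (a linear system in the `16` entries of `χ`,
solved by evaluating the hypothesis at `e_n` and `e_n + e_{n'}`). -/
theorem productAbsorb_01 [CharZero K] (α β : K) (χ : (Fin 4 → K) →ₗ[K] (Fin 4 → K))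
    (hαβ : α ≠ 0 ∨ β ≠ 0) (h : ∀ u l, T3 u (lvec 0 1 α β) (χ u) l = 0) (u : Fin 4 → K) :
    ∃ μ : K, χ u = μ • lvec 0 1 α (-β) := by
  have hm : ∀ u, u 2 * χ u 3 + u 3 * χ u 2 = 0 := by
    intro u
    rcases hαβ with hα | hβ
    · have := h u 1
      rw [(T3_lvec01 α β u (χ u)).2.1] at this
      exact (mul_eq_zero.mp this).resolve_left hα
    · have := h u 0
      rw [(T3_lvec01 α β u (χ u)).1] at this
      exact (mul_eq_zero.mp this).resolve_left hβ
  have hE2 : ∀ u, (β * u 0 + α * u 1) * χ u 3 + u 3 * (β * χ u 0 + α * χ u 1) = 0 := fun u => by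
    have := h u 2
    rwa [(T3_lvec01 α β u (χ u)).2.2.1] at this
  have hE3 : ∀ u, (β * u 0 + α * u 1) * χ u 2 + u 2 * (β * χ u 0 + α * χ u 1) = 0 := fun u => by
    have := h u 3
    rwa [(T3_lvec01 α β u (χ u)).2.2.2] at this
  -- the linear system
  have a1 := hm (Pi.single 2 1)
  have a2 := hm (Pi.single 3 1)
  have a3 := hm (Pi.single 2 1 + Pi.single 3 1)
  have a4 := hm (Pi.single 2 1 + Pi.single 0 1)
  have a5 := hm (Pi.single 2 1 + Pi.single 1 1)
  have a6 := hm (Pi.single 3 1 + Pi.single 0 1)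
  have a7 := hm (Pi.single 3 1 + Pi.single 1 1)
  have b1 := hE2 (Pi.single 3 1)
  have b2 := hE2 (Pi.single 3 1 + Pi.single 0 1)
  have b3 := hE2 (Pi.single 3 1 + Pi.single 1 1)
  have c1 := hE3 (Pi.single 2 1)
  have c2 := hE3 (Pi.single 2 1 + Pi.single 0 1)
  have c3 := hE3 (Pi.single 2 1 + Pi.single 1 1)
  simp at a1 a2 a3 a4 a5 a6 a7 b1 b2 b3 c1 c2 c3
  have hX22 : χ (Pi.single 2 1) 2 = 0 := by
    rcases hαβ with hα | hβ
    · have h2 : (2 : K) * (α * χ (Pi.single 2 1) 2) = 0 := by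
        linear_combination c3 - b3 - c1 + b1 + α * a3 - α * a7 + α * a5 - 2 * α * a1
      exact (mul_eq_zero.mp ((mul_eq_zero.mp h2).resolve_left two_ne_zero)).resolve_left hα
    · have h2 : (2 : K) * (β * χ (Pi.single 2 1) 2) = 0 := by
        linear_combination c2 - b2 - c1 + b1 + β * a3 - β * a6 + β * a4 - 2 * β * a1
      exact (mul_eq_zero.mp ((mul_eq_zero.mp h2).resolve_left two_ne_zero)).resolve_left hβ
  have hX33 : χ (Pi.single 3 1) 3 = 0 := by linear_combination a3 - hX22 - a1 - a2
  have hX20 : χ (Pi.single 0 1) 2 = 0 := by linear_combination a6 - a2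
  have hX21 : χ (Pi.single 1 1) 2 = 0 := by linear_combination a7 - a2
  have hX30 : χ (Pi.single 0 1) 3 = 0 := by linear_combination a4 - a1
  have hX31 : χ (Pi.single 1 1) 3 = 0 := by linear_combination a5 - a1
  have C0 : β * χ (Pi.single 0 1) 0 + α * χ (Pi.single 0 1) 1 = 0 := by
    linear_combination c2 - c1 - β * hX22 - β * hX20
  have C1 : β * χ (Pi.single 1 1) 0 + α * χ (Pi.single 1 1) 1 = 0 := by
    linear_combination c3 - c1 - α * hX22 - α * hX21
  have C2 : β * χ (Pi.single 2 1) 0 + α * χ (Pi.single 2 1) 1 = 0 := by linear_combination c1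
  have C3 : β * χ (Pi.single 3 1) 0 + α * χ (Pi.single 3 1) 1 = 0 := by linear_combination b1
  -- expand `u` in the basis
  have hχu : χ u = u 0 • χ (Pi.single 0 1) + u 1 • χ (Pi.single 1 1) + u 2 • χ (Pi.single 2 1) +
      u 3 • χ (Pi.single 3 1) := by
    conv_lhs => rw [basis_expand u]
    simp only [map_add, map_smul]
  have L2 : χ u 2 = 0 := by
    rw [hχu]; simp only [Pi.add_apply, Pi.smul_apply, smul_eq_mul]
    linear_combination u 0 * hX20 + u 1 * hX21 + u 2 * hX22 + u 3 * a2
  have L3 : χ u 3 = 0 := by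
    rw [hχu]; simp only [Pi.add_apply, Pi.smul_apply, smul_eq_mul]
    linear_combination u 0 * hX30 + u 1 * hX31 + u 2 * a1 + u 3 * hX33
  have L01 : β * χ u 0 + α * χ u 1 = 0 := by
    rw [hχu]; simp only [Pi.add_apply, Pi.smul_apply, smul_eq_mul]
    linear_combination u 0 * C0 + u 1 * C1 + u 2 * C2 + u 3 * C3
  rcases hαβ with hα | hβ
  · refine ⟨χ u 0 / α, funext fun i => ?_⟩
    rcases fin4_cases i with rfl | rfl | rfl | rfl
    · simp [lvec]; field_simp
    · simp [lvec]; field_simp; linear_combination L01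
    · simp [lvec, L2]
    · simp [lvec, L3]
  · refine ⟨-(χ u 1) / β, funext fun i => ?_⟩
    rcases fin4_cases i with rfl | rfl | rfl | rfl
    · simp [lvec]; field_simp; linear_combination L01
    · simp [lvec]; field_simp
    · simp [lvec, L2]
    · simp [lvec, L3]

/-- **§3.5 / C12 PRODUCT ABSORPTION — PROVED** (rev 2.4; was `stub_productAbsorb`): transport to
`j = 0, c = 1` along `w ↦ w ∘ γ` (`T3_perm`), then `productAbsorb_01`. -/
theorem productAbsorb [CharZero K] : ProductAbsorb K := by
  intro j c α β χ hjc hαβ h u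
  obtain ⟨γ, hγ0, hγ1⟩ := exists_perm_zero_one hjc
  let χ' : (Fin 4 → K) →ₗ[K] (Fin 4 → K) :=
    (compPermL (K := K) γ).comp (χ.comp (compPermL (K := K) γ.symm))
  have hχ' : ∀ u', χ' u' = (χ (u' ∘ γ.symm)) ∘ γ := fun _ => rfl
  have h' : ∀ u' l, T3 u' (lvec 0 1 α β) (χ' u') l = 0 := by
    intro u' l
    have := h (u' ∘ γ.symm) (γ l)
    rw [← T3_perm γ, lvec_comp_perm hγ0 hγ1] at this
    have e1 : (u' ∘ γ.symm) ∘ γ = u' := by funext k; simp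
    rwa [e1, ← hχ'] at this
  obtain ⟨μ, hμ⟩ := productAbsorb_01 α β χ' hαβ h' (u ∘ γ)
  have e2 : (u ∘ γ) ∘ γ.symm = u := by funext k; simp
  rw [hχ', e2, ← lvec_comp_perm hγ0 hγ1 α (-β)] at hμ
  refine ⟨μ, funext fun k => ?_⟩
  have := congrFun hμ (γ.symm k)
  simpa using this

/-- **C13 GRAPH ABSORPTION — PROVED** (rev 2.4; was `stub_graphAbsorb`), from `ProductAbsorb` used
twice with `αβ = 0`: `v = e_j` shows that `ψ = χ + e φ` is absorbed by `e_j` (`ψ u ∈ K e_j`), `v = e_c`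
that `ω = χ - e φ` is absorbed by `e_c`; then `2e φ_i = ψ_i - ω_i = 0` off `{j, c}` (char `0`) and
`χ = e σ φ` componentwise. -/
theorem graphAbsorb_of [CharZero K] (hPA : ProductAbsorb K) : GraphAbsorb K := by
  intro j c e φ χ hjc he h u
  have hψ : ∀ u l, T3 u (lvec j c 1 0) ((χ + e • φ) u) l = 0 := by
    intro u l
    have hv : ∀ i, i ≠ j → i ≠ c → (Pi.single j 1 : Fin 4 → K) i = 0 := fun i hij _ => by
      simp [hij]
    have := h u (Pi.single j 1) hv l
    have hflip : flipAt c (Pi.single j 1 : Fin 4 → K) = Pi.single j 1 := by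
      funext i
      by_cases hic : i = c
      · subst hic; simp [flipAt, hjc.symm]
      · simp [flipAt, hic]
    rw [hflip] at this
    have hl : (lvec j c 1 0 : Fin 4 → K) = Pi.single j 1 := by simp [lvec]
    rw [hl]
    simp only [T3, LinearMap.add_apply, LinearMap.smul_apply, Pi.add_apply, Pi.smul_apply,
      smul_eq_mul] at this ⊢
    linear_combination this
  have hω : ∀ u l, T3 u (lvec j c 0 1) ((χ - e • φ) u) l = 0 := by
    intro u l
    have hv : ∀ i, i ≠ j → i ≠ c → (Pi.single c 1 : Fin 4 → K) i = 0 := fun i _ hic => by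
      simp [hic]
    have := h u (Pi.single c 1) hv l
    have hflip : flipAt c (Pi.single c 1 : Fin 4 → K) = -Pi.single c 1 := by
      funext i
      by_cases hic : i = c
      · subst hic; simp [flipAt]
      · simp [flipAt, hic]
    rw [hflip] at this
    have hl : (lvec j c 0 1 : Fin 4 → K) = Pi.single c 1 := by simp [lvec]
    rw [hl]
    simp only [T3, LinearMap.sub_apply, LinearMap.smul_apply, Pi.sub_apply,
      Pi.smul_apply, Pi.neg_apply, smul_eq_mul] at this ⊢
    linear_combination this
  obtain ⟨μ, hμ⟩ := hPA j c 1 0 (χ + e • φ) hjc (Or.inl one_ne_zero) hψ u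
  obtain ⟨ν, hν⟩ := hPA j c 0 1 (χ - e • φ) hjc (Or.inr one_ne_zero) hω u
  have hψi : ∀ i, i ≠ j → χ u i + e * φ u i = 0 := by
    intro i hij
    have := congrFun hμ i
    simp [lvec, hij] at this
    linear_combination this
  have hωi : ∀ i, i ≠ c → χ u i - e * φ u i = 0 := by
    intro i hic
    have := congrFun hν i
    simp [lvec, hic] at this
    linear_combination this
  refine ⟨fun i hij hic => ?_, funext fun i => ?_⟩
  · have h2 : (2 : K) * (e * φ u i) = 0 := by linear_combination hψi i hij - hωi i hic
    exact (mul_eq_zero.mp ((mul_eq_zero.mp h2).resolve_left two_ne_zero)).resolve_left he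
  · by_cases hic : i = c
    · subst hic
      simp only [Pi.smul_apply, smul_eq_mul, flipAt, if_pos]
      linear_combination hψi i (Ne.symm hjc)
    · simp only [Pi.smul_apply, smul_eq_mul, flipAt, if_neg hic]
      linear_combination hωi i hic

/-! #### Absorption: the master lemma (rev 2.4) -/

/-- The `4 × 4` permanent polarisation `⟨z, T3 (u, v, w)⟩` (fully symmetric). -/
def H4 (z u v w : Fin 4 → K) : K := ∑ l, z l * T3 u v w l

theorem H4_symm12 (z u v w : Fin 4 → K) : H4 z u v w = H4 u z v w := by
  simp only [H4, Fin.sum_univ_four, T3, Fin.succAbove]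
  simp
  ring

theorem H4_single (l : Fin 4) (u v w : Fin 4 → K) : H4 (Pi.single l 1) u v w = T3 u v w l := by
  fin_cases l <;> simp [H4, Fin.sum_univ_four]

/-- **ABSORPTION, MASTER LEMMA.**  If `T3 (u, b, χ u) = 0` for all `u` (a linear `χ`), then already
`T3 (u, b, χ u') = 0` for all `u, u'`: the trilinear scalar `H(z, u, u') = ⟨z, T3 (u, b, χ u')⟩` is
symmetric in `(z, u)` (symmetry of the polar matrix) and alternating in `(u, u')` (the hypothesis,
polarised), and a tensor with these two symmetries vanishes in characteristic `≠ 2`. -/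
theorem T3_absorb_all [CharZero K] (b : Fin 4 → K) (χ : (Fin 4 → K) →ₗ[K] (Fin 4 → K))
    (h : ∀ u l, T3 u b (χ u) l = 0) (u u' : Fin 4 → K) (l : Fin 4) : T3 u b (χ u') l = 0 := by
  have hpt : ∀ u u' l, T3 u b (χ u') l + T3 u' b (χ u) l = 0 := by
    intro u u' l
    have e1 := h (u + u') l
    rw [map_add, T3_add₁, T3_add₃, T3_add₃, h u l, h u' l] at e1
    linear_combination e1
  have hA : ∀ z u u', H4 z u b (χ u') = -H4 z u' b (χ u) := by
    intro z u u'
    simp only [H4, ← Finset.sum_neg_distrib]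
    refine Finset.sum_congr rfl fun l _ => ?_
    linear_combination z l * hpt u u' l
  have hH : ∀ z u u', H4 z u b (χ u') = 0 := by
    intro z u u'
    have c1 := H4_symm12 z u b (χ u')
    have c2 := hA u z u'
    have c3 := H4_symm12 u u' b (χ z)
    have c4 := hA u' u z
    have c5 := H4_symm12 u' z b (χ u)
    have c6 := hA z u' u
    have h2 : (2 : K) * H4 z u b (χ u') = 0 := by linear_combination c1 + c2 - c3 - c4 + c5 + c6
    exact (mul_eq_zero.mp h2).resolve_left two_ne_zero
  have := hH (Pi.single l 1) u u'
  rwa [H4_single] at this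

/-- Hence `b ⊥ χ u` for every `u`. -/
theorem permOrth_absorb [CharZero K] (b : Fin 4 → K) (χ : (Fin 4 → K) →ₗ[K] (Fin 4 → K))
    (h : ∀ u l, T3 u b (χ u) l = 0) (u : Fin 4 → K) : PermOrth b (χ u) :=
  permOrth_of_T3 fun u' l => T3_absorb_all b χ h u' u l

/-- **PURE-PLANE CORE — PROVED DIRECTLY** (rev 2.4; supersedes the route `SBShape → LemmaPhi →
PureCore` of `pureCore_of`, whose two stubs are thereby retired): by the master lemma every `b ∈ B`
is perm-orthogonal to `w = φ u`; if `w_i ≠ 0` then `b ↦ b_i` is injective on `B`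
(`b_q = -(w_q / w_i) b_i`), so `dim B ≤ 1` — contradiction. -/
theorem pureCore [CharZero K] : PureCore K := by
  intro φ B hB h
  refine LinearMap.ext fun u => funext fun i => ?_
  rw [LinearMap.zero_apply, Pi.zero_apply]
  by_contra hne
  have hperp : ∀ b ∈ B, PermOrth b (φ u) := fun b hb =>
    permOrth_absorb b φ (fun u' l => by rw [T3_swap₂₃]; exact h u' b hb l) u
  have hinj : ∀ b ∈ B, b i = 0 → b = 0 := by
    intro b hb hbi
    funext q
    by_cases hq : q = i
    · rw [hq]; exact hbi
    · have := hperp b hb q i hq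
      simp only [pairPerm] at this
      rw [hbi, zero_mul, add_zero] at this
      exact (mul_eq_zero.mp this).resolve_right hne
  have hle : finrank K B ≤ 1 := by
    let g : B →ₗ[K] K := (LinearMap.proj i).comp B.subtype
    have hg : Function.Injective g := by
      intro x y hxy
      apply Subtype.ext
      have h0 : ((x : Fin 4 → K) - (y : Fin 4 → K)) i = 0 := by
        rw [Pi.sub_apply]; exact sub_eq_zero.mpr hxy
      exact sub_eq_zero.mp (hinj _ (B.sub_mem x.2 y.2) h0)
    have := LinearMap.finrank_le_finrank_of_injective hg
    simpa using this
  omega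

/-! #### Perpendicular planes: covering by the pieces `E_{jc}` and the two rulings of `Q_jc` (rev 2.5) -/

/-- Arrays whose rows `s, t` are supported on the columns `{j, c}` (no condition on other rows). -/
def EJC (s t j c : Fin 4) : Submodule K (Fin 4 × Fin 4 → K) where
  carrier := {d | ∀ i, i ≠ j → i ≠ c → d (s, i) = 0 ∧ d (t, i) = 0}
  add_mem' := by
    intro a b ha hb i hij hic
    obtain ⟨h1, h2⟩ := ha i hij hic
    obtain ⟨h3, h4⟩ := hb i hij hic
    simp [h1, h2, h3, h4]
  zero_mem' := by
    intro i _ _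
    simp
  smul_mem' := by
    intro r a ha i hij hic
    obtain ⟨h1, h2⟩ := ha i hij hic
    simp [h1, h2]

theorem mem_EJC {s t j c : Fin 4} {d : Fin 4 × Fin 4 → K} :
    d ∈ EJC (K := K) s t j c ↔ ∀ i, i ≠ j → i ≠ c → d (s, i) = 0 ∧ d (t, i) = 0 := Iff.rfl

/-- The pieces covering `D` pointwise, as submodules of `D`: `{row s = 0}`, `{row t = 0}` and the
`E_{jc}` (all ordered pairs, the diagonal ones included for convenience). -/
def perpPiece (D : Submodule K (Fin 4 × Fin 4 → K)) (s t : Fin 4) :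
    Option (Option (Fin 4 × Fin 4)) → Submodule K D
  | none => (LinearMap.ker (rowL (K := K) s)).comap D.subtype
  | some none => (LinearMap.ker (rowL (K := K) t)).comap D.subtype
  | some (some jc) => (EJC (K := K) s t jc.1 jc.2).comap D.subtype

theorem mem_perpPiece_none {D : Submodule K (Fin 4 × Fin 4 → K)} {s t : Fin 4} {x : D} :
    x ∈ perpPiece D s t none ↔ row (x : Fin 4 × Fin 4 → K) s = 0 := Iff.rfl

theorem mem_perpPiece_some_none {D : Submodule K (Fin 4 × Fin 4 → K)} {s t : Fin 4} {x : D} :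
    x ∈ perpPiece D s t (some none) ↔ row (x : Fin 4 × Fin 4 → K) t = 0 := Iff.rfl

theorem mem_perpPiece_some_some {D : Submodule K (Fin 4 × Fin 4 → K)} {s t : Fin 4} {x : D}
    {jc : Fin 4 × Fin 4} : x ∈ perpPiece D s t (some (some jc)) ↔
      ∀ i, i ≠ jc.1 → i ≠ jc.2 → (x : Fin 4 × Fin 4 → K) (s, i) = 0 ∧ (x : Fin 4 × Fin 4 → K) (t, i) = 0 :=
  Iff.rfl

/-- Parallel coordinate pairs: `(y₁, y₂) ≠ 0` and `x₁ y₂ = x₂ y₁` give `x = μ y`. -/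
theorem exists_smul_of_par {x₁ x₂ y₁ y₂ : K} (hy : y₁ ≠ 0 ∨ y₂ ≠ 0) (h : x₁ * y₂ = x₂ * y₁) :
    ∃ μ : K, x₁ = μ * y₁ ∧ x₂ = μ * y₂ := by
  rcases hy with hy | hy
  · refine ⟨x₁ / y₁, (div_mul_cancel₀ x₁ hy).symm, ?_⟩
    rw [div_mul_eq_mul_div, eq_div_iff hy]
    linear_combination (-1 : K) * h
  · refine ⟨x₂ / y₂, ?_, (div_mul_cancel₀ x₂ hy).symm⟩
    rw [div_mul_eq_mul_div, eq_div_iff hy]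
    linear_combination h

/-- The product ruling plane's parametrisation
`(μ, ν) ↦ μ • (row s := ℓ(α, β)) + ν • (row t := ℓ(α, -β))`. -/
def prodGen (s t j c : Fin 4) (α β : K) : (K × K) →ₗ[K] (Fin 4 × Fin 4 → K) :=
  (LinearMap.fst K K K).smulRight (rowAt s (lvec j c α β)) +
    (LinearMap.snd K K K).smulRight (rowAt t (lvec j c α (-β)))

theorem prodGen_apply (s t j c : Fin 4) (α β : K) (μν : K × K) :
    prodGen s t j c α β μν = μν.1 • rowAt s (lvec j c α β) + μν.2 • rowAt t (lvec j c α (-β)) :=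
  rfl

/-- **§3.3 PERPENDICULAR PLANES — PROVED** (rev 2.5; was `stub_perpPlanes`).  Pointwise every
`d ∈ D` lies in `{row s = 0}`, `{row t = 0}` or some `E_{jc}` (`PermOrthPairs`); a vector space over
an infinite field is not a finite union of proper subspaces
(`Submodule.exists_forall_notMem_of_forall_ne_top`), so `D` lies in one piece.  Inside `E_{jc}` the
quadric is `q(d) = d_{sj} d_{tc} + d_{sc} d_{tj}`; polarising `q ≡ 0` on `D`: if the `s`-row
coordinates `(d_{sj}, d_{sc})` are injective on `D`, then `dim D = 2`, the preimages of `(1,0), (0,1)`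
have `t`-rows `(e, 0), (0, -e)` and `D` is the GRAPH ruling `Γ_e` (`e = 0` would make `row t ≡ 0`);
otherwise some `d₀ ≠ 0` in `D` has zero `s`-row, its `t`-row `(α, -β) ≠ 0` forces every `s`-row to be
parallel to `(α, β)` and (through one `d₁` with nonzero `s`-row) every `t`-row parallel to `(α, -β)`,
so `D ≤ range (prodGen …)` (dimension `≤ 2`), with equality by dimension: the PRODUCT ruling. -/
theorem perpPlanes [CharZero K] (hPOP : PermOrthPairs K) : PerpPlanes K := by
  intro D s t hst hsupp hD hperp
  by_cases hV : ∀ d ∈ D, row d s = 0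
  · exact Or.inl hV
  by_cases hW : ∀ d ∈ D, row d t = 0
  · exact Or.inr (Or.inl hW)
  push Not at hV hW
  obtain ⟨d₁, hd₁, hv₁⟩ := hV
  obtain ⟨d₂, hd₂, hw₂⟩ := hW
  -- STEP A: `D` lies in one piece `E_{jc}`
  obtain ⟨j, c, hjc, hE⟩ : ∃ j c : Fin 4, j ≠ c ∧
      ∀ d ∈ D, ∀ i, i ≠ j → i ≠ c → d (s, i) = 0 ∧ d (t, i) = 0 := by
    by_contra hnone
    have hcov : ∀ j c : Fin 4, ¬ ∀ d ∈ D, ∀ i, i ≠ j → i ≠ c → d (s, i) = 0 ∧ d (t, i) = 0 := by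
      intro j c hall
      by_cases hjc : j = c
      · obtain ⟨c', hc'⟩ := exists_ne j
        exact hnone ⟨j, c', hc'.symm, fun d hd i hij _ => hall d hd i hij (by rw [← hjc]; exact hij)⟩
      · exact hnone ⟨j, c, hjc, hall⟩
    have hne : ∀ o, perpPiece D s t o ≠ ⊤ := by
      intro o ho
      have hall : ∀ x : D, x ∈ perpPiece D s t o := fun x => by rw [ho]; exact Submodule.mem_top
      rcases o with _ | ⟨_ | ⟨j', c'⟩⟩
      · exact hv₁ (mem_perpPiece_none.mp (hall ⟨d₁, hd₁⟩))
      · exact hw₂ (mem_perpPiece_some_none.mp (hall ⟨d₂, hd₂⟩))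
      · exact hcov j' c' fun d hd => mem_perpPiece_some_some.mp (hall ⟨d, hd⟩)
    obtain ⟨x, hx⟩ := Submodule.exists_forall_notMem_of_forall_ne_top (perpPiece D s t) hne
    rcases hPOP (row (x : Fin 4 × Fin 4 → K) s) (row (x : Fin 4 × Fin 4 → K) t) (hperp x x.2) with
      h0 | h0 | ⟨j, c, _, hsup⟩
    · exact hx none (mem_perpPiece_none.mpr h0)
    · exact hx (some none) (mem_perpPiece_some_none.mpr h0)
    · exact hx (some (some (j, c))) (mem_perpPiece_some_some.mpr hsup)
  -- STEP B: inside `E_{jc}`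
  have hq : ∀ d ∈ D, d (s, j) * d (t, c) + d (s, c) * d (t, j) = 0 := fun d hd => hperp d hd j c hjc
  have hbil : ∀ d ∈ D, ∀ d' ∈ D, d (s, j) * d' (t, c) + d (s, c) * d' (t, j) +
      (d' (s, j) * d (t, c) + d' (s, c) * d (t, j)) = 0 := by
    intro d hd d' hd'
    have h := hq (d + d') (D.add_mem hd hd')
    simp only [Pi.add_apply] at h
    linear_combination h - hq d hd - hq d' hd'
  -- entrywise extensionality for arrays supported on rows `s, t` and columns `j, c`
  have ext4 : ∀ d d' : Fin 4 × Fin 4 → K,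
      (∀ i, i ≠ s → i ≠ t → row d i = 0) → (∀ i, i ≠ j → i ≠ c → d (s, i) = 0 ∧ d (t, i) = 0) →
      (∀ i, i ≠ s → i ≠ t → row d' i = 0) → (∀ i, i ≠ j → i ≠ c → d' (s, i) = 0 ∧ d' (t, i) = 0) →
      d (s, j) = d' (s, j) → d (s, c) = d' (s, c) → d (t, j) = d' (t, j) → d (t, c) = d' (t, c) →
      d = d' := by
    intro d d' hd hdE hd' hd'E e1 e2 e3 e4
    funext ik
    obtain ⟨i, k⟩ := ik
    by_cases his : i = s
    · rw [his]
      by_cases hkj : k = j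
      · rw [hkj]; exact e1
      by_cases hkc : k = c
      · rw [hkc]; exact e2
      rw [(hdE k hkj hkc).1, (hd'E k hkj hkc).1]
    by_cases hit : i = t
    · rw [hit]
      by_cases hkj : k = j
      · rw [hkj]; exact e3
      by_cases hkc : k = c
      · rw [hkc]; exact e4
      rw [(hdE k hkj hkc).2, (hd'E k hkj hkc).2]
    have h1 := congrFun (hd i his hit) k
    have h2 := congrFun (hd' i his hit) k
    simp only [row, Pi.zero_apply] at h1 h2
    rw [h1, h2]
  have hv₁' : d₁ (s, j) ≠ 0 ∨ d₁ (s, c) ≠ 0 := by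
    by_contra h0
    push Not at h0
    apply hv₁
    funext k
    show d₁ (s, k) = 0
    by_cases hkj : k = j
    · rw [hkj]; exact h0.1
    by_cases hkc : k = c
    · rw [hkc]; exact h0.2
    exact (hE d₁ hd₁ k hkj hkc).1
  have hw₂' : d₂ (t, j) ≠ 0 ∨ d₂ (t, c) ≠ 0 := by
    by_contra h0
    push Not at h0
    apply hw₂
    funext k
    show d₂ (t, k) = 0
    by_cases hkj : k = j
    · rw [hkj]; exact h0.1
    by_cases hkc : k = c
    · rw [hkc]; exact h0.2
    exact (hE d₂ hd₂ k hkj hkc).2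
  by_cases hinj : ∀ d ∈ D, d (s, j) = 0 → d (s, c) = 0 → d = 0
  · -- CASE (ii): the `s`-row coordinates are injective on `D`: GRAPH ruling
    obtain ⟨π, hπ_def⟩ : ∃ π : D →ₗ[K] K × K, π =
        ((LinearMap.proj (s, j) : (Fin 4 × Fin 4 → K) →ₗ[K] K).comp D.subtype).prod
          ((LinearMap.proj (s, c) : (Fin 4 × Fin 4 → K) →ₗ[K] K).comp D.subtype) := ⟨_, rfl⟩
    have hπ : ∀ x : D, π x = ((x : Fin 4 × Fin 4 → K) (s, j), (x : Fin 4 × Fin 4 → K) (s, c)) :=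
      fun x => by rw [hπ_def]; rfl
    have hπinj : Function.Injective π := by
      intro x y hxy
      rw [hπ, hπ, Prod.mk.injEq] at hxy
      apply Subtype.ext
      have := hinj ((x : Fin 4 × Fin 4 → K) - y) (D.sub_mem x.2 y.2)
        (by rw [Pi.sub_apply, hxy.1, sub_self]) (by rw [Pi.sub_apply, hxy.2, sub_self])
      exact sub_eq_zero.mp this
    have hle : finrank K D ≤ 2 := by
      have := LinearMap.finrank_le_finrank_of_injective hπinj
      simpa using this
    have hfin : finrank K D = 2 := le_antisymm hle hD
    have hπsurj : Function.Surjective π := by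
      refine (LinearMap.injective_iff_surjective_of_finrank_eq_finrank ?_).mp hπinj
      rw [hfin]; simp
    obtain ⟨gj, hgj⟩ := hπsurj (1, 0)
    obtain ⟨gc, hgc⟩ := hπsurj (0, 1)
    rw [hπ, Prod.mk.injEq] at hgj hgc
    obtain ⟨e, hge⟩ : ∃ e : K, (gj : Fin 4 × Fin 4 → K) (t, j) = e := ⟨_, rfl⟩
    have hq1 := hq gj gj.2
    rw [hgj.1, hgj.2] at hq1
    have hq2 := hq gc gc.2
    rw [hgc.1, hgc.2] at hq2
    have hb12 := hbil gj gj.2 gc gc.2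
    rw [hgj.1, hgj.2, hgc.1, hgc.2, hge] at hb12
    have hgjtc : (gj : Fin 4 × Fin 4 → K) (t, c) = 0 := by linear_combination hq1
    have hgctj : (gc : Fin 4 × Fin 4 → K) (t, j) = 0 := by linear_combination hq2
    have hgctc : (gc : Fin 4 × Fin 4 → K) (t, c) = -e := by linear_combination hb12
    have hrepr : ∀ d ∈ D,
        d = d (s, j) • (gj : Fin 4 × Fin 4 → K) + d (s, c) • (gc : Fin 4 × Fin 4 → K) := by
      intro d hd
      have hmem : d - (d (s, j) • (gj : Fin 4 × Fin 4 → K) + d (s, c) • (gc : Fin 4 × Fin 4 → K)) ∈ D :=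
        D.sub_mem hd (D.add_mem (D.smul_mem _ gj.2) (D.smul_mem _ gc.2))
      have := hinj _ hmem (by simp [hgj.1, hgc.1]) (by simp [hgj.2, hgc.2])
      exact sub_eq_zero.mp this
    by_cases he : e = 0
    · exfalso
      rcases hw₂' with h | h
      · apply h
        have := congrFun (hrepr d₂ hd₂) (t, j)
        simp only [Pi.add_apply, Pi.smul_apply, smul_eq_mul] at this
        rw [this, hge, hgctj, he]; ring
      · apply h
        have := congrFun (hrepr d₂ hd₂) (t, c)
        simp only [Pi.add_apply, Pi.smul_apply, smul_eq_mul] at this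
        rw [this, hgjtc, hgctc, he]; ring
    · refine Or.inr (Or.inr ⟨hfin, Or.inr ⟨j, c, e, hjc, he, fun d => ⟨fun hd => ?_, fun hc => ?_⟩⟩⟩)
      · refine ⟨hsupp d hd, hE d hd, ?_, ?_⟩
        · have := congrFun (hrepr d hd) (t, j)
          simp only [Pi.add_apply, Pi.smul_apply, smul_eq_mul] at this
          rw [this, hge, hgctj]; ring
        · have := congrFun (hrepr d hd) (t, c)
          simp only [Pi.add_apply, Pi.smul_apply, smul_eq_mul] at this
          rw [this, hgjtc, hgctc]; ring
      · obtain ⟨hds, hdE, htj, htc⟩ := hc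
        have : d = d (s, j) • (gj : Fin 4 × Fin 4 → K) + d (s, c) • (gc : Fin 4 × Fin 4 → K) := by
          apply ext4 d _ hds hdE
          · intro i his hit
            rw [row_add, row_smul, row_smul, hsupp _ gj.2 i his hit, hsupp _ gc.2 i his hit,
              smul_zero, smul_zero, add_zero]
          · intro i hij hic
            obtain ⟨a1, a2⟩ := hE _ gj.2 i hij hic
            obtain ⟨b1, b2⟩ := hE _ gc.2 i hij hic
            simp [a1, a2, b1, b2]
          · simp [hgj.1, hgc.1]
          · simp [hgj.2, hgc.2]
          · rw [Pi.add_apply, Pi.smul_apply, Pi.smul_apply, smul_eq_mul, smul_eq_mul, hge, hgctj, htj]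
            ring
          · rw [Pi.add_apply, Pi.smul_apply, Pi.smul_apply, smul_eq_mul, smul_eq_mul, hgjtc, hgctc,
              htc]
            ring
        rw [this]
        exact D.add_mem (D.smul_mem _ gj.2) (D.smul_mem _ gc.2)
  · -- CASE (i): some nonzero `d₀ ∈ D` has zero `s`-row: PRODUCT ruling
    push Not at hinj
    obtain ⟨d₀, hd₀, h0j, h0c, hd₀ne⟩ := hinj
    obtain ⟨α, hα⟩ : ∃ α : K, d₀ (t, j) = α := ⟨_, rfl⟩
    obtain ⟨β, hβ⟩ : ∃ β : K, d₀ (t, c) = -β := ⟨-d₀ (t, c), by rw [neg_neg]⟩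
    have hαβ : α ≠ 0 ∨ β ≠ 0 := by
      by_contra h0
      push Not at h0
      apply hd₀ne
      apply ext4 d₀ 0 (hsupp d₀ hd₀) (hE d₀ hd₀) (fun _ _ _ => rfl) (fun _ _ _ => ⟨rfl, rfl⟩)
      · rw [Pi.zero_apply]; exact h0j
      · rw [Pi.zero_apply]; exact h0c
      · rw [Pi.zero_apply, hα, h0.1]
      · rw [Pi.zero_apply, hβ, h0.2, neg_zero]
    have hpar_s : ∀ d ∈ D, d (s, j) * β = d (s, c) * α := by
      intro d hd
      have h := hbil d hd d₀ hd₀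
      rw [h0j, h0c, hα, hβ] at h
      linear_combination (-1 : K) * h
    obtain ⟨μ₁, hμ1j, hμ1c⟩ := exists_smul_of_par hαβ (hpar_s d₁ hd₁)
    have hμ₁ : μ₁ ≠ 0 := by
      rintro rfl
      rcases hv₁' with h | h
      · exact h (by rw [hμ1j, zero_mul])
      · exact h (by rw [hμ1c, zero_mul])
    have hX1 : α * d₁ (t, c) + β * d₁ (t, j) = 0 := by
      have h := hq d₁ hd₁
      rw [hμ1j, hμ1c] at h
      have : μ₁ * (α * d₁ (t, c) + β * d₁ (t, j)) = 0 := by linear_combination h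
      exact (mul_eq_zero.mp this).resolve_left hμ₁
    have hX : ∀ d ∈ D, α * d (t, c) + β * d (t, j) = 0 := by
      intro d hd
      obtain ⟨μ, hμj, hμc⟩ := exists_smul_of_par hαβ (hpar_s d hd)
      have h := hbil d₁ hd₁ d hd
      rw [hμ1j, hμ1c, hμj, hμc] at h
      have : μ₁ * (α * d (t, c) + β * d (t, j)) = 0 := by linear_combination h - μ * hX1
      exact (mul_eq_zero.mp this).resolve_left hμ₁
    have hαβ' : α ≠ 0 ∨ -β ≠ 0 := hαβ.imp id neg_ne_zero.mpr
    -- every `d ∈ D` is `μ • P₁ + ν • P₂`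
    have hDle : D ≤ LinearMap.range (prodGen s t j c α β) := by
      intro d hd
      obtain ⟨μ, hμj, hμc⟩ := exists_smul_of_par hαβ (hpar_s d hd)
      obtain ⟨ν, hνj, hνc⟩ := exists_smul_of_par hαβ' (x₁ := d (t, j)) (x₂ := d (t, c))
        (by linear_combination (-1 : K) * hX d hd)
      refine ⟨(μ, ν), ?_⟩
      rw [prodGen_apply]
      symm
      apply ext4 d _ (hsupp d hd) (hE d hd)
      · intro i his hit
        rw [row_add, row_smul, row_smul, row_rowAt_ne his, row_rowAt_ne hit, smul_zero, smul_zero,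
          add_zero]
      · intro i hij hic
        simp [rowAt_apply_ne hst, rowAt_apply_ne hst.symm, lvec_apply_of_ne hij hic]
      · simp [rowAt_apply_ne hst, lvec_apply_left hjc, hμj]
      · simp [rowAt_apply_ne hst, lvec_apply_right hjc, hμc]
      · simp [rowAt_apply_ne hst.symm, lvec_apply_left hjc, hνj]
      · simp [rowAt_apply_ne hst.symm, lvec_apply_right hjc, hνc]
    have hrange_le : finrank K (LinearMap.range (prodGen s t j c α β)) ≤ 2 := by
      have := LinearMap.finrank_range_le (prodGen s t j c α β)
      simpa using this
    have hfin : finrank K D = 2 := le_antisymm ((Submodule.finrank_mono hDle).trans hrange_le) hD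
    have hDeq : D = LinearMap.range (prodGen s t j c α β) :=
      Submodule.eq_of_le_of_finrank_le hDle (by rw [hfin]; exact hrange_le)
    refine Or.inr (Or.inr ⟨hfin, Or.inl ⟨j, c, α, β, hjc, hαβ, fun d => ?_⟩⟩)
    rw [hDeq, LinearMap.mem_range]
    constructor
    · rintro ⟨μν, rfl⟩
      rw [prodGen_apply]
      refine ⟨?_, ⟨μν.1, ?_⟩, ⟨μν.2, ?_⟩⟩
      · intro i his hit
        rw [row_add, row_smul, row_smul, row_rowAt_ne his, row_rowAt_ne hit, smul_zero, smul_zero,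
          add_zero]
      · rw [row_add, row_smul, row_smul, row_rowAt_self, row_rowAt_ne hst, smul_zero, add_zero]
      · rw [row_add, row_smul, row_smul, row_rowAt_ne hst.symm, row_rowAt_self, smul_zero, zero_add]
    · rintro ⟨hds, ⟨μ, hμ⟩, ⟨ν, hν⟩⟩
      refine ⟨(μ, ν), ?_⟩
      rw [prodGen_apply]
      have hrows : ∀ i, row (μ • rowAt s (lvec j c α β) + ν • rowAt t (lvec j c α (-β))) i =
          row d i := by
        intro i
        by_cases his : i = s
        · rw [his, row_add, row_smul, row_smul, row_rowAt_self, row_rowAt_ne hst, smul_zero,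
            add_zero, hμ]
        by_cases hit : i = t
        · rw [hit, row_add, row_smul, row_smul, row_rowAt_ne hst.symm, row_rowAt_self, smul_zero,
            zero_add, hν]
        rw [row_add, row_smul, row_smul, row_rowAt_ne his, row_rowAt_ne hit, smul_zero, smul_zero,
          add_zero, hds i his hit]
      funext ik
      obtain ⟨i, k⟩ := ik
      exact congrFun (hrows i) k

/-! #### Toric triples (rev 2.5): kernel pairs, perpendicular partners, one coordinate vector -/

/-- The four components of `T3` written out. -/
theorem T3_explicit (u v w : Fin 4 → K) :
    T3 u v w 0 = u 1 * (v 2 * w 3 + v 3 * w 2) + u 2 * (v 1 * w 3 + v 3 * w 1) +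
      u 3 * (v 1 * w 2 + v 2 * w 1) ∧
    T3 u v w 1 = u 0 * (v 2 * w 3 + v 3 * w 2) + u 2 * (v 0 * w 3 + v 3 * w 0) +
      u 3 * (v 0 * w 2 + v 2 * w 0) ∧
    T3 u v w 2 = u 0 * (v 1 * w 3 + v 3 * w 1) + u 1 * (v 0 * w 3 + v 3 * w 0) +
      u 3 * (v 0 * w 1 + v 1 * w 0) ∧
    T3 u v w 3 = u 0 * (v 1 * w 2 + v 2 * w 1) + u 1 * (v 0 * w 2 + v 2 * w 0) +
      u 2 * (v 0 * w 1 + v 1 * w 0) := by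
  refine ⟨?_, ?_, ?_, ?_⟩ <;> simp [T3, Fin.succAbove]

theorem pairPerm_comm (v w : Fin 4 → K) (p q : Fin 4) : pairPerm v w p q = pairPerm w v p q := by
  unfold pairPerm; ring

/-- Perm-orthogonality from the six values. -/
theorem permOrth_of_six {v w : Fin 4 → K} (m01 : pairPerm v w 0 1 = 0)
    (m02 : pairPerm v w 0 2 = 0) (m03 : pairPerm v w 0 3 = 0) (m12 : pairPerm v w 1 2 = 0)
    (m13 : pairPerm v w 1 3 = 0) (m23 : pairPerm v w 2 3 = 0) : PermOrth v w := by
  have hsymm : ∀ p q, pairPerm v w p q = pairPerm v w q p := fun p q => by unfold pairPerm; ring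
  intro p q hpq
  rcases fin4_cases p with rfl | rfl | rfl | rfl <;>
    rcases fin4_cases q with rfl | rfl | rfl | rfl <;>
    first | exact absurd rfl hpq | assumption | (rw [hsymm]; assumption)

/-- KERNEL PAIR at `(0, 1)`: if `P(v, w)` kills `x = (1, 0, *, *)` and `y = (0, 1, *, *)` and
`m_{01}(v, w) = 0` (the `(2, 3)` entry of `P(v, w)`), then `v ⊥ w` — the five other entries are read
off `(P(v,w) x)_{1,2,3} = 0`, `(P(v,w) y)_{2,3} = 0`.  (So the symmetric zero-diagonal matrices
killing a `2`-plane form a line: the `2`-dimensional-kernel sequel of the rank drop.) -/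
theorem smallKer01 (v w x y : Fin 4 → K) (hx0 : x 0 = 1) (hx1 : x 1 = 0) (hy0 : y 0 = 0)
    (hy1 : y 1 = 1) (hx : ∀ l, T3 x v w l = 0) (hy : ∀ l, T3 y v w l = 0)
    (h01 : pairPerm v w 0 1 = 0) : PermOrth v w := by
  have m01 : v 0 * w 1 + v 1 * w 0 = 0 := h01
  have e2 := hx 2
  rw [(T3_explicit x v w).2.2.1, hx0, hx1] at e2
  have e3 := hx 3
  rw [(T3_explicit x v w).2.2.2, hx0, hx1] at e3
  have e1 := hx 1
  rw [(T3_explicit x v w).2.1, hx0] at e1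
  have f2 := hy 2
  rw [(T3_explicit y v w).2.2.1, hy0, hy1] at f2
  have f3 := hy 3
  rw [(T3_explicit y v w).2.2.2, hy0, hy1] at f3
  have m13 : v 1 * w 3 + v 3 * w 1 = 0 := by linear_combination e2 - x 3 * m01
  have m12 : v 1 * w 2 + v 2 * w 1 = 0 := by linear_combination e3 - x 2 * m01
  have m03 : v 0 * w 3 + v 3 * w 0 = 0 := by linear_combination f2 - y 3 * m01
  have m02 : v 0 * w 2 + v 2 * w 0 = 0 := by linear_combination f3 - y 2 * m01
  have m23 : v 2 * w 3 + v 3 * w 2 = 0 := by linear_combination e1 - x 2 * m03 - x 3 * m02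
  exact permOrth_of_six m01 m02 m03 m12 m13 m23

/-- KERNEL PAIR, general position `(p, q)` (transport of `smallKer01` by `T3_perm`). -/
theorem smallKer {p q : Fin 4} (hpq : p ≠ q) (v w x y : Fin 4 → K) (hxp : x p = 1)
    (hxq : x q = 0) (hyp : y p = 0) (hyq : y q = 1) (hx : ∀ l, T3 x v w l = 0)
    (hy : ∀ l, T3 y v w l = 0) (hm : pairPerm v w p q = 0) : PermOrth v w := by
  obtain ⟨γ, hγ0, hγ1⟩ := exists_perm_zero_one hpq
  have h := smallKer01 (v ∘ γ) (w ∘ γ) (x ∘ γ) (y ∘ γ)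
    (by simp [hγ0, hxp]) (by simp [hγ1, hxq]) (by simp [hγ0, hyp]) (by simp [hγ1, hyq])
    (fun l => by rw [T3_perm]; exact hx _) (fun l => by rw [T3_perm]; exact hy _)
    (by simp only [pairPerm, Function.comp_apply, hγ0, hγ1]; exact hm)
  intro a b hab
  have := h (γ.symm a) (γ.symm b) (by simpa using hab)
  simpa [pairPerm] using this

/-- `T3 (u, v, e_l) = 0` makes all `2 × 2` permanents of `(u ; v)` off the column `l` vanish. -/
theorem pairPerm_of_T3_single {l : Fin 4} {u v : Fin 4 → K}
    (h : ∀ l', T3 u v (Pi.single l 1) l' = 0) {p q : Fin 4} (hpq : p ≠ q) (hpl : p ≠ l)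
    (hql : q ≠ l) : pairPerm u v p q = 0 := by
  obtain ⟨γ, hγ0, hγ1⟩ := exists_perm_zero_one hpq
  have hsingle : (Pi.single l (1 : K)) ∘ γ = Pi.single (γ.symm l) 1 := by
    funext k
    simp only [Function.comp_apply, Pi.single_apply, Equiv.eq_symm_apply]
  have hT : ∀ l'', T3 (u ∘ γ) (v ∘ γ) (Pi.single (γ.symm l) (1 : K)) l'' = 0 := fun l'' => by
    rw [← hsingle, T3_perm]; exact h _
  have hne0 : γ.symm l ≠ 0 := by
    intro h0; apply hpl; rw [← hγ0, ← h0, Equiv.apply_symm_apply]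
  have hne1 : γ.symm l ≠ 1 := by
    intro h1; apply hql; rw [← hγ1, ← h1, Equiv.apply_symm_apply]
  have key : u (γ 0) * v (γ 1) + u (γ 1) * v (γ 0) = 0 := by
    rcases fin4_cases (γ.symm l) with h0 | h1 | h2 | h3
    · exact absurd h0 hne0
    · exact absurd h1 hne1
    · have e := hT 3
      rw [h2, (T3_explicit _ _ _).2.2.2] at e
      simp at e
      linear_combination e
    · have e := hT 2
      rw [h3, (T3_explicit _ _ _).2.2.1] at e
      simp at e
      linear_combination e
  simpa [pairPerm, hγ0, hγ1] using key

/-- Vectors supported on the columns `{j, c}`. -/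
def E1 (j c : Fin 4) : Submodule K (Fin 4 → K) where
  carrier := {u | ∀ i, i ≠ j → i ≠ c → u i = 0}
  add_mem' := by
    intro a b ha hb i hij hic
    simp [ha i hij hic, hb i hij hic]
  zero_mem' := by
    intro i _ _
    simp
  smul_mem' := by
    intro r a ha i hij hic
    simp [ha i hij hic]

theorem mem_E1 {j c : Fin 4} {u : Fin 4 → K} :
    u ∈ E1 (K := K) j c ↔ ∀ i, i ≠ j → i ≠ c → u i = 0 := Iff.rfl

/-- A subspace all of whose vectors are supported on (varying) pairs is supported on ONE pair
(again `Submodule.exists_forall_notMem_of_forall_ne_top`). -/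
theorem coordPair_of_cover [CharZero K] (A : Submodule K (Fin 4 → K))
    (h : ∀ a ∈ A, ∃ j c : Fin 4, j ≠ c ∧ ∀ i, i ≠ j → i ≠ c → a i = 0) :
    ∃ j c : Fin 4, j ≠ c ∧ ∀ a ∈ A, ∀ i, i ≠ j → i ≠ c → a i = 0 := by
  by_contra hnone
  have hcov : ∀ j c : Fin 4, ¬ ∀ a ∈ A, ∀ i, i ≠ j → i ≠ c → a i = 0 := by
    intro j c hall
    by_cases hjc : j = c
    · obtain ⟨c', hc'⟩ := exists_ne j
      exact hnone ⟨j, c', hc'.symm, fun a ha i hij _ => hall a ha i hij (by rw [← hjc]; exact hij)⟩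
    · exact hnone ⟨j, c, hjc, hall⟩
  have hne : ∀ jc : Fin 4 × Fin 4, (E1 (K := K) jc.1 jc.2).comap A.subtype ≠ ⊤ := by
    intro jc hjc
    exact hcov jc.1 jc.2 fun a ha => by
      have hmem : (⟨a, ha⟩ : A) ∈ (E1 (K := K) jc.1 jc.2).comap A.subtype := by
        rw [hjc]; exact Submodule.mem_top
      exact hmem
  obtain ⟨x, hx⟩ := Submodule.exists_forall_notMem_of_forall_ne_top
    (fun jc : Fin 4 × Fin 4 => (E1 (K := K) jc.1 jc.2).comap A.subtype) hne
  obtain ⟨j, c, _, hsup⟩ := h x x.2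
  exact hx (j, c) hsup

/-- In a `2`-dimensional `A`, two jointly injective coordinates are jointly surjective. -/
theorem exists_of_inj2 {A : Submodule K (Fin 4 → K)} (hA : finrank K A = 2) {p l : Fin 4}
    (hinj : ∀ a ∈ A, a p = 0 → a l = 0 → a = 0) (c d : K) : ∃ a ∈ A, a p = c ∧ a l = d := by
  obtain ⟨π, hπ_def⟩ : ∃ π : A →ₗ[K] K × K, π =
      ((LinearMap.proj p : (Fin 4 → K) →ₗ[K] K).comp A.subtype).prod
        ((LinearMap.proj l : (Fin 4 → K) →ₗ[K] K).comp A.subtype) := ⟨_, rfl⟩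
  have hπ : ∀ x : A, π x = ((x : Fin 4 → K) p, (x : Fin 4 → K) l) := fun x => by rw [hπ_def]; rfl
  have hπinj : Function.Injective π := by
    intro x y hxy
    rw [hπ, hπ, Prod.mk.injEq] at hxy
    apply Subtype.ext
    have := hinj ((x : Fin 4 → K) - y) (A.sub_mem x.2 y.2)
      (by rw [Pi.sub_apply, hxy.1, sub_self]) (by rw [Pi.sub_apply, hxy.2, sub_self])
    exact sub_eq_zero.mp this
  have hπsurj : Function.Surjective π := by
    refine (LinearMap.injective_iff_surjective_of_finrank_eq_finrank ?_).mp hπinj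
    rw [hA]; simp
  obtain ⟨x, hx⟩ := hπsurj (c, d)
  rw [hπ, Prod.mk.injEq] at hx
  exact ⟨x, x.2, hx.1, hx.2⟩

/-- A linear functional on a `2`-dimensional space has a nonzero kernel vector. -/
theorem exists_ne_zero_ker {A : Submodule K (Fin 4 → K)} (hA : finrank K A = 2)
    (f : A →ₗ[K] K) : ∃ a : A, a ≠ 0 ∧ f a = 0 := by
  have hrn := LinearMap.finrank_range_add_finrank_ker f
  have hr : finrank K (LinearMap.range f) ≤ 1 := by
    have := Submodule.finrank_le (LinearMap.range f)
    simpa using this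
  have hk : LinearMap.ker f ≠ ⊥ := by
    intro hbot
    rw [hbot, hA] at hrn
    simp at hrn
    omega
  obtain ⟨a, ha, hne⟩ := (Submodule.ne_bot_iff _).mp hk
  exact ⟨a, hne, LinearMap.mem_ker.mp ha⟩

/-- Two normalised vectors `x = (…1_p…0_q…)`, `y = (…0_p…1_q…)` in a `2`-dimensional `A`. -/
theorem exists_normalized {A : Submodule K (Fin 4 → K)} (hA : finrank K A = 2) :
    ∃ (p q : Fin 4) (x y : Fin 4 → K), p ≠ q ∧ x ∈ A ∧ y ∈ A ∧
      x p = 1 ∧ x q = 0 ∧ y p = 0 ∧ y q = 1 := by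
  obtain ⟨b₁, hb₁ne, -⟩ := exists_ne_zero_ker hA 0
  obtain ⟨p, hp⟩ : ∃ p, (b₁ : Fin 4 → K) p ≠ 0 := by
    by_contra h
    push Not at h
    exact hb₁ne (Subtype.ext (funext h))
  obtain ⟨b₂, hb₂ne, hb₂p⟩ :=
    exists_ne_zero_ker hA ((LinearMap.proj p : (Fin 4 → K) →ₗ[K] K).comp A.subtype)
  have hb₂p' : (b₂ : Fin 4 → K) p = 0 := hb₂p
  obtain ⟨q, hq⟩ : ∃ q, (b₂ : Fin 4 → K) q ≠ 0 := by
    by_contra h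
    push Not at h
    exact hb₂ne (Subtype.ext (funext h))
  have hpq : p ≠ q := by rintro rfl; exact hq hb₂p'
  refine ⟨p, q, ((b₁ : Fin 4 → K) p)⁻¹ • (b₁ : Fin 4 → K) -
      (((b₁ : Fin 4 → K) p)⁻¹ * (b₁ : Fin 4 → K) q * ((b₂ : Fin 4 → K) q)⁻¹) • (b₂ : Fin 4 → K),
    ((b₂ : Fin 4 → K) q)⁻¹ • (b₂ : Fin 4 → K), hpq, ?_, ?_, ?_, ?_, ?_, ?_⟩
  · exact A.sub_mem (A.smul_mem _ b₁.2) (A.smul_mem _ b₂.2)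
  · exact A.smul_mem _ b₂.2
  · simp [hb₂p', hp]
  · simp [hq]
  · simp [hb₂p']
  · simp [hq]

/-- CASE I of the toric triple: a coordinate vector `e_l ∈ A₃`.  Then `e_l ∈ A₂, A₁` too (the
coordinates `(p, l)` are injective, hence surjective, on the partner plane), all `2 × 2` permanents
off `l` vanish across the three planes, and one vector `x₃ ∈ A₃` with `x₃(l) = 0` pins a second
column `m`: `2 x₃(i) = 0` for `i ∉ {l, m}` (characteristic `≠ 2`), whence everything vanishes off
`{l, m}`. -/
theorem toric_caseI [CharZero K] {A₁ A₂ A₃ : Submodule K (Fin 4 → K)}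
    (hA₁ : finrank K A₁ = 2) (hA₂ : finrank K A₂ = 2) (hA₃ : finrank K A₃ = 2)
    (hT : ∀ a₁ ∈ A₁, ∀ a₂ ∈ A₂, ∀ a₃ ∈ A₃, ∀ l, T3 a₁ a₂ a₃ l = 0) {l : Fin 4}
    (hl3 : (Pi.single l 1 : Fin 4 → K) ∈ A₃) :
    ∃ p q : Fin 4, p ≠ q ∧ (∀ a ∈ A₁, a p = 0 ∧ a q = 0) ∧ (∀ a ∈ A₂, a p = 0 ∧ a q = 0) ∧
      (∀ a ∈ A₃, a p = 0 ∧ a q = 0) := by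
  have H3 : ∀ a₁ ∈ A₁, ∀ a₂ ∈ A₂, ∀ p q, p ≠ q → p ≠ l → q ≠ l → pairPerm a₁ a₂ p q = 0 :=
    fun a₁ h₁ a₂ h₂ p q hpq hpl hql =>
      pairPerm_of_T3_single (fun l' => hT a₁ h₁ a₂ h₂ _ hl3 l') hpq hpl hql
  -- from the permanents off `l` between `B` and `C`: `e_l ∈ C`
  have step : ∀ {B C : Submodule K (Fin 4 → K)}, finrank K B = 2 → finrank K C = 2 →
      (∀ b ∈ B, ∀ c ∈ C, ∀ p q, p ≠ q → p ≠ l → q ≠ l → pairPerm b c p q = 0) →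
      (Pi.single l 1 : Fin 4 → K) ∈ C := by
    intro B C hB hC hBC
    obtain ⟨b, hbne, hbl⟩ :=
      exists_ne_zero_ker hB ((LinearMap.proj l : (Fin 4 → K) →ₗ[K] K).comp B.subtype)
    have hbl' : (b : Fin 4 → K) l = 0 := hbl
    obtain ⟨p, hp⟩ : ∃ p, (b : Fin 4 → K) p ≠ 0 := by
      by_contra h
      push Not at h
      exact hbne (Subtype.ext (funext h))
    have hpl : p ≠ l := by rintro rfl; exact hp hbl'
    have hinj : ∀ c ∈ C, c p = 0 → c l = 0 → c = 0 := by
      intro c hc hcp hcl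
      funext i
      by_cases hip : i = p
      · rw [hip]; exact hcp
      by_cases hil : i = l
      · rw [hil]; exact hcl
      have h := hBC b b.2 c hc p i (Ne.symm hip) hpl hil
      simp only [pairPerm, hcp, mul_zero, add_zero] at h
      exact (mul_eq_zero.mp h).resolve_left hp
    obtain ⟨e, heC, hep, hel⟩ := exists_of_inj2 hC hinj 0 1
    have he : e = Pi.single l 1 := by
      funext i
      by_cases hil : i = l
      · rw [hil, hel]; simp
      by_cases hip : i = p
      · rw [hip, hep]; simp [hpl]
      have h := hBC b b.2 e heC p i (Ne.symm hip) hpl hil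
      simp only [pairPerm, hep, mul_zero, add_zero] at h
      rw [(mul_eq_zero.mp h).resolve_left hp]
      simp [hil]
    rw [← he]
    exact heC
  have hl2 : (Pi.single l 1 : Fin 4 → K) ∈ A₂ := step hA₁ hA₂ H3
  have H2 : ∀ a₁ ∈ A₁, ∀ a₃ ∈ A₃, ∀ p q, p ≠ q → p ≠ l → q ≠ l → pairPerm a₁ a₃ p q = 0 :=
    fun a₁ h₁ a₃ h₃ p q hpq hpl hql =>
      pairPerm_of_T3_single
        (fun l' => by rw [← T3_swap₂₃]; exact hT a₁ h₁ _ hl2 a₃ h₃ l') hpq hpl hql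
  have hl1 : (Pi.single l 1 : Fin 4 → K) ∈ A₁ :=
    step hA₂ hA₁ fun b hb c hc p q hpq hpl hql => by
      rw [pairPerm_comm]; exact H3 c hc b hb p q hpq hpl hql
  have H1 : ∀ a₂ ∈ A₂, ∀ a₃ ∈ A₃, ∀ p q, p ≠ q → p ≠ l → q ≠ l → pairPerm a₂ a₃ p q = 0 :=
    fun a₂ h₂ a₃ h₃ p q hpq hpl hql =>
      pairPerm_of_T3_single
        (fun l' => by rw [T3_swap₁₃, T3_swap₂₃]; exact hT _ hl1 a₂ h₂ a₃ h₃ l') hpq hpl hql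
  -- a vector `x₃ ∈ A₃` with `x₃ l = 0`, and a column `m` with `x₃ m ≠ 0`
  obtain ⟨x₃, hx₃ne, hx₃l⟩ :=
    exists_ne_zero_ker hA₃ ((LinearMap.proj l : (Fin 4 → K) →ₗ[K] K).comp A₃.subtype)
  have hx₃l' : (x₃ : Fin 4 → K) l = 0 := hx₃l
  obtain ⟨m, hm⟩ : ∃ m, (x₃ : Fin 4 → K) m ≠ 0 := by
    by_contra h
    push Not at h
    exact hx₃ne (Subtype.ext (funext h))
  have hml : m ≠ l := by rintro rfl; exact hm hx₃l'
  have hinj1 : ∀ a ∈ A₁, a m = 0 → a l = 0 → a = 0 := by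
    intro a ha ham hal
    funext i
    by_cases him : i = m
    · rw [him]; exact ham
    by_cases hil : i = l
    · rw [hil]; exact hal
    have h := H2 a ha x₃ x₃.2 m i (Ne.symm him) hml hil
    simp only [pairPerm, ham, zero_mul, zero_add] at h
    exact (mul_eq_zero.mp h).resolve_right hm
  have hinj2 : ∀ a ∈ A₂, a m = 0 → a l = 0 → a = 0 := by
    intro a ha ham hal
    funext i
    by_cases him : i = m
    · rw [him]; exact ham
    by_cases hil : i = l
    · rw [hil]; exact hal
    have h := H1 a ha x₃ x₃.2 m i (Ne.symm him) hml hil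
    simp only [pairPerm, ham, zero_mul, zero_add] at h
    exact (mul_eq_zero.mp h).resolve_right hm
  obtain ⟨a₁, ha₁, ha₁m, -⟩ := exists_of_inj2 hA₁ hinj1 1 0
  obtain ⟨a₂, ha₂, ha₂m, -⟩ := exists_of_inj2 hA₂ hinj2 1 0
  -- `x₃` vanishes off `{l, m}` (characteristic `≠ 2`)
  have hx₃ : ∀ i, i ≠ l → i ≠ m → (x₃ : Fin 4 → K) i = 0 := by
    intro i hil him
    have h1 := H2 a₁ ha₁ x₃ x₃.2 m i (Ne.symm him) hml hil
    have h2 := H1 a₂ ha₂ x₃ x₃.2 m i (Ne.symm him) hml hil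
    have h12 := H3 a₁ ha₁ a₂ ha₂ m i (Ne.symm him) hml hil
    simp only [pairPerm, ha₁m, ha₂m, one_mul, mul_one] at h1 h2 h12
    have : (2 : K) * (x₃ : Fin 4 → K) i = 0 := by
      linear_combination h1 + h2 - (x₃ : Fin 4 → K) m * h12
    exact (mul_eq_zero.mp this).resolve_left two_ne_zero
  -- everything vanishes off `{l, m}`
  have hZ1 : ∀ a ∈ A₁, ∀ i, i ≠ l → i ≠ m → a i = 0 := by
    intro a ha i hil him
    have h := H2 a ha x₃ x₃.2 m i (Ne.symm him) hml hil
    rw [pairPerm, hx₃ i hil him, mul_zero, zero_add] at h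
    exact (mul_eq_zero.mp h).resolve_right hm
  have hZ2 : ∀ a ∈ A₂, ∀ i, i ≠ l → i ≠ m → a i = 0 := by
    intro a ha i hil him
    have h := H1 a ha x₃ x₃.2 m i (Ne.symm him) hml hil
    rw [pairPerm, hx₃ i hil him, mul_zero, zero_add] at h
    exact (mul_eq_zero.mp h).resolve_right hm
  have hZ3 : ∀ a ∈ A₃, ∀ i, i ≠ l → i ≠ m → a i = 0 := by
    intro a ha i hil him
    have h := H2 a₁ ha₁ a ha m i (Ne.symm him) hml hil
    rw [pairPerm, ha₁m, hZ1 a₁ ha₁ i hil him, one_mul, zero_mul, add_zero] at h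
    exact h
  -- the two remaining columns
  obtain ⟨γ, hγ0, hγ1⟩ := exists_perm_zero_one hml.symm
  have h2l : γ 2 ≠ l := by rw [← hγ0]; exact fun h => absurd (γ.injective h) (by decide)
  have h2m : γ 2 ≠ m := by rw [← hγ1]; exact fun h => absurd (γ.injective h) (by decide)
  have h3l : γ 3 ≠ l := by rw [← hγ0]; exact fun h => absurd (γ.injective h) (by decide)
  have h3m : γ 3 ≠ m := by rw [← hγ1]; exact fun h => absurd (γ.injective h) (by decide)
  refine ⟨γ 2, γ 3, fun h => absurd (γ.injective h) (by decide), ?_, ?_, ?_⟩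
  · exact fun a ha => ⟨hZ1 a ha _ h2l h2m, hZ1 a ha _ h3l h3m⟩
  · exact fun a ha => ⟨hZ2 a ha _ h2l h2m, hZ2 a ha _ h3l h3m⟩
  · exact fun a ha => ⟨hZ3 a ha _ h2l h2m, hZ3 a ha _ h3l h3m⟩

/-- **§3.8 TORIC TRIPLES — PROVED** (rev 2.5; was `stub_toricTriple`; no `SBShape`).  Normalise
`x = (1_p, 0_q, …)`, `y = (0_p, 1_q, …)` in `A₁`; for `a₃ ∈ A₃` the functional
`a₂ ↦ m_{pq}(a₂, a₃)` on the plane `A₂` has a nonzero kernel vector, which by the KERNEL PAIR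
lemma `smallKer` is a perpendicular partner of `a₃`; so (`PermOrthPairs`) every `a₃ ∈ A₃` is
supported on a pair, hence (`coordPair_of_cover`) `A₃` on ONE pair `{j, c}`, so `e_j ∈ A₃` and
CASE I (`toric_caseI`) concludes. -/
theorem toricTriple [CharZero K] (hPOP : PermOrthPairs K) : ToricTriple K := by
  intro A₁ A₂ A₃ hA₁ hA₂ hA₃ hT
  obtain ⟨p, q, x, y, hpq, hxA, hyA, hxp, hxq, hyp, hyq⟩ := exists_normalized hA₁
  have hcover : ∀ a₃ ∈ A₃, ∃ j c : Fin 4, j ≠ c ∧ ∀ i, i ≠ j → i ≠ c → a₃ i = 0 := by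
    intro a₃ ha₃
    obtain ⟨f, hf_def⟩ : ∃ f : A₂ →ₗ[K] K, f =
        a₃ q • ((LinearMap.proj p : (Fin 4 → K) →ₗ[K] K).comp A₂.subtype) +
          a₃ p • ((LinearMap.proj q : (Fin 4 → K) →ₗ[K] K).comp A₂.subtype) := ⟨_, rfl⟩
    have hf : ∀ a : A₂, f a = pairPerm (a : Fin 4 → K) a₃ p q := fun a => by
      rw [hf_def]
      simp only [LinearMap.add_apply, LinearMap.smul_apply, LinearMap.comp_apply,
        Submodule.subtype_apply, LinearMap.proj_apply, smul_eq_mul, pairPerm]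
      ring
    obtain ⟨a₂, ha₂ne, hfa₂⟩ := exists_ne_zero_ker hA₂ f
    rw [hf] at hfa₂
    have hperp : PermOrth (a₂ : Fin 4 → K) a₃ :=
      smallKer hpq (a₂ : Fin 4 → K) a₃ x y hxp hxq hyp hyq
        (fun l => hT x hxA a₂ a₂.2 a₃ ha₃ l) (fun l => hT y hyA a₂ a₂.2 a₃ ha₃ l) hfa₂
    rcases hPOP (a₂ : Fin 4 → K) a₃ hperp with h0 | h0 | ⟨j, c, hjc, hsup⟩
    · exact absurd (Subtype.ext h0) ha₂ne
    · exact ⟨0, 1, by decide, fun i _ _ => by rw [h0]; rfl⟩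
    · exact ⟨j, c, hjc, fun i hij hic => (hsup i hij hic).2⟩
  obtain ⟨j, c, hjc, hE⟩ := coordPair_of_cover A₃ hcover
  have hinj3 : ∀ a ∈ A₃, a j = 0 → a c = 0 → a = 0 := by
    intro a ha haj hac
    funext i
    by_cases hij : i = j
    · rw [hij]; exact haj
    by_cases hic : i = c
    · rw [hic]; exact hac
    exact hE a ha i hij hic
  obtain ⟨ej, hejA, hej1, hej0⟩ := exists_of_inj2 hA₃ hinj3 1 0
  have hej : ej = Pi.single j 1 := by
    funext i
    by_cases hij : i = j
    · rw [hij, hej1]; simp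
    by_cases hic : i = c
    · rw [hic, hej0]; simp [Ne.symm hjc]
    rw [hE ej hejA i hij hic]
    simp [hij]
  rw [hej] at hejA
  exact toric_caseI hA₁ hA₂ hA₃ hT hejA

/-! #### Leaf 1 (rev 2.6): the zero-line lemma — Part A + finite union + the anti-block count -/

/-- If `(P ± …)·(ℓ ± c) = 0` along `x ± x₀` with `c ≠ 0`, the quadratic `P` dies (char `≠ 2`). -/
theorem quad_kill [CharZero K] {Px P0 B xab c : K} (hc : c ≠ 0) (e0 : Px * xab = 0) (p0 : P0 = 0)
    (ep : (Px + B + P0) * (xab + c) = 0) (em : (Px - B + P0) * (xab - c) = 0) : Px = 0 := by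
  have h : 2 * c ^ 2 * Px = 0 := by
    linear_combination c * ep - c * em - xab * ep - xab * em + 2 * xab * e0 +
      2 * (xab ^ 2 - c ^ 2) * p0
  rcases mul_eq_zero.mp h with h | h
  · exact absurd (mul_eq_zero.mp h) (by simp [hc])
  · exact h

/-- Totally isotropic subspaces of the split form `v₀ v₃ + v₁ v₂` on `K⁴` have dimension `≤ 2`. -/
theorem iso_le_two (V : Submodule K (Fin 4 → K)) (hV : ∀ v ∈ V, v 0 * v 3 + v 1 * v 2 = 0) :
    finrank K V ≤ 2 := by
  have hB : ∀ v ∈ V, ∀ w ∈ V, v 0 * w 3 + v 3 * w 0 + v 1 * w 2 + v 2 * w 1 = 0 := by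
    intro v hv w hw
    have h := hV (v + w) (V.add_mem hv hw)
    simp only [Pi.add_apply] at h
    linear_combination h - hV v hv - hV w hw
  have key : ∀ a b : Fin 4, (∀ v ∈ V, v a = 0 → v b = 0 → v = 0) → finrank K V ≤ 2 := by
    intro a b hinj
    obtain ⟨π, hπ_def⟩ : ∃ π : V →ₗ[K] K × K, π =
        ((LinearMap.proj a : (Fin 4 → K) →ₗ[K] K).comp V.subtype).prod
          ((LinearMap.proj b : (Fin 4 → K) →ₗ[K] K).comp V.subtype) := ⟨_, rfl⟩
    have hπ : ∀ x : V, π x = ((x : Fin 4 → K) a, (x : Fin 4 → K) b) := fun x => by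
      rw [hπ_def]; rfl
    have hinj' : Function.Injective π := by
      intro x y hxy
      rw [hπ, hπ, Prod.mk.injEq] at hxy
      apply Subtype.ext
      have := hinj ((x : Fin 4 → K) - y) (V.sub_mem x.2 y.2)
        (by rw [Pi.sub_apply, hxy.1, sub_self]) (by rw [Pi.sub_apply, hxy.2, sub_self])
      exact sub_eq_zero.mp this
    have := LinearMap.finrank_le_finrank_of_injective hinj'
    simpa using this
  by_cases h01 : ∀ v ∈ V, v 0 = 0 → v 1 = 0 → v = 0
  · exact key 0 1 h01
  by_cases h23 : ∀ v ∈ V, v 2 = 0 → v 3 = 0 → v = 0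
  · exact key 2 3 h23
  push Not at h01 h23
  obtain ⟨p, hpV, hp0, hp1, hpne⟩ := h01
  obtain ⟨q, hqV, hq2, hq3, hqne⟩ := h23
  have rp : ∀ w ∈ V, p 3 * w 0 + p 2 * w 1 = 0 := fun w hw => by
    have h := hB p hpV w hw
    rw [hp0, hp1] at h
    linear_combination h
  have rq : ∀ w ∈ V, q 0 * w 3 + q 1 * w 2 = 0 := fun w hw => by
    have h := hB q hqV w hw
    rw [hq2, hq3] at h
    linear_combination h
  have hp23 : p 2 ≠ 0 ∨ p 3 ≠ 0 := by
    by_contra h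
    push Not at h
    exact hpne (funext fun i => by
      rcases fin4_cases i with rfl | rfl | rfl | rfl
      · exact hp0
      · exact hp1
      · exact h.1
      · exact h.2)
  have hq01 : q 0 ≠ 0 ∨ q 1 ≠ 0 := by
    by_contra h
    push Not at h
    exact hqne (funext fun i => by
      rcases fin4_cases i with rfl | rfl | rfl | rfl
      · exact h.1
      · exact h.2
      · exact hq2
      · exact hq3)
  -- from `rp`: `w a' = 0 ⇒ w (other) = 0` on `{0,1}`; from `rq` likewise on `{2,3}`
  have hw01 : ∀ w ∈ V, (p 2 ≠ 0 → w 0 = 0 → w 1 = 0) ∧ (p 3 ≠ 0 → w 1 = 0 → w 0 = 0) := by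
    intro w hw
    refine ⟨fun hp2 h0 => ?_, fun hp3 h1 => ?_⟩
    · have h := rp w hw
      rw [h0] at h
      have : p 2 * w 1 = 0 := by linear_combination h
      exact (mul_eq_zero.mp this).resolve_left hp2
    · have h := rp w hw
      rw [h1] at h
      have : p 3 * w 0 = 0 := by linear_combination h
      exact (mul_eq_zero.mp this).resolve_left hp3
  have hw23 : ∀ w ∈ V, (q 0 ≠ 0 → w 2 = 0 → w 3 = 0) ∧ (q 1 ≠ 0 → w 3 = 0 → w 2 = 0) := by
    intro w hw
    refine ⟨fun hq0 h2 => ?_, fun hq1 h3 => ?_⟩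
    · have h := rq w hw
      rw [h2] at h
      have : q 0 * w 3 = 0 := by linear_combination h
      exact (mul_eq_zero.mp this).resolve_left hq0
    · have h := rq w hw
      rw [h3] at h
      have : q 1 * w 2 = 0 := by linear_combination h
      exact (mul_eq_zero.mp this).resolve_left hq1
  have fin : ∀ w : Fin 4 → K, w 0 = 0 → w 1 = 0 → w 2 = 0 → w 3 = 0 → w = 0 := by
    intro w h0 h1 h2 h3
    funext i
    rcases fin4_cases i with rfl | rfl | rfl | rfl
    · exact h0
    · exact h1
    · exact h2
    · exact h3
  rcases hp23 with hp2 | hp3 <;> rcases hq01 with hq0 | hq1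
  · exact key 0 2 fun w hw h0 h2 =>
      fin w h0 ((hw01 w hw).1 hp2 h0) h2 ((hw23 w hw).1 hq0 h2)
  · exact key 0 3 fun w hw h0 h3 =>
      fin w h0 ((hw01 w hw).1 hp2 h0) ((hw23 w hw).2 hq1 h3) h3
  · exact key 1 2 fun w hw h1 h2 =>
      fin w ((hw01 w hw).2 hp3 h1) h1 h2 ((hw23 w hw).1 hq0 h2)
  · exact key 1 3 fun w hw h1 h3 =>
      fin w ((hw01 w hw).2 hp3 h1) h1 ((hw23 w hw).2 hq1 h3) h3

/-- The `P`-block and `Q`-block coordinates of the normal anti-block. -/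
def cP : Fin 4 → Fin 4 × Fin 4 := ![(0, 2), (0, 3), (1, 2), (1, 3)]
def cQ : Fin 4 → Fin 4 × Fin 4 := ![(2, 0), (2, 1), (3, 0), (3, 1)]

def πP : (Fin 4 × Fin 4 → K) →ₗ[K] (Fin 4 → K) :=
  LinearMap.pi fun k => LinearMap.proj (cP k)
def πQ : (Fin 4 × Fin 4 → K) →ₗ[K] (Fin 4 → K) :=
  LinearMap.pi fun k => LinearMap.proj (cQ k)

@[simp] theorem πP_apply (x : Fin 4 × Fin 4 → K) (k : Fin 4) : πP (K := K) x k = x (cP k) := rfl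
@[simp] theorem πQ_apply (x : Fin 4 × Fin 4 → K) (k : Fin 4) : πQ (K := K) x k = x (cQ k) := rfl
@[simp] theorem cP_0 : cP 0 = (0, 2) := rfl
@[simp] theorem cP_1 : cP 1 = (0, 3) := rfl
@[simp] theorem cP_2 : cP 2 = (1, 2) := rfl
@[simp] theorem cP_3 : cP 3 = (1, 3) := rfl
@[simp] theorem cQ_0 : cQ 0 = (2, 0) := rfl
@[simp] theorem cQ_1 : cQ 1 = (2, 1) := rfl
@[simp] theorem cQ_2 : cQ 2 = (3, 0) := rfl
@[simp] theorem cQ_3 : cQ 3 = (3, 1) := rfl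

/-- **ANTI-BLOCK in normal position.**  If `W ⊆ Sing` has `x (a, b) = 0` whenever
`[a ∈ {0,1}] = [b ∈ {0,1}]` (so `W` lives on `P = {0,1} × {2,3}` and `Q = {2,3} × {0,1}`), then row
`0` or row `2` vanishes on `W`, or `dim W ≤ 4`: the subpermanents `per(P)·q`, `per(Q)·p` vanish, so
(along `x ± x₀`, characteristic `≠ 2`) `Q ≡ 0`, or `P ≡ 0`, or `per(P) ≡ per(Q) ≡ 0` on `W`, and a
totally isotropic plane of `p₁₁p₂₂ + p₁₂p₂₁` has dimension `≤ 2` (`iso_le_two`). -/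
theorem anti_normal [CharZero K] {W : Submodule K (Fin 4 × Fin 4 → K)} (hS : Sing3 W)
    (h5 : 5 ≤ finrank K W)
    (hZ : ∀ x ∈ W, ∀ a b : Fin 4, ((a = 0 ∨ a = 1) ↔ (b = 0 ∨ b = 1)) → x (a, b) = 0) :
    (∀ x ∈ W, ∀ j, x (0, j) = 0) ∨ (∀ x ∈ W, ∀ j, x (2, j) = 0) := by
  -- (A) per(P)·q = 0
  have hA : ∀ x ∈ W, ∀ a b : Fin 4, (a = 2 ∨ a = 3) → (b = 0 ∨ b = 1) →
      (x (0, 2) * x (1, 3) + x (0, 3) * x (1, 2)) * x (a, b) = 0 := by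
    intro x hx a b ha hb
    have z := hZ x hx
    rcases ha with rfl | rfl <;> rcases hb with rfl | rfl
    · have t := T3_eq_zero_of_sing3 hS hx 0 1 2 (by decide) (by decide) (by decide) 1
      rw [(T3_explicit _ _ _).2.1] at t
      simp only [row_apply, z 0 0 (by decide), z 1 0 (by decide), z 2 2 (by decide),
        z 2 3 (by decide)] at t
      linear_combination t
    · have t := T3_eq_zero_of_sing3 hS hx 0 1 2 (by decide) (by decide) (by decide) 0
      rw [(T3_explicit _ _ _).1] at t
      simp only [row_apply, z 0 1 (by decide), z 1 1 (by decide), z 2 2 (by decide),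
        z 2 3 (by decide)] at t
      linear_combination t
    · have t := T3_eq_zero_of_sing3 hS hx 0 1 3 (by decide) (by decide) (by decide) 1
      rw [(T3_explicit _ _ _).2.1] at t
      simp only [row_apply, z 0 0 (by decide), z 1 0 (by decide), z 3 2 (by decide),
        z 3 3 (by decide)] at t
      linear_combination t
    · have t := T3_eq_zero_of_sing3 hS hx 0 1 3 (by decide) (by decide) (by decide) 0
      rw [(T3_explicit _ _ _).1] at t
      simp only [row_apply, z 0 1 (by decide), z 1 1 (by decide), z 3 2 (by decide),
        z 3 3 (by decide)] at t
      linear_combination t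
  -- (B) per(Q)·p = 0
  have hB : ∀ x ∈ W, ∀ a b : Fin 4, (a = 0 ∨ a = 1) → (b = 2 ∨ b = 3) →
      (x (2, 0) * x (3, 1) + x (2, 1) * x (3, 0)) * x (a, b) = 0 := by
    intro x hx a b ha hb
    have z := hZ x hx
    rcases ha with rfl | rfl <;> rcases hb with rfl | rfl
    · have t := T3_eq_zero_of_sing3 hS hx 2 3 0 (by decide) (by decide) (by decide) 3
      rw [(T3_explicit _ _ _).2.2.2] at t
      simp only [row_apply, z 2 2 (by decide), z 3 2 (by decide), z 0 0 (by decide),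
        z 0 1 (by decide)] at t
      linear_combination t
    · have t := T3_eq_zero_of_sing3 hS hx 2 3 0 (by decide) (by decide) (by decide) 2
      rw [(T3_explicit _ _ _).2.2.1] at t
      simp only [row_apply, z 2 3 (by decide), z 3 3 (by decide), z 0 0 (by decide),
        z 0 1 (by decide)] at t
      linear_combination t
    · have t := T3_eq_zero_of_sing3 hS hx 2 3 1 (by decide) (by decide) (by decide) 3
      rw [(T3_explicit _ _ _).2.2.2] at t
      simp only [row_apply, z 2 2 (by decide), z 3 2 (by decide), z 1 0 (by decide),
        z 1 1 (by decide)] at t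
      linear_combination t
    · have t := T3_eq_zero_of_sing3 hS hx 2 3 1 (by decide) (by decide) (by decide) 2
      rw [(T3_explicit _ _ _).2.2.1] at t
      simp only [row_apply, z 2 3 (by decide), z 3 3 (by decide), z 1 0 (by decide),
        z 1 1 (by decide)] at t
      linear_combination t
  -- (C) `Q ≡ 0` on `W` (⇒ row 2 vanishes) or `per(P) ≡ 0` on `W`
  by_cases hQ : ∀ x ∈ W, ∀ a b : Fin 4, (a = 2 ∨ a = 3) → (b = 0 ∨ b = 1) → x (a, b) = 0
  · right
    intro x hx j
    rcases fin4_cases j with rfl | rfl | rfl | rfl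
    · exact hQ x hx 2 0 (Or.inl rfl) (Or.inl rfl)
    · exact hQ x hx 2 1 (Or.inl rfl) (Or.inr rfl)
    · exact hZ x hx 2 2 (by decide)
    · exact hZ x hx 2 3 (by decide)
  have hP0 : ∀ x ∈ W, x (0, 2) * x (1, 3) + x (0, 3) * x (1, 2) = 0 := by
    push Not at hQ
    obtain ⟨x₀, hx₀, a, b, ha, hb, hc⟩ := hQ
    have p0 : x₀ (0, 2) * x₀ (1, 3) + x₀ (0, 3) * x₀ (1, 2) = 0 :=
      (mul_eq_zero.mp (hA x₀ hx₀ a b ha hb)).resolve_right hc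
    intro x hx
    have e0 := hA x hx a b ha hb
    have ep := hA (x + x₀) (W.add_mem hx hx₀) a b ha hb
    have em := hA (x - x₀) (W.sub_mem hx hx₀) a b ha hb
    simp only [Pi.add_apply, Pi.sub_apply] at ep em
    refine quad_kill (B := x (0, 2) * x₀ (1, 3) + x₀ (0, 2) * x (1, 3) + x (0, 3) * x₀ (1, 2) +
      x₀ (0, 3) * x (1, 2)) hc e0 p0 ?_ ?_
    · linear_combination ep
    · linear_combination em
  -- (D) `P ≡ 0` on `W` (⇒ row 0 vanishes) or `per(Q) ≡ 0` on `W`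
  by_cases hP : ∀ x ∈ W, ∀ a b : Fin 4, (a = 0 ∨ a = 1) → (b = 2 ∨ b = 3) → x (a, b) = 0
  · left
    intro x hx j
    rcases fin4_cases j with rfl | rfl | rfl | rfl
    · exact hZ x hx 0 0 (by decide)
    · exact hZ x hx 0 1 (by decide)
    · exact hP x hx 0 2 (Or.inl rfl) (Or.inl rfl)
    · exact hP x hx 0 3 (Or.inl rfl) (Or.inr rfl)
  have hQ0 : ∀ x ∈ W, x (2, 0) * x (3, 1) + x (2, 1) * x (3, 0) = 0 := by
    push Not at hP
    obtain ⟨x₀, hx₀, a, b, ha, hb, hc⟩ := hP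
    have p0 : x₀ (2, 0) * x₀ (3, 1) + x₀ (2, 1) * x₀ (3, 0) = 0 :=
      (mul_eq_zero.mp (hB x₀ hx₀ a b ha hb)).resolve_right hc
    intro x hx
    have e0 := hB x hx a b ha hb
    have ep := hB (x + x₀) (W.add_mem hx hx₀) a b ha hb
    have em := hB (x - x₀) (W.sub_mem hx hx₀) a b ha hb
    simp only [Pi.add_apply, Pi.sub_apply] at ep em
    refine quad_kill (B := x (2, 0) * x₀ (3, 1) + x₀ (2, 0) * x (3, 1) + x (2, 1) * x₀ (3, 0) +
      x₀ (2, 1) * x (3, 0)) hc e0 p0 ?_ ?_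
    · linear_combination ep
    · linear_combination em
  -- (E) both block projections are totally isotropic planes: `dim W ≤ 2 + 2`
  exfalso
  have hVP : finrank K (W.map (πP (K := K))) ≤ 2 := by
    refine iso_le_two _ fun v hv => ?_
    obtain ⟨x, hx, rfl⟩ := Submodule.mem_map.mp hv
    simpa using hP0 x hx
  have hVQ : finrank K (W.map (πQ (K := K))) ≤ 2 := by
    refine iso_le_two _ fun v hv => ?_
    obtain ⟨x, hx, rfl⟩ := Submodule.mem_map.mp hv
    simpa using hQ0 x hx
  obtain ⟨Ω, hΩ_def⟩ : ∃ Ω : W →ₗ[K] ↥(W.map (πP (K := K))) × ↥(W.map (πQ (K := K))), Ω =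
      (LinearMap.codRestrict (W.map (πP (K := K))) ((πP (K := K)).comp W.subtype)
          (fun w => Submodule.mem_map_of_mem w.2)).prod
        (LinearMap.codRestrict (W.map (πQ (K := K))) ((πQ (K := K)).comp W.subtype)
          (fun w => Submodule.mem_map_of_mem w.2)) := ⟨_, rfl⟩
  have hΩ : ∀ w : W, (((Ω w).1 : Fin 4 → K), ((Ω w).2 : Fin 4 → K)) =
      (πP (K := K) (w : Fin 4 × Fin 4 → K), πQ (K := K) (w : Fin 4 × Fin 4 → K)) := fun w => by
    rw [hΩ_def]; rfl
  have hΩinj : Function.Injective Ω := by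
    intro w w' h
    have h1 := congrArg (fun z : ↥(W.map (πP (K := K))) × ↥(W.map (πQ (K := K))) =>
      (((z.1 : Fin 4 → K)), ((z.2 : Fin 4 → K)))) h
    simp only [hΩ, Prod.mk.injEq] at h1
    obtain ⟨hPeq, hQeq⟩ := h1
    apply Subtype.ext
    funext ij
    obtain ⟨i, j⟩ := ij
    have eP := fun k => congrFun hPeq k
    have eQ := fun k => congrFun hQeq k
    simp only [πP_apply, πQ_apply] at eP eQ
    rcases fin4_cases i with rfl | rfl | rfl | rfl <;>
      rcases fin4_cases j with rfl | rfl | rfl | rfl <;>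
      first
        | exact eP 0 | exact eP 1 | exact eP 2 | exact eP 3
        | exact eQ 0 | exact eQ 1 | exact eQ 2 | exact eQ 3
        | (rw [hZ _ w.2 _ _ (by decide), hZ _ w'.2 _ _ (by decide)])
  have hle := LinearMap.finrank_le_finrank_of_injective hΩinj
  rw [Module.finrank_prod] at hle
  omega

/-- Simultaneous row/column permutation `x ↦ ((i, j) ↦ x (ρ i, γ j))` as a linear equivalence. -/
def biPermL (ρ γ : Equiv.Perm (Fin 4)) : (Fin 4 × Fin 4 → K) ≃ₗ[K] (Fin 4 × Fin 4 → K) :=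
  LinearEquiv.funCongrLeft K K (Equiv.prodCongr ρ γ)

@[simp] theorem biPermL_apply (ρ γ : Equiv.Perm (Fin 4)) (x : Fin 4 × Fin 4 → K) (i j : Fin 4) :
    biPermL ρ γ x (i, j) = x (ρ i, γ j) := rfl

theorem sing3_map_biPermL {W : Submodule K (Fin 4 × Fin 4 → K)} (hS : Sing3 W)
    (ρ γ : Equiv.Perm (Fin 4)) :
    Sing3 (W.map (biPermL (K := K) ρ γ : (Fin 4 × Fin 4 → K) →ₗ[K] (Fin 4 × Fin 4 → K))) := by
  intro y hy r c hr hc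
  obtain ⟨x, hx, rfl⟩ := Submodule.mem_map.mp hy
  have key : (Matrix.of fun i j => (biPermL (K := K) ρ γ : (Fin 4 × Fin 4 → K) →ₗ[K]
      (Fin 4 × Fin 4 → K)) x (i, j)).submatrix r c =
      (Matrix.of fun i j => x (i, j)).submatrix (ρ ∘ r) (γ ∘ c) := Matrix.ext fun _ _ => rfl
  rw [key]
  exact hS x hx _ _ (ρ.injective.comp hr) (γ.injective.comp hc)

/-- **ANTI-BLOCK, general position** (transport of `anti_normal` by `biPermL`): a zero row. -/
theorem anti_case [CharZero K] {W : Submodule K (Fin 4 × Fin 4 → K)} (hS : Sing3 W)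
    (h5 : 5 ≤ finrank K W) {i₁ i₂ j₁ j₂ : Fin 4} (hi : i₁ ≠ i₂) (hj : j₁ ≠ j₂)
    (hW : ∀ x ∈ W, ∀ i j, ((i = i₁ ∨ i = i₂) ↔ (j = j₁ ∨ j = j₂)) → x (i, j) = 0) :
    ∃ i : Fin 4, ∀ x ∈ W, ∀ j : Fin 4, x (i, j) = 0 := by
  obtain ⟨ρ, hρ0, hρ1⟩ := exists_perm_zero_one hi
  obtain ⟨γ, hγ0, hγ1⟩ := exists_perm_zero_one hj
  set L : (Fin 4 × Fin 4 → K) →ₗ[K] (Fin 4 × Fin 4 → K) :=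
    (biPermL (K := K) ρ γ : (Fin 4 × Fin 4 → K) →ₗ[K] (Fin 4 × Fin 4 → K)) with hL
  have hS' : Sing3 (W.map L) := sing3_map_biPermL hS ρ γ
  have h5' : 5 ≤ finrank K (W.map L) := by
    have : finrank K (W.map L) = finrank K W := LinearEquiv.finrank_map_eq _ _
    omega
  have hZ' : ∀ y ∈ W.map L, ∀ a b : Fin 4, ((a = 0 ∨ a = 1) ↔ (b = 0 ∨ b = 1)) → y (a, b) = 0 := by
    intro y hy a b hab
    obtain ⟨x, hx, rfl⟩ := Submodule.mem_map.mp hy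
    show x (ρ a, γ b) = 0
    apply hW x hx
    rw [← hρ0, ← hρ1, ← hγ0, ← hγ1]
    simpa only [Equiv.apply_eq_iff_eq] using hab
  have back : ∀ r : Fin 4, (∀ y ∈ W.map L, ∀ j, y (r, j) = 0) → ∀ x ∈ W, ∀ j, x (ρ r, j) = 0 := by
    intro r hr x hx j
    have := hr (L x) (Submodule.mem_map_of_mem hx) (γ.symm j)
    simpa [hL] using this
  rcases anti_normal hS' h5' hZ' with h0 | h2
  · exact ⟨ρ 0, back 0 h0⟩
  · exact ⟨ρ 2, back 2 h2⟩

/-- The four pattern submodules of Part A. -/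
def RowZ (i : Fin 4) : Submodule K (Fin 4 × Fin 4 → K) where
  carrier := {x | ∀ j, x (i, j) = 0}
  add_mem' := by
    intro a b ha hb j
    simp [ha j, hb j]
  zero_mem' := by
    intro j
    simp
  smul_mem' := by
    intro r a ha j
    simp [ha j]

def ColZ (j : Fin 4) : Submodule K (Fin 4 × Fin 4 → K) where
  carrier := {x | ∀ i, x (i, j) = 0}
  add_mem' := by
    intro a b ha hb i
    simp [ha i, hb i]
  zero_mem' := by
    intro i
    simp
  smul_mem' := by
    intro r a ha i
    simp [ha i]

def CrossZ (i₀ j₀ : Fin 4) : Submodule K (Fin 4 × Fin 4 → K) where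
  carrier := {x | ∀ i j, i ≠ i₀ → j ≠ j₀ → x (i, j) = 0}
  add_mem' := by
    intro a b ha hb i j hi hj
    simp [ha i j hi hj, hb i j hi hj]
  zero_mem' := by
    intro i j _ _
    simp
  smul_mem' := by
    intro r a ha i j hi hj
    simp [ha i j hi hj]

def AntiZ (i₁ i₂ j₁ j₂ : Fin 4) : Submodule K (Fin 4 × Fin 4 → K) where
  carrier := {x | ∀ i j, ((i = i₁ ∨ i = i₂) ↔ (j = j₁ ∨ j = j₂)) → x (i, j) = 0}
  add_mem' := by
    intro a b ha hb i j hij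
    simp [ha i j hij, hb i j hij]
  zero_mem' := by
    intro i j _
    simp
  smul_mem' := by
    intro r a ha i j hij
    simp [ha i j hij]

theorem mem_RowZ {i : Fin 4} {x : Fin 4 × Fin 4 → K} : x ∈ RowZ (K := K) i ↔ ∀ j, x (i, j) = 0 :=
  Iff.rfl
theorem mem_ColZ {j : Fin 4} {x : Fin 4 × Fin 4 → K} : x ∈ ColZ (K := K) j ↔ ∀ i, x (i, j) = 0 :=
  Iff.rfl
theorem mem_CrossZ {i₀ j₀ : Fin 4} {x : Fin 4 × Fin 4 → K} :
    x ∈ CrossZ (K := K) i₀ j₀ ↔ ∀ i j, i ≠ i₀ → j ≠ j₀ → x (i, j) = 0 := Iff.rfl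
theorem mem_AntiZ {i₁ i₂ j₁ j₂ : Fin 4} {x : Fin 4 × Fin 4 → K} :
    x ∈ AntiZ (K := K) i₁ i₂ j₁ j₂ ↔
      ∀ i j, ((i = i₁ ∨ i = i₂) ↔ (j = j₁ ∨ j = j₂)) → x (i, j) = 0 := Iff.rfl

/-- Index of the `42` pieces (rows, columns, crosses, proper anti-blocks). -/
abbrev PieceIdx : Type :=
  (Fin 4 ⊕ Fin 4) ⊕ ((Fin 4 × Fin 4) ⊕ {p : Fin 4 × Fin 4 × Fin 4 × Fin 4 // p.1 ≠ p.2.1 ∧ p.2.2.1 ≠ p.2.2.2})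

/-- The pieces. -/
def piece : PieceIdx → Submodule K (Fin 4 × Fin 4 → K) :=
  Sum.elim (Sum.elim RowZ ColZ)
    (Sum.elim (fun c => CrossZ c.1 c.2) (fun p => AntiZ p.1.1 p.1.2.1 p.1.2.2.1 p.1.2.2.2))

/-- Part A pointwise: every element of `W ⊆ Sing` lies in one of the pieces. -/
theorem mem_piece_of_sing3 {W : Submodule K (Fin 4 × Fin 4 → K)} (hS : Sing3 W)
    (h12 : (12 : K) ≠ 0) {x : Fin 4 × Fin 4 → K} (hx : x ∈ W) : ∃ k : PieceIdx, x ∈ piece (K := K) k := by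
  have h := Summit.ValiantsHypothesis.ValiantsHypothesis.Theorems.SymPencilPerFourSingularLocusSupportPatterns.support_of_subperm_vanish
    h12 (Matrix.of fun i j => x (i, j))
    (fun r c => hS x hx _ _ Fin.succAbove_right_injective Fin.succAbove_right_injective)
  rcases h with ⟨i, hi⟩ | ⟨j, hj⟩ | ⟨i₁, i₂, j₁, j₂, h₁, h₂, hA⟩ | ⟨i₀, j₀, hC⟩
  · exact ⟨Sum.inl (Sum.inl i), fun j => hi j⟩
  · exact ⟨Sum.inl (Sum.inr j), fun i => hj i⟩
  · exact ⟨Sum.inr (Sum.inr ⟨(i₁, i₂, j₁, j₂), h₁, h₂⟩), fun i j hij => hA i j hij⟩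
  · exact ⟨Sum.inr (Sum.inl (i₀, j₀)), fun i j hi hj => hC i j hi hj⟩

/-- **LEAF 1 — ZERO-LINE LEMMA — PROVED** (rev 2.6; the statement of rev 1's `stub_zeroLine`,
VERBATIM; memo §2).  A linear subspace of `Sing Z(per₄)` of dimension `≥ 5` lies in a cross or has an
identically-zero row or column.  Part A (`SymPencilPerFourSingularLocusSupportPatterns.
support_of_subperm_vanish`, p615473) puts every `x ∈ W` inside one of the `42` coordinate subspaces
`piece` (4 rows, 4 columns, 16 crosses, 18 proper anti-blocks); a vector space over an infinite field
is not a finite union of proper subspaces (`Submodule.exists_forall_notMem_of_forall_ne_top`), so `W`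
lies in ONE piece; rows / columns / crosses are conclusions, and a proper anti-block `[[0,P],[Q,0]]`
is `anti_case` (zero row, since `dim W ≥ 5 > 2 + 2`). [folklore] -/
theorem zeroLine [CharZero K] :
    ∀ W : Submodule K (Fin 4 × Fin 4 → K), Sing3 W → 5 ≤ finrank K W →
      InCross W ∨ (∃ i : Fin 4, ∀ x ∈ W, ∀ j : Fin 4, x (i, j) = 0) ∨
        (∃ j : Fin 4, ∀ x ∈ W, ∀ i : Fin 4, x (i, j) = 0) := by
  intro W hS h5
  have h12 : (12 : K) ≠ 0 := by norm_num
  by_contra hnot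
  have hne : ∀ k : PieceIdx, (piece (K := K) k).comap W.subtype ≠ ⊤ := by
    intro k hk
    have hall : ∀ x ∈ W, x ∈ piece (K := K) k := fun x hx => by
      have hmem : (⟨x, hx⟩ : W) ∈ (piece (K := K) k).comap W.subtype := by
        rw [hk]; exact Submodule.mem_top
      exact hmem
    rcases k with (i | j) | (c | p)
    · exact hnot (Or.inr (Or.inl ⟨i, fun x hx j => (mem_RowZ.mp (hall x hx)) j⟩))
    · exact hnot (Or.inr (Or.inr ⟨j, fun x hx i => (mem_ColZ.mp (hall x hx)) i⟩))
    · exact hnot (Or.inl ⟨c.1, c.2, fun x hx i j hi hj => (mem_CrossZ.mp (hall x hx)) i j hi hj⟩)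
    · exact hnot (Or.inr (Or.inl (anti_case hS h5 p.2.1 p.2.2
        (fun x hx => mem_AntiZ.mp (hall x hx)))))
  obtain ⟨x, hx⟩ := Submodule.exists_forall_notMem_of_forall_ne_top
    (fun k : PieceIdx => (piece (K := K) k).comap W.subtype) hne
  obtain ⟨k, hk⟩ := mem_piece_of_sing3 hS h12 x.2
  exact hx k hk

/-- **`caseFour_of`** (PROVED): the case `n_r = 4` from the kernel-plane types and the three sub-cases. -/
theorem caseFour_of [CharZero K] (hP : PerpPlanes K) (hPure : CasePure K) (hProd : CaseProduct K)
    (hGraph : CaseGraph K) : CaseFour K := by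
  intro W ρ hN hρ htop
  obtain ⟨hS, h6, h0⟩ := hN
  have h02 : (0 : Fin 4) ≠ ρ 2 := by rw [← hρ]; exact fun h => by simpa using ρ.injective h
  have h03 : (0 : Fin 4) ≠ ρ 3 := by rw [← hρ]; exact fun h => by simpa using ρ.injective h
  have h12 : ρ 1 ≠ ρ 2 := fun h => by simpa using ρ.injective h
  have h13 : ρ 1 ≠ ρ 3 := fun h => by simpa using ρ.injective h
  have h23 : ρ 2 ≠ ρ 3 := fun h => by simpa using ρ.injective h
  set D : Submodule K (Fin 4 × Fin 4 → K) := W ⊓ LinearMap.ker (rowL (K := K) (ρ 1)) with hD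
  -- rows other than `ρ 2, ρ 3` vanish on `D`
  have hrows : ∀ d ∈ D, ∀ i, i ≠ ρ 2 → i ≠ ρ 3 → row d i = 0 := by
    intro d hd i hi2 hi3
    rw [mem_kerPlane] at hd
    rcases fin4_of_perm ρ i with rfl | rfl | rfl | rfl
    · rw [hρ]; exact h0 d hd.1
    · exact hd.2
    · exact absurd rfl hi2
    · exact absurd rfl hi3
  have hD2 : finrank K D = 2 := finrank_kerPlane h6 htop
  -- every element of `D` is a perm-orthogonal pair of rows (POLARISATION)
  have hperp : ∀ d ∈ D, PermOrth (row d (ρ 2)) (row d (ρ 3)) := by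
    intro d hd
    rw [mem_kerPlane] at hd
    refine permOrth_of_T3 fun u l => ?_
    have hu : u ∈ W.map (rowL (ρ 1)) := by rw [htop]; exact Submodule.mem_top
    obtain ⟨x, hx, rfl⟩ := Submodule.mem_map.mp hu
    exact polar hS h12 h13 h23 hx hd.1 hd.2 l
  have hKiff : ∀ k, (k ∈ W ∧ row k (ρ 1) = 0) ↔ k ∈ D := fun k => mem_kerPlane.symm
  rcases hP D (ρ 2) (ρ 3) h23 hrows (by omega) hperp with hPv | hPw | ⟨-, hProdT | hGraphT⟩
  · -- row `ρ 2` vanishes on `K_r`: pure case ⇒ rows `0, ρ 2` vanish on `W`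
    have hW : ∀ x ∈ W, row x (ρ 2) = 0 :=
      hPure W ρ ⟨hS, h6, h0⟩ hρ htop fun k hk hkr => hPv k (mem_kerPlane.mpr ⟨hk, hkr⟩)
    refine Or.inr (Or.inl ⟨0, ρ 2, h02, fun x hx j => ⟨?_, ?_⟩⟩)
    · exact congrFun (h0 x hx) j
    · exact congrFun (hW x hx) j
  · -- row `ρ 3` vanishes on `K_r`: pure case with `ρ ∘ (2 3)`
    have e0 : ((Equiv.swap (2 : Fin 4) 3).trans ρ) 0 = 0 := by
      simp [Equiv.swap_apply_of_ne_of_ne, hρ]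
    have e1 : ((Equiv.swap (2 : Fin 4) 3).trans ρ) 1 = ρ 1 := by
      simp [Equiv.swap_apply_of_ne_of_ne]
    have e2 : ((Equiv.swap (2 : Fin 4) 3).trans ρ) 2 = ρ 3 := by simp
    have hW : ∀ x ∈ W, row x (ρ 3) = 0 := by
      have := hPure W ((Equiv.swap (2 : Fin 4) 3).trans ρ) ⟨hS, h6, h0⟩ e0 (by rw [e1]; exact htop)
        (fun k hk hkr => by
          rw [e2]; rw [e1] at hkr; exact hPw k (mem_kerPlane.mpr ⟨hk, hkr⟩))
      rw [e2] at this
      exact this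
    refine Or.inr (Or.inl ⟨0, ρ 3, h03, fun x hx j => ⟨?_, ?_⟩⟩)
    · exact congrFun (h0 x hx) j
    · exact congrFun (hW x hx) j
  · obtain ⟨j, c, α, β, hjc, hαβ, hmem⟩ := hProdT
    rcases hProd W ρ j c α β ⟨hS, h6, h0⟩ hρ htop hjc hαβ (fun k => (hKiff k).trans (hmem k)) with
      hV | hX
    · exact Or.inr (Or.inr (Or.inr (Or.inl hV)))
    · exact Or.inl hX
  · obtain ⟨j, c, e, hjc, he, hmem⟩ := hGraphT
    have hV := hGraph W ρ j c e ⟨hS, h6, h0⟩ hρ htop hjc he (fun k => (hKiff k).trans (hmem k))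
    exact Or.inr (Or.inr (Or.inr (Or.inr (Or.inl hV))))

/-- The TORIC ENVELOPE `{x : row₀ x = 0, rowᵢ x ∈ Aᵢ (i ≠ 0)}` of `W` (used for `ToricStructure`). -/
def toricEnvelope (W : Submodule K (Fin 4 × Fin 4 → K)) : Submodule K (Fin 4 × Fin 4 → K) where
  carrier := {x | row x 0 = 0 ∧ ∀ i : Fin 4, i ≠ 0 → row x i ∈ W.map (rowL i)}
  add_mem' := by
    rintro x y ⟨hx0, hx⟩ ⟨hy0, hy⟩
    refine ⟨by rw [row_add, hx0, hy0, add_zero], fun i hi => ?_⟩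
    rw [row_add]
    exact Submodule.add_mem _ (hx i hi) (hy i hi)
  zero_mem' := ⟨rfl, fun i hi => Submodule.zero_mem _⟩
  smul_mem' := by
    rintro c x ⟨hx0, hx⟩
    refine ⟨by rw [row_smul, hx0, smul_zero], fun i hi => ?_⟩
    rw [row_smul]
    exact Submodule.smul_mem _ c (hx i hi)

theorem mem_toricEnvelope {W : Submodule K (Fin 4 × Fin 4 → K)} {x : Fin 4 × Fin 4 → K} :
    x ∈ toricEnvelope W ↔ row x 0 = 0 ∧ ∀ i : Fin 4, i ≠ 0 → row x i ∈ W.map (rowL i) :=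
  Iff.rfl

theorem le_toricEnvelope {W : Submodule K (Fin 4 × Fin 4 → K)} (h0 : ∀ x ∈ W, row x 0 = 0) :
    W ≤ toricEnvelope W :=
  fun x hx => ⟨h0 x hx, fun i hi => Submodule.mem_map_of_mem hx⟩

/-- `dim (toric envelope) ≤ n₁ + n₂ + n₃` (it embeds into `A₁ × A₂ × A₃`). -/
theorem finrank_toricEnvelope_le (W : Submodule K (Fin 4 × Fin 4 → K)) :
    finrank K (toricEnvelope W) ≤ finrank K (W.map (rowL 1)) +
      (finrank K (W.map (rowL 2)) + finrank K (W.map (rowL 3))) := by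
  obtain ⟨F, hF⟩ : ∃ F : toricEnvelope W →ₗ[K]
      (↥(W.map (rowL (K := K) 1)) × (↥(W.map (rowL (K := K) 2)) × ↥(W.map (rowL (K := K) 3)))),
      Function.Injective F := by
    refine ⟨LinearMap.prod
        (LinearMap.codRestrict _ ((rowL 1).comp (toricEnvelope W).subtype) fun x =>
          (mem_toricEnvelope.mp x.2).2 1 (by decide))
        (LinearMap.prod
          (LinearMap.codRestrict _ ((rowL 2).comp (toricEnvelope W).subtype) fun x =>
            (mem_toricEnvelope.mp x.2).2 2 (by decide))
          (LinearMap.codRestrict _ ((rowL 3).comp (toricEnvelope W).subtype) fun x =>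
            (mem_toricEnvelope.mp x.2).2 3 (by decide))), fun x y hxy => ?_⟩
    have e1 : row (x : Fin 4 × Fin 4 → K) 1 = row (y : Fin 4 × Fin 4 → K) 1 :=
      congrArg (fun z => ((z.1 : ↥(W.map (rowL (K := K) 1))) : Fin 4 → K)) hxy
    have e2 : row (x : Fin 4 × Fin 4 → K) 2 = row (y : Fin 4 × Fin 4 → K) 2 :=
      congrArg (fun z => ((z.2.1 : ↥(W.map (rowL (K := K) 2))) : Fin 4 → K)) hxy
    have e3 : row (x : Fin 4 × Fin 4 → K) 3 = row (y : Fin 4 × Fin 4 → K) 3 :=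
      congrArg (fun z => ((z.2.2 : ↥(W.map (rowL (K := K) 3))) : Fin 4 → K)) hxy
    apply Subtype.ext
    funext ⟨i, j⟩
    have hx0 := (mem_toricEnvelope.mp x.2).1
    have hy0 := (mem_toricEnvelope.mp y.2).1
    rcases fin4_cases i with rfl | rfl | rfl | rfl
    · exact (congrFun hx0 j).trans (congrFun hy0 j).symm
    · exact congrFun e1 j
    · exact congrFun e2 j
    · exact congrFun e3 j
  calc finrank K (toricEnvelope W)
      ≤ finrank K (↥(W.map (rowL (K := K) 1)) × (↥(W.map (rowL (K := K) 2)) × ↥(W.map (rowL (K := K) 3)))) :=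
        LinearMap.finrank_le_finrank_of_injective hF
    _ = _ := by rw [Module.finrank_prod, Module.finrank_prod]

/-- **§3.8 TORIC PRODUCT STRUCTURE — PROVED** (rev 2.1; was `stub_toricStructure`). -/
theorem toricStructure : ToricStructure K := by
  intro W h6 h0 hle
  have hWV : W ≤ toricEnvelope W := le_toricEnvelope h0
  have hWle : finrank K W ≤ finrank K (toricEnvelope W) := Submodule.finrank_mono hWV
  have hV := finrank_toricEnvelope_le W
  have h1 := hle 1 (by decide)
  have h2 := hle 2 (by decide)
  have h3 := hle 3 (by decide)
  have n1 : finrank K (W.map (rowL 1)) = 2 := by omega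
  have n2 : finrank K (W.map (rowL 2)) = 2 := by omega
  have n3 : finrank K (W.map (rowL 3)) = 2 := by omega
  refine ⟨fun i hi => ?_, fun x hx0 hx => ?_⟩
  · rcases fin4_cases i with rfl | rfl | rfl | rfl
    · exact absurd rfl hi
    · exact n1
    · exact n2
    · exact n3
  · have hEq : W = toricEnvelope W := Submodule.eq_of_le_of_finrank_le hWV (by omega)
    rw [hEq]
    exact ⟨hx0, hx⟩

/-- The `4 × 4` array with rows `0, a₁, a₂, a₃`. -/
def mk4 (a₁ a₂ a₃ : Fin 4 → K) : Fin 4 × Fin 4 → K :=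
  fun ij => ![(0 : Fin 4 → K), a₁, a₂, a₃] ij.1 ij.2

@[simp] theorem row_mk4_zero (a₁ a₂ a₃ : Fin 4 → K) : row (mk4 a₁ a₂ a₃) 0 = 0 := rfl
@[simp] theorem row_mk4_one (a₁ a₂ a₃ : Fin 4 → K) : row (mk4 a₁ a₂ a₃) 1 = a₁ := rfl
@[simp] theorem row_mk4_two (a₁ a₂ a₃ : Fin 4 → K) : row (mk4 a₁ a₂ a₃) 2 = a₂ := rfl
@[simp] theorem row_mk4_three (a₁ a₂ a₃ : Fin 4 → K) : row (mk4 a₁ a₂ a₃) 3 = a₃ := rfl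

/-- Row spaces have dimension `≤ 4`. -/
theorem finrank_rowSpace_le (W : Submodule K (Fin 4 × Fin 4 → K)) (i : Fin 4) :
    finrank K (W.map (rowL i)) ≤ 4 := by
  calc finrank K (W.map (rowL i)) ≤ finrank K (Fin 4 → K) := Submodule.finrank_le _
    _ = 4 := Module.finrank_fin_fun K

/-- **`residueNorm_of`** (PROVED): the normal-form residue theorem from the three cases
(trichotomy on the live row-space dimensions + the toric glue). -/
theorem residueNorm_of [CharZero K] (h4 : CaseFour K) (h3 : CaseThree K) (hT : ToricStructure K)
    (hTT : ToricTriple K) : ResidueNorm K := by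
  intro W hN
  obtain ⟨hS, h6, h0⟩ := hN
  by_cases hex4 : ∃ i : Fin 4, i ≠ 0 ∧ W.map (rowL i) = ⊤
  · obtain ⟨i, hi, htop⟩ := hex4
    refine h4 W (Equiv.swap 1 i) ⟨hS, h6, h0⟩ ?_ (by simpa using htop)
    exact Equiv.swap_apply_of_ne_of_ne (by decide) hi.symm
  push Not at hex4
  have hle3 : ∀ i : Fin 4, i ≠ 0 → finrank K (W.map (rowL i)) ≤ 3 := by
    intro i hi
    have hle := finrank_rowSpace_le W i
    rcases Nat.lt_or_ge (finrank K (W.map (rowL i))) 4 with h | h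
    · omega
    · exfalso
      refine hex4 i hi (Submodule.eq_top_of_finrank_eq ?_)
      rw [Module.finrank_fin_fun]; omega
  by_cases hex3 : ∃ i : Fin 4, i ≠ 0 ∧ finrank K (W.map (rowL i)) = 3
  · obtain ⟨i, hi, h3i⟩ := hex3
    have hTZ := h3 W (Equiv.swap 1 i) ⟨hS, h6, h0⟩
      (Equiv.swap_apply_of_ne_of_ne (by decide) hi.symm) hle3 (by rw [Equiv.swap_apply_left]; exact h3i)
    exact Or.inr (Or.inl hTZ)
  push Not at hex3
  have hle2 : ∀ i : Fin 4, i ≠ 0 → finrank K (W.map (rowL i)) ≤ 2 := by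
    intro i hi
    have := hle3 i hi
    have := hex3 i hi
    omega
  -- toric case
  obtain ⟨hdim, hprod⟩ := hT W h6 h0 hle2
  have hvan : ∀ a₁ ∈ W.map (rowL 1), ∀ a₂ ∈ W.map (rowL 2), ∀ a₃ ∈ W.map (rowL 3), ∀ l,
      T3 a₁ a₂ a₃ l = 0 := by
    intro a₁ h₁ a₂ h₂ a₃ h₃ l
    have hx : mk4 a₁ a₂ a₃ ∈ W := by
      refine hprod _ (row_mk4_zero _ _ _) fun i hi => ?_
      rcases fin4_of_perm (Equiv.refl _) i with rfl | rfl | rfl | rfl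
      · exact absurd rfl hi
      · simpa using h₁
      · simpa using h₂
      · simpa using h₃
    simpa using T3_eq_zero_of_sing3 hS hx 1 2 3 (by decide) (by decide) (by decide) l
  obtain ⟨p, q, hpq, hA₁, hA₂, hA₃⟩ :=
    hTT _ _ _ (hdim 1 (by decide)) (hdim 2 (by decide)) (hdim 3 (by decide)) hvan
  refine Or.inr (Or.inr (Or.inl ⟨p, q, hpq, fun x hx i => ?_⟩))
  by_cases hi : i = 0
  · subst hi; exact ⟨congrFun (h0 x hx) p, congrFun (h0 x hx) q⟩
  · have hm : row x i ∈ W.map (rowL i) := Submodule.mem_map_of_mem hx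
    rcases fin4_of_perm (Equiv.refl _) i with rfl | rfl | rfl | rfl
    · exact absurd rfl hi
    · exact hA₁ _ (by simpa using hm)
    · exact hA₂ _ (by simpa using hm)
    · exact hA₃ _ (by simpa using hm)

/-- **Leaf 2 assembled** (PROVED): the one-zero-line residue from `Transport` and the cases. -/
theorem zeroLineResidue_of [CharZero K] (hTr : Transport K) (h4 : CaseFour K) (h3 : CaseThree K)
    (hT : ToricStructure K) (hTT : ToricTriple K) :
    ∀ W : Submodule K (Fin 4 × Fin 4 → K), Sing3 W → finrank K W = 6 →
      ((∃ i : Fin 4, ∀ x ∈ W, ∀ j : Fin 4, x (i, j) = 0) ∨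
        (∃ j : Fin 4, ∀ x ∈ W, ∀ i : Fin 4, x (i, j) = 0)) →
      InCross W ∨ TwoZeroRows W ∨ TwoZeroCols W ∨
        VLambdaRows W ∨ VGraphRows W ∨ VLambdaCols W ∨ VGraphCols W :=
  hTr (residueNorm_of h4 h3 hT hTT)

/-- **LEAF 2 — PROVED** (rev 2.5): the statement of rev 1's `stub_zeroLineResidue`, VERBATIM, with NO
`sorry` in its dependency cone (`permOrthPairs`, `toricStructure`, `transport`, the four CASES,
`productAbsorb`, `graphAbsorb_of`, `pureCore`, `perpPlanes`, `toricTriple`: revs 2.1–2.5). -/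
theorem zeroLineResidue [CharZero K] :
    ∀ W : Submodule K (Fin 4 × Fin 4 → K), Sing3 W → finrank K W = 6 →
      ((∃ i : Fin 4, ∀ x ∈ W, ∀ j : Fin 4, x (i, j) = 0) ∨
        (∃ j : Fin 4, ∀ x ∈ W, ∀ i : Fin 4, x (i, j) = 0)) →
      InCross W ∨ TwoZeroRows W ∨ TwoZeroCols W ∨
        VLambdaRows W ∨ VGraphRows W ∨ VLambdaCols W ∨ VGraphCols W :=
  zeroLineResidue_of transport
    (caseFour_of (perpPlanes permOrthPairs)
      (casePure_of pureCore)
      (caseProduct_of productAbsorb) (caseGraph_of (graphAbsorb_of productAbsorb)))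
    (caseThree_of (perpPlanes permOrthPairs))
    toricStructure (toricTriple permOrthPairs)


/-! ## Kernel-checked compositions -/

/-- **T6′ — classification of the `6`-dimensional linear subspaces of `Sing Z(per₄)`** from leaves 1–2
(composition; the unconditional instance is `sixDim_classification` below). -/
theorem sixDim_classification_of [CharZero K]
    (h1 : ∀ W : Submodule K (Fin 4 × Fin 4 → K), Sing3 W → 5 ≤ finrank K W →
      InCross W ∨ (∃ i : Fin 4, ∀ x ∈ W, ∀ j : Fin 4, x (i, j) = 0) ∨
        (∃ j : Fin 4, ∀ x ∈ W, ∀ i : Fin 4, x (i, j) = 0))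
    (h2 : ∀ W : Submodule K (Fin 4 × Fin 4 → K), Sing3 W → finrank K W = 6 →
      ((∃ i : Fin 4, ∀ x ∈ W, ∀ j : Fin 4, x (i, j) = 0) ∨
        (∃ j : Fin 4, ∀ x ∈ W, ∀ i : Fin 4, x (i, j) = 0)) →
      InCross W ∨ TwoZeroRows W ∨ TwoZeroCols W ∨
        VLambdaRows W ∨ VGraphRows W ∨ VLambdaCols W ∨ VGraphCols W) :
    ∀ W : Submodule K (Fin 4 × Fin 4 → K), Sing3 W → finrank K W = 6 →
      InCross W ∨ TwoZeroRows W ∨ TwoZeroCols W ∨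
        VLambdaRows W ∨ VGraphRows W ∨ VLambdaCols W ∨ VGraphCols W := by
  intro W hS h6
  rcases h1 W hS (by omega) with hX | hrow | hcol
  · exact Or.inl hX
  · exact h2 W hS h6 (Or.inl hrow)
  · exact h2 W hS h6 (Or.inr hcol)

/-- **THEOREM A (T6′) — PROVED, no hypotheses, no `sorry`** (rev 2.6).  Over a field of
characteristic `0`, every `6`-dimensional linear subspace `W` of `Sing Z(per₄)` (all `3 × 3`
subpermanents vanish on `W`) lies in a cross, or has two identically-zero rows, or two identically-zero
columns, or is one of the exotic one-zero-line families `V_Λ` / `V_gr` (rows or columns).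
`sixDim_classification_of zeroLine zeroLineResidue`; `#print axioms`: `propext`, `Classical.choice`,
`Quot.sound`.  (Not a lower bound: the LIST below still rests on leaves 3–5.) -/
theorem sixDim_classification [CharZero K] :
    ∀ W : Submodule K (Fin 4 × Fin 4 → K), Sing3 W → finrank K W = 6 →
      InCross W ∨ TwoZeroRows W ∨ TwoZeroCols W ∨
        VLambdaRows W ∨ VGraphRows W ∨ VLambdaCols W ∨ VGraphCols W :=
  sixDim_classification_of zeroLine zeroLineResidue

/-- Corollary (T5): a `5`-dimensional `W ⊆ Sing Z(per₄)` already lies in a cross or has a zero line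
(`zeroLine` is stated for `dim ≥ 5`). -/
theorem fiveDim_crossOrZeroLine [CharZero K] (W : Submodule K (Fin 4 × Fin 4 → K)) (hS : Sing3 W)
    (h5 : 5 ≤ finrank K W) :
    InCross W ∨ (∃ i : Fin 4, ∀ x ∈ W, ∀ j : Fin 4, x (i, j) = 0) ∨
      (∃ j : Fin 4, ∀ x ∈ W, ∀ i : Fin 4, x (i, j) = 0) :=
  zeroLine W hS h5

end Summit.ValiantsHypothesis.ValiantsHypothesis.Cruxes.SdcSuperquadratic.SingSixClassification

end
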